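import Mathlib
import Literature.Analysis.FluidPDE.TypeIAncientMild
import Literature.Analysis.FluidPDE.OseenMildUniqueness
import Literature.Analysis.FluidPDE.KNSSOseenMildDecayTools
import Literature.Analysis.FluidPDE.KatoSymmetryCovariance
import Literature.Analysis.FluidPDE.CurlFreeLiouville
import Literature.Analysis.FluidPDE.VorticityCalculus
import Literature.Analysis.FluidPDE.VectorCalculusProofs
import Literature.Analysis.FluidPDE.Vorticity
import Literature.Analysis.FluidPDE.SpaceTimeCalculusC1
import Literature.Analysis.FluidPDE.VectorCalculus
import Literature.Analysis.FluidPDE.SpaceTimeMollifier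
import Literature.Analysis.FluidPDE.TaoEnstrophyLocalisationProofs
import Literature.Analysis.FluidPDE.NSBoundedMildAnalytic
import Literature.Analysis.FluidPDE.KNSSTypeIRateLiouvilleMild
import Literature.Analysis.FluidPDE.KNSSTypeIRateMildProofs
import Literature.Analysis.FluidPDE.ClassicalSolutionRescale
import Literature.Analysis.FluidPDE.BlowupAncientSolution
import Literature.Analysis.FluidPDE.TaoEnstrophyLocalisation
import Literature.Analysis.FluidPDE.SuitableWeak
import Literature.Analysis.FluidPDE.SelfSimilar
import Literature.Analysis.FluidPDE.LocalTypeI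
import Literature.Analysis.FluidPDE.NSBoundedMildSmoothing
import Literature.Analysis.FluidPDE.KNSSSmoothingHolds
import Literature.Analysis.UnboundedOperators.HeatKernel
import Literature.Analysis.FluidPDE.IsometryInvariance
import Literature.Analysis.FluidPDE.OseenZoomCovariance
import Literature.Analysis.FluidPDE.KNSSTypeIRateLiouvilleHolds
import Literature.Analysis.FluidPDE.NSLocalLerayBackwardUniqueness
import Literature.Analysis.FluidPDE.DirectionDissipation
import Literature.Analysis.FluidPDE.PoincareBall
import Literature.Analysis.FunctionSpaces.MorreyConvexDomain
import Literature.Analysis.FluidPDE.AxisymmetricHeatFlow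
import Literature.Analysis.FluidPDE.BallCutoff
import Literature.Analysis.FluidPDE.ChaeWolfRemovingDSSBounds
import Literature.Analysis.FluidPDE.NSLerayExistenceR3Holds
import Literature.Analysis.FluidPDE.LerayGaugeStrainSpectrum
import Literature.Analysis.FluidPDE.LocalTypeIPersistenceHolds
import Mathlib.MeasureTheory.Function.ConvergenceInMeasure
import Literature.Analysis.FluidPDE.TypeIAncientMildClassical
import Mathlib.Analysis.Calculus.IteratedDeriv.Lemmas
import Mathlib.Analysis.Calculus.MeanValue
import Mathlib.Analysis.Analytic.Constructions
import Literature.Analysis.FluidPDE.DongZhangTimeAnalyticityProofs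
import Literature.Analysis.FunctionSpaces.ContDiffHolderOne
import Literature.Analysis.FluidPDE.DerivativeHolderInterpolation
import Mathlib.Analysis.Calculus.UniformLimitsDeriv
import Literature.Analysis.FluidPDE.NormalisedPressureLpClass
import Literature.Analysis.FluidPDE.LocalPressureOscillation
import Literature.Analysis.FluidPDE.LerayPressureDecayProofs
import Mathlib.Analysis.Calculus.BumpFunction.FiniteDimension
import Literature.Analysis.FluidPDE.NSLerayBlowupRateTopHolds
import Mathlib.Analysis.SpecialFunctions.Pow.Real
import Literature.Analysis.FluidPDE.SwirlMaximumPrinciple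
import Literature.Analysis.FluidPDE.KNSSProp41MildHolds
import Literature.Analysis.FluidPDE.NSCriticalClosureBesovKatoClass
import Literature.Analysis.FluidPDE.PineauVicolPressureIdentification
import Literature.Analysis.FluidPDE.LocalTypeICongr
import Mathlib.Analysis.SpecialFunctions.Pow.Deriv
import Literature.Analysis.FluidPDE.NSVorticityBKMContinuation
import Literature.Analysis.FluidPDE.VorticityFormulationHolds
import Literature.Analysis.FluidPDE.ConstantinDirectionDissipationCalculus
import Literature.Analysis.FluidPDE.LambFormCurlKernel
import Mathlib.MeasureTheory.Integral.MeanInequalities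
import Literature.Analysis.FluidPDE.LocalTypeICharacterization
import Literature.Analysis.FluidPDE.MorreyLargeScale
import Literature.Analysis.FluidPDE.SereginSverakPressureLocalTypeI
import Mathlib.Analysis.Convex.SpecificFunctions.Basic
import Literature.Analysis.FluidPDE.GigaMiura2011TypeIZoomKit
import Literature.Analysis.FluidPDE.GigaMiura2011DirectionGradientCriterion
import HarnessLib

/-!
# Giga–Miura 2011 via the Type-I zoom kit, file 2 of 2: clock-ceiling invariance, aligned-window rigidity, the direction-gradient selection — `gigaMiura2011_directionGradient_typeI` and `…_LaLb_typeI` HOLD (re-homed proofs)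

**Y. Giga, H. Miura, *On vorticity directions near singularities for the Navier–Stokes flows with infinite energy*, Comm. Math.
Phys. 303 (2011), Cor. 2.6 with Rmk. 2.7 (§2.1) [GigaMiura2011]: for a classical Leray–Hopf solution on `ℝ³ × [0,T)`, bounded on
every `[0,T']`, whose possible blow-up at `T` is of Type I, a square-integrable-in-time `L^∞` bound on the gradient of the vorticity
direction over the top region `{|ω| > d}` excludes blow-up (`u` continues past `T`); and the `L^a_t L^b_x` member of the scaling-invariant
family `2/a + 3/b = 1` (Rmk. 2.8).**  The two named facts `Literature.Analysis.FluidPDE.gigaMiura2011_directionGradient_typeI`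
(`GigaMiura2011DirectionGradientCriterion.lean`) and `…gigaMiura2011_directionGradient_LaLb_typeI` are PROVED in the tree by the
Navier–Stokes cell's Type-I zoom kit (Koch–Nadirashvili–Seregin–Šverák 2009 style rescaling at a singular point, extraction of a
bounded ancient mild limit, persistence of the direction-gradient hypothesis under the zoom, a Liouville theorem for ancient
solutions with slice-wise parallel vorticity, contradiction) — until now Summits-side only
(`Summits/NavierStokesRegularity/NavierStokesRegularity/Theorems/ScaledTopAlignmentGigaMiuraDirectionGradient{,LaLb}Holds.lean`).
RE-HOMED into `Literature/` by the Hodge foundations lane (`lit-hodgefound`, prover p20, generation 39) as TWO files: verbatim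
DECLARATION-LEVEL ports (the declarations the two discharges need, in dependency order; each Part header lists the declarations of
its source module that are NOT carried) of 26 Summits modules `Summits/NavierStokesRegularity/NavierStokesRegularity/Theorems/*.lean`,
namespaces `Summit.NavierStokesRegularity.NavierStokesRegularity.Theorems{,.…}` re-rooted to `Literature.Analysis.NavierStokesZoomKit{,.…}`;
imports from `Literature/` and Mathlib only; no `sorry`, no new axiom, NO named fact (D-0026).  PROVENANCE CONVENTION: docstrings are
carried byte-for-byte; declarations the cell cites keep their cites; `[folklore]`-tagged and untagged declarations (the cell's own
lemmas) carry the Part's tag `[cite: <Key>, <loc> (source of the ARGUMENT implemented / context; this declaration is the cell's own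
lemma, NOT a printed statement)]`, because the gate does not admit a public Literature theorem without a cite tag.  Sibling
Literature-side discharges of the same paper by another seat: `GigaMiura2011ScaledAlignmentTypeIHolds.lean`,
`GigaMiura2011ScaledAlignmentBlowupLimitHolds.lean`, `GigaMiura2011UnidirectionalVorticityHolds.lean` (their primed zoom lemmas are
independent of this port; nothing here redeclares a tree name).

THIS FILE (2 of 2) ports: ClockStretchingLawClockCeilingStubTranslationInvariantAfter, ClockStretchingLawClockCeilingStubSliceInvariantOfCurlParallel, ClockStretchingLawClockCeilingUnidirectionalVorticityLiouville, ScaledTopAlignmentMostTimesEnd, LocalSineTubeDoorProfileAlignedWindowRigidityPlanarity, IsobarTomographyTubeAlternativeStubOseenAncientAnalytic, LocalSineTubeDoorProfileAlignedWindowRigidityAncient, LocalSineTubeDoorProfileAlignedWindowRigidity, ClockStretchingLawClockCeilingSingularStretchingNearZero, ScaledTopAlignmentDirectionGradientSelection, ScaledTopAlignmentGigaMiuraDirectionGradient, ScaledTopAlignmentDirectionGradientLaLbTools, ScaledTopAlignmentGigaMiuraDirectionGradientLaLb.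
-/

noncomputable section

/-!
## Part 1 — port of `Summits/NavierStokesRegularity/NavierStokesRegularity/Theorems/ClockStretchingLawClockCeilingStubTranslationInvariantAfter.lean` (2 declarations kept)

# Crux `ClockStretchingLaw.ClockCeiling` (stmt-NavierStokesRegularity-10570), line `registered`:
# stub `stub_translationInvariantAfter` — translation invariance of a slice propagates forward

For an element `u` of the Type-I ancient mild class `A_C = IsTypeIAncientMild C u` (jointly smooth
on `(-∞,0) × ℝ³`, divergence-free slices, the Oseen integral identity
`u t = e^{(t-s)Δ} u s - B¹_s(u,u)(t)` between all pairs `s < t < 0`, `‖u(t,x)‖ ≤ C/√(-t)`; NO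
symmetry): if ONE slice `u s` (`s < 0`) is invariant under the translation `x ↦ x + b`, then
every later slice `u t`, `s < t < 0`, is invariant under it.

Proof (the step "symmetries of the data are inherited by the unique solution", here for the
Oseen integral equation; Koch–Nadirashvili–Seregin–Šverák 2009, §1 p. 3 (symmetries) and §3–§4
(uniqueness of bounded mild solutions by the fixed point in `L^∞_{x,t}`)):

* `translationInvariantAfter_isTypeIAncientMild_comp_add_right` — the translate
  `v(τ, y) = u(τ, y + b)` is again in `A_C` (the heat flow and the Oseen–Duhamel term commute with
  translations: `heatFlow_comp_add_right`, `oseenDuhamel_comp_add_right`; smoothness, the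
  divergence condition and the `x`-uniform Type-I bound are translation covariant);
* on the slab `(s, t/2) × ℝ³` (`t < t/2 < 0`) both `u` and `v` are bounded by `C/√(-(t/2))`,
  jointly measurable, and solve the SAME integral equation from time `s`, because the free terms
  agree: `v s = u s` by the hypothesis. Uniqueness of bounded solutions of the Oseen integral
  equation (`oseenMild_bounded_unique`) gives `u t = v t` a.e., and continuity of both slices
  upgrades this to equality everywhere.

References: G. Koch, N. Nadirashvili, G. Seregin, V. Šverák, *Liouville theorems for the
Navier–Stokes equations and applications*, Acta Math. 203 (2009) = arXiv:0709.3599, §1 p. 3,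
§3 p. 6, §4 p. 8.
-/

section Part1

namespace Literature.Analysis.NavierStokesZoomKit

open _root_.Set _root_.Function _root_.Filter _root_.MeasureTheory
open Literature.Analysis Literature.Analysis.FluidPDE

/-- **`A_C` is invariant under space translations** `u ↦ u(·, · + c)` (same constant): joint
smoothness and the divergence condition are translation covariant, the heat flow and the
Oseen–Duhamel term commute with translations (`heatFlow_comp_add_right`,
`oseenDuhamel_comp_add_right`), and the Type-I bound is uniform in `x` (KNSS 2009, §1 p. 3: the
symmetries of the problem). [cite: KochNadirashviliSereginSverak2009, §1 p. 3 (arXiv:0709.3599)] -/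
theorem translationInvariantAfter_isTypeIAncientMild_comp_add_right {C : ℝ}
    {u : ℝ → EuclideanSpace ℝ (Fin 3) → EuclideanSpace ℝ (Fin 3)} (h : IsTypeIAncientMild C u)
    (c : EuclideanSpace ℝ (Fin 3)) : IsTypeIAncientMild C (fun t x => u t (x + c)) := by
  refine ⟨?_, fun t ht => (h.isDivFree ht).comp_add_right c, fun s t hst ht x => ?_,
    fun t ht x => h.norm_le ht (x + c)⟩
  · have e : (uncurry fun t x => u t (x + c)) =
        uncurry u ∘ fun p : ℝ × EuclideanSpace ℝ (Fin 3) => (p.1, p.2 + c) := by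
      funext p
      rfl
    rw [e]
    refine h.contDiffOn.comp
      ((contDiff_fst.prodMk (contDiff_snd.add contDiff_const)).contDiffOn) ?_
    intro p hp
    exact mem_prod.2 ⟨(mem_prod.1 hp).1, mem_univ _⟩
  · show u t (x + c) = heatFlow (fun y => u s (y + c)) (t - s) x -
        oseenDuhamel 1 s (fun τ y => u τ (y + c)) (fun τ y => u τ (y + c)) t x
    rw [heatFlow_comp_add_right, oseenDuhamel_comp_add_right]
    exact h.mild_eq hst ht (x + c)

/-- **Stub `stub_translationInvariantAfter` — translation invariance of one slice propagates
forward in `A_C`.** For `u ∈ A_C`, `s < 0`, `b ∈ ℝ³` with `u(s, x + b) = u(s, x)` for all `x`: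
`u(t, x + b) = u(t, x)` for all `s < t < 0` and all `x`. Proof: the translate
`v(τ, y) = u(τ, y + b)` lies in `A_C` (`translationInvariantAfter_isTypeIAncientMild_comp_add_right`)
and has the same slice at time `s`; on the slab `(s, t/2) × ℝ³` both fields are bounded by
`C/√(-(t/2))`, jointly measurable, and solve the same Oseen integral equation from time `s`, so
`u t = v t` a.e. by uniqueness of bounded Oseen-mild solutions (`oseenMild_bounded_unique`,
KNSS 2009 §3–§4), hence everywhere by continuity of the two slices. [cite: KochNadirashviliSereginSverak2009, §1 p. 3 and §4 (4.3)–(4.4) (arXiv:0709.3599 p. 8)] -/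
theorem stub_translationInvariantAfter : ∀ (C : ℝ) (u : ℝ → EuclideanSpace ℝ (Fin 3) → EuclideanSpace ℝ (Fin 3)), Literature.Analysis.FluidPDE.IsTypeIAncientMild C u → ∀ (s : ℝ) (b : EuclideanSpace ℝ (Fin 3)), s < 0 → (∀ x, u s (x + b) = u s x) → ∀ t : ℝ, s < t → t < 0 → ∀ x, u t (x + b) = u t x := by
  intro C u h s b _hs hb t hst ht x
  -- the translate `v τ y = u τ (y + b)` is again in the class, with the same slice at time `s`
  have hv : IsTypeIAncientMild C (fun τ y => u τ (y + b)) :=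
    translationInvariantAfter_isTypeIAncientMild_comp_add_right h b
  have hvs : (fun y => u s (y + b)) = u s := funext hb
  -- the slab `(s, t / 2)`
  have hT0 : t / 2 < 0 := by linarith
  have htI : t ∈ Ioo s (t / 2) := ⟨hst, by linarith⟩
  have hM : 0 ≤ C / Real.sqrt (-(t / 2)) := div_nonneg h.nonneg (Real.sqrt_nonneg _)
  have huM : ∀ τ ∈ Ioo s (t / 2), ∀ y, ‖u τ y‖ ≤ C / Real.sqrt (-(t / 2)) :=
    fun τ hτ y => h.norm_le_of_mem_Ioo hT0 hτ y
  have hvM : ∀ τ ∈ Ioo s (t / 2), ∀ y,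
      ‖(fun τ y => u τ (y + b)) τ y‖ ≤ C / Real.sqrt (-(t / 2)) :=
    fun τ hτ y => hv.norm_le_of_mem_Ioo hT0 hτ y
  have hum := h.aestronglyMeasurable_uncurry (s := s) hT0.le
  have hvm := hv.aestronglyMeasurable_uncurry (s := s) hT0.le
  -- the two integral equations with the common free term `e^{(τ-s)Δ} u(s)`
  have hu : ∀ τ ∈ Ioo s (t / 2), u τ =ᵐ[volume] fun y =>
      UnboundedOperators.heatExtension (u s) (τ - s) y - oseenDuhamel 1 s u u τ y :=
    fun τ hτ => Eventually.of_forall fun y => h.mild_eq_heatExtension hτ.1 (hτ.2.trans hT0) y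
  have hv' : ∀ τ ∈ Ioo s (t / 2), (fun τ y => u τ (y + b)) τ =ᵐ[volume] fun y =>
      UnboundedOperators.heatExtension (u s) (τ - s) y -
        oseenDuhamel 1 s (fun τ y => u τ (y + b)) (fun τ y => u τ (y + b)) τ y := by
    intro τ hτ
    refine Eventually.of_forall fun y => ?_
    have key := hv.mild_eq_heatExtension hτ.1 (hτ.2.trans hT0) y
    rw [hvs] at key
    exact key
  have hae := oseenMild_bounded_unique one_pos hM hum hvm huM hvM hu hv' t htI
  have heq := (Continuous.ae_eq_iff_eq volume (h.continuous_slice ht) (hv.continuous_slice ht)).1 hae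
  exact (congr_fun heq x).symm

end Literature.Analysis.NavierStokesZoomKit

end Part1

/-!
## Part 2 — port of `Summits/NavierStokesRegularity/NavierStokesRegularity/Theorems/ClockStretchingLawClockCeilingStubSliceInvariantOfCurlParallel.lean` (4 declarations kept)

# Crux `ClockStretchingLaw.ClockCeiling` (stmt-NavierStokesRegularity-10570), line `registered`:
# stub `stub_sliceInvariantOfCurlParallel` — the Giga–Miura slice lemma

A bounded `C²` divergence-free field `v : ℝ³ → ℝ³` whose curl is everywhere parallel to a fixed
vector `e ≠ 0` is invariant under every translation along the line `ℝ e`: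
`v (x + h e) = v x` for all `x`, `h`. This is the pure vector-calculus core of the step
"the vorticity points in one fixed direction, hence the (blow-up limit) flow is two-dimensional"
of Giga–Miura 2011 (Comm. Math. Phys. 303, proof of Thm 1.1), restated in Giga–Gu–Hsu 2019,
§2.4 (p. 7), here for a single time slice and without any equation.

Proof. Write `curl v = a e` with the `C¹` scalar `a = ⟪e, curl v⟫ / ‖e‖²`. Since
`div (curl v) = 0` (`divergence_curl_eq_zero_holds`) and `div (a e) = ∂ₑ a`, the derivative of
`t ↦ a (x + t e)` vanishes, so `a`, hence `curl v`, is invariant under the translations along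
`e`. For fixed `h` the increment `z = v(· + h e) - v` is `C²`, bounded by `2M`, divergence free
and curl free, hence constant (`eq_of_curl_eq_zero_of_isDivFree_of_bounded`, the Liouville
theorem for the system `curl z = 0`, `div z = 0` of KNSS 2009, Lemma 3.1); iterating,
`v (x + n h e) - v x = n c` stays bounded by `2M` for all `n : ℕ`, so the constant `c` is `0`.

What is NOT here: anything about the time variable or the Navier–Stokes equations (the
neighbouring stubs of the line carry the dynamics).

References: Y. Giga, H. Miura, Comm. Math. Phys. 303 (2011) 289–300, proof of Thm 1.1;
Y. Giga, Z. Gu, P.-Y. Hsu, Nonlinear Anal. 189 (2019) 111579, §2.4; G. Koch, N. Nadirashvili,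
G. Seregin, V. Šverák, Acta Math. 203 (2009), Lemma 3.1.
-/

section Part2

namespace Literature.Analysis.NavierStokesZoomKit

open Literature.Analysis.FluidPDE
open scoped RealInnerProductSpace

/-- **Curl of a translate**: `curl (v(· + a))(x) = (curl v)(x + a)`, no differentiability
hypothesis (the Jacobian of a translate is the translated Jacobian, Mathlib's
`fderiv_comp_add_right`; re-proof of the tree's `curl_comp_add_const` of `FlatSwirlGauge`,
kept private to avoid that file's import cone). [folklore] -/
private theorem curl_comp_add_const_aux
    (v : EuclideanSpace ℝ (Fin 3) → EuclideanSpace ℝ (Fin 3)) (a x : EuclideanSpace ℝ (Fin 3)) :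
    curl (fun y => v (y + a)) x = curl v (x + a) := by
  -- adapted from `curl_comp_add_const` (`FlatSwirlGauge`)
  simp only [curl, fderiv_comp_add_right]

/-- **Divergence of `g e`**: for a scalar `g` differentiable at `x` and a fixed vector `e`,
`div (g e)(x) = ∂ₑ g (x) = Dg(x) e` (the trace of the rank-one map `Dg(x) ⊗ e`; re-proof of the
tree's `divergence_smul_const_eq_fderiv_apply` of `PressureDeterminedUpToTime`, kept private to
avoid that file's import cone). [folklore] -/
private theorem divergence_smul_const_aux {g : EuclideanSpace ℝ (Fin 3) → ℝ}
    {x : EuclideanSpace ℝ (Fin 3)} (hg : DifferentiableAt ℝ g x) (e : EuclideanSpace ℝ (Fin 3)) :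
    VectorCalculus.divergence (fun y => g y • e) x = fderiv ℝ g x e := by
  -- adapted from `divergence_smul_const_eq_fderiv_apply` (`PressureDeterminedUpToTime`)
  set b := stdOrthonormalBasis ℝ (EuclideanSpace ℝ (Fin 3)) with hb
  rw [divergence_eq_sum_inner_fderiv b]
  have hD : fderiv ℝ (fun y => g y • e) x = (fderiv ℝ g x).smulRight e :=
    (hg.hasFDerivAt.smul_const e).fderiv
  simp only [hD, ContinuousLinearMap.smulRight_apply, inner_smul_right]
  calc ∑ i, fderiv ℝ g x (b i) * ⟪b i, e⟫ = fderiv ℝ g x (∑ i, ⟪b i, e⟫ • b i) := by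
        rw [map_sum]
        refine Finset.sum_congr rfl fun i _ => ?_
        rw [map_smul, smul_eq_mul, mul_comm]
    _ = fderiv ℝ g x e := by rw [b.sum_repr' e]

/-- **Bounded fields have no constant non-zero increments**: if `‖v‖ ≤ M` and
`v (x + b) - v x = κ` for all `x`, then `κ = 0` (by induction `v (x + n b) - v x = n κ`, whose norm
is at most `2M` for every `n : ℕ`; Archimedes). [folklore] -/
private theorem eq_zero_of_forall_comp_add_sub_eq
    {v : EuclideanSpace ℝ (Fin 3) → EuclideanSpace ℝ (Fin 3)} {M : ℝ} (hM : ∀ x, ‖v x‖ ≤ M)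
    {b κ : EuclideanSpace ℝ (Fin 3)} (h : ∀ x, v (x + b) - v x = κ) : κ = 0 := by
  -- adapted from `eq_zero_of_ae_comp_add_sub_eq_const_of_norm_le` (`AncientMildDirectionalInvariance`)
  have hiter : ∀ (n : ℕ) (x : EuclideanSpace ℝ (Fin 3)),
      v (x + (n : ℝ) • b) - v x = (n : ℝ) • κ := by
    intro n
    induction n with
    | zero => intro x; simp
    | succ n ih =>
      intro x
      have e1 : x + ((n : ℝ) + 1) • b = x + b + (n : ℝ) • b := by
        rw [add_smul, one_smul]; abel
      simp only [Nat.cast_succ, e1]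
      calc v (x + b + (n : ℝ) • b) - v x
          = (v (x + b + (n : ℝ) • b) - v (x + b)) + (v (x + b) - v x) := by abel
        _ = (n : ℝ) • κ + κ := by rw [ih (x + b), h x]
        _ = ((n : ℝ) + 1) • κ := by rw [add_smul, one_smul]
  have hbd : ∀ n : ℕ, (n : ℝ) * ‖κ‖ ≤ 2 * M := by
    intro n
    have h2 : ‖(n : ℝ) • κ‖ ≤ 2 * M := by
      rw [← hiter n 0]
      exact (norm_sub_le _ _).trans (by linarith [hM (0 + (n : ℝ) • b), hM 0])
    rwa [norm_smul, Real.norm_of_nonneg (Nat.cast_nonneg n)] at h2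
  by_contra hκ
  have hκ' : 0 < ‖κ‖ := norm_pos_iff.2 hκ
  obtain ⟨n, hn⟩ := exists_nat_gt (2 * M / ‖κ‖)
  have h3 := hbd n
  rw [div_lt_iff₀ hκ'] at hn
  linarith

/-- **Stub `stub_sliceInvariantOfCurlParallel` — the Giga–Miura slice lemma.** A bounded `C²`
divergence-free field `v` on `ℝ³` whose curl is everywhere parallel to a fixed `e ≠ 0` satisfies
`v (x + h e) = v x` for all `x`, `h`. Proof: with `a = ⟪e, curl v⟫ / ‖e‖²` one has `curl v = a e`,
`∂ₑ a = div (a e) = div (curl v) = 0`, so `a` and `curl v` are invariant along `e`; the increment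
`v(· + h e) - v` is then a bounded `C²` field with `curl = 0`, `div = 0`, hence a constant
(`eq_of_curl_eq_zero_of_isDivFree_of_bounded`, KNSS 2009 Lemma 3.1), and a bounded field has no
non-zero constant increment. This is the vector-calculus core of "the vorticity points in one
direction, so the limit flow is two-dimensional" (Giga–Miura 2011, proof of Thm 1.1, as restated
in Giga–Gu–Hsu 2019, §2.4). [cite: GigaGuHsu2019, §2.4 p. 7 (restating Giga–Miura 2011 proof of Thm 1.1)] -/
theorem stub_sliceInvariantOfCurlParallel : ∀ (v : EuclideanSpace ℝ (Fin 3) → EuclideanSpace ℝ (Fin 3)), ContDiff ℝ 2 v → Literature.Analysis.FluidPDE.VectorCalculus.IsDivFree v → (∃ M : ℝ, ∀ x, ‖v x‖ ≤ M) → ∀ e : EuclideanSpace ℝ (Fin 3), e ≠ 0 → (∀ x, ∃ a : ℝ, Literature.Analysis.FluidPDE.curl v x = a • e) → ∀ (x : EuclideanSpace ℝ (Fin 3)) (h : ℝ), v (x + h • e) = v x := by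
  intro v hv hdiv hbdd e he hpar x h
  obtain ⟨M, hM⟩ := hbdd
  -- Step 1: `curl v = a • e` with a `C¹` scalar `a`
  have hcurl1 : ContDiff ℝ 1 (curl v) := contDiff_curl (n := 1) (by exact_mod_cast hv)
  have he2 : ‖e‖ ^ 2 ≠ 0 := pow_ne_zero 2 (norm_ne_zero_iff.2 he)
  obtain ⟨a, ha1, hcurl_eq⟩ : ∃ a : EuclideanSpace ℝ (Fin 3) → ℝ,
      ContDiff ℝ 1 a ∧ ∀ y, curl v y = a y • e := by
    refine ⟨fun y => ⟪e, curl v y⟫ / ‖e‖ ^ 2, (contDiff_const.inner ℝ hcurl1).div_const _,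
      fun y => ?_⟩
    obtain ⟨a₀, ha₀⟩ := hpar y
    show curl v y = (⟪e, curl v y⟫ / ‖e‖ ^ 2) • e
    rw [ha₀, real_inner_smul_right, real_inner_self_eq_norm_sq, mul_div_assoc, div_self he2,
      mul_one]
  have hadiff : Differentiable ℝ a := ha1.differentiable one_ne_zero
  -- Step 2: `∂ₑ a = div (a e) = div (curl v) = 0`
  have hDa : ∀ y, fderiv ℝ a y e = 0 := by
    intro y
    have h0 : VectorCalculus.divergence (curl v) y = 0 := divergence_curl_eq_zero_holds v hv y
    have hfun : curl v = fun z => a z • e := funext hcurl_eq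
    rwa [hfun, divergence_smul_const_aux (hadiff y) e] at h0
  -- Step 3: `a`, hence `curl v`, is invariant under the translations along `e`
  have ha_inv : ∀ (y : EuclideanSpace ℝ (Fin 3)) (s : ℝ), a (y + s • e) = a y := by
    intro y s
    have hline : ∀ t : ℝ,
        HasDerivAt (fun t : ℝ => a (y + t • e)) (fderiv ℝ a (y + t • e) e) t := by
      intro t
      have h1 : HasDerivAt (fun t : ℝ => y + t • e) e t := by
        simpa using ((hasDerivAt_id t).smul_const e).const_add y
      exact (hadiff (y + t • e)).hasFDerivAt.comp_hasDerivAt t h1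
    have hderiv : ∀ t, deriv (fun t : ℝ => a (y + t • e)) t = 0 := fun t => by
      rw [(hline t).deriv, hDa]
    have hdiff : Differentiable ℝ (fun t : ℝ => a (y + t • e)) := fun t =>
      (hline t).differentiableAt
    simpa using is_const_of_deriv_eq_zero hdiff hderiv s 0
  have hcurl_inv : ∀ (y : EuclideanSpace ℝ (Fin 3)) (s : ℝ), curl v (y + s • e) = curl v y :=
    fun y s => by rw [hcurl_eq (y + s • e), hcurl_eq y, ha_inv]
  -- Step 4: the increment `v(· + h e) - v` is `C²`, bounded, curl free and divergence free
  have hvh : ContDiff ℝ 2 (fun y => v (y + h • e)) := hv.comp (contDiff_id.add contDiff_const)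
  have hz2 : ContDiff ℝ 2 (fun y => v (y + h • e) - v y) := hvh.sub hv
  have hzcurl : ∀ y, curl (fun y => v (y + h • e) - v y) y = 0 := by
    intro y
    rw [curl_sub (hvh.differentiable two_ne_zero y) (hv.differentiable two_ne_zero y),
      curl_comp_add_const_aux v (h • e) y, hcurl_inv, sub_self]
  have hzdiv : VectorCalculus.IsDivFree (fun y => v (y + h • e) - v y) := by
    intro y
    have h1 := hdiv (y + h • e)
    have h2 := hdiv y
    simp only [VectorCalculus.divergence] at h1 h2 ⊢
    rw [fderiv_fun_sub (hvh.differentiable two_ne_zero y) (hv.differentiable two_ne_zero y),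
      fderiv_comp_add_right]
    simp [map_sub, h1, h2]
  have hzM : ∀ y, ‖v (y + h • e) - v y‖ ≤ 2 * M := fun y =>
    (norm_sub_le _ _).trans (by linarith [hM (y + h • e), hM y])
  -- Step 5: hence constant (Liouville for `curl z = 0`, `div z = 0`), and the constant is `0`
  have hzconst : ∀ y, v (y + h • e) - v y = v (0 + h • e) - v 0 := fun y =>
    eq_of_curl_eq_zero_of_isDivFree_of_bounded hz2 hzcurl hzdiv hzM y 0
  have hc : v (0 + h • e) - v 0 = 0 := eq_zero_of_forall_comp_add_sub_eq hM hzconst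
  exact sub_eq_zero.1 ((hzconst x).trans hc)

end Literature.Analysis.NavierStokesZoomKit

end Part2

/-!
## Part 3 — port of `Summits/NavierStokesRegularity/NavierStokesRegularity/Theorems/ClockStretchingLawClockCeilingUnidirectionalVorticityLiouville.lean` (1 declarations kept)

# Route ClockStretchingLaw, crux `ClockCeiling` (stmt-NavierStokesRegularity-10570) — the ancient core of
# Giga–Miura's continuous-alignment criterion: a Type-I ancient mild field with unidirectional vorticity
# slices is trivial

Line `registered`, lead c7, stub `stub_unidirectionalVorticityLiouville` (`--supports 10570`).

Giga–Miura (Commun. Math. Phys. 303 (2011), Thm 1.1) prove that a Type-I blow-up of a bounded mild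
solution cannot occur if the vorticity direction `ξ = ω/|ω|` is uniformly continuous in space
("continuous alignment"). The heart of their blow-up argument (Giga–Gu–Hsu 2019, §2.4) is a
Liouville statement for the blow-up limit: an ancient bounded mild solution whose vorticity "points
out just one fixed direction" is two-dimensional and therefore trivial by the planar Liouville
theorem of Koch–Nadirashvili–Seregin–Šverák. This file proves that statement for the tree's Type-I
ancient mild class `A_C = IsTypeIAncientMild C` (KNSS/Oseen gauge), in a form that needs the
direction only slice by slice:

* `unidirectionalVorticityLiouville` — if for every `t < 0` the vorticity `curl u(t, ·)` is
  everywhere parallel to one nonzero vector `e(t)` (allowed to depend on `t`), then `u ≡ 0`;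
* `unidirectionalVorticityLiouville_end` — the same with the hypothesis only on a backward end
  `t < T ≤ 0` (time shift + forward uniqueness);
* `stub_unidirectionalVorticityLiouville` (registered form) and
  `unidirectionalVorticityLiouville_class` (the hypotheses of `ClockCeiling` verbatim).

## Proof

No vorticity equation and no time derivative of `e(t)` is used.
1. Slice lemma (`stub_sliceInvariantOfCurlParallel`, p167542): a bounded `C²` divergence-free field
   on `ℝ³` with `curl v ∥ e` everywhere is invariant under all translations along `ℝe`
   (`div curl = 0` makes `⟪curl v, e⟫` constant along `e`; the increment `v(· + he) − v` is bounded,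
   divergence free and irrotational, hence constant, hence zero).
2. Forward propagation (`stub_translationInvariantAfter`, p167497): translation invariance of one
   slice of `u ∈ A_C` propagates to all later slices (translation covariance of the Oseen identity and
   uniqueness of bounded Oseen-mild solutions). Hence the subspaces
   `W(t) = {b ∈ ℝ³ | u(t, · + h b) = u(t, ·) ∀ h}` are nested, `W(s) ≤ W(t)` for `s < t < 0`, and
   nonzero by step 1.
3. `exists_end_submodule_const`: a nested family of subspaces of `ℝ³` over `t < 0` is constant on a
   far-past end `t < t₁` (integer dimension argument). So `u` is invariant along the FIXED line
   `ℝ e(t₁)` for all `t < t₁`, and the landed 2.5-D leaf `stub_lineLiouvilleEnd` (rotation covariance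
   of `A_C` + KNSS 2009 Thm 5.1 / Remark 6.1) gives `u ≡ 0` before `t₁`; forward uniqueness
   (`vanishes_of_vanishes_before`) finishes.

Consumers: `ClockStretchingLawClockCeilingContinuousAlignmentRegular.lean` (Giga–Miura's Thm 1.1
for the route class: a singular Type-I model has no `t`-uniform spatial modulus of continuity of
`ξ`; `ClockCeiling` holds along continuously aligned elements).

## References

* Y. Giga, H. Miura, *On vorticity directions near singularities for the Navier–Stokes flows with
  infinite energy*, Commun. Math. Phys. 303 (2011) 289–300, Thm 1.1. [GigaMiura2011]
* Y. Giga, Z. Gu, P.-Y. Hsu, *Continuous alignment of vorticity direction prevents the blow-up of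
  the Navier–Stokes flow under the no-slip boundary condition*, Nonlinear Anal. 189 (2019) 111579,
  Thm 1.1 and §2.4 (held: paper:doi-10-1016-j-na-2019-111579, pp. 3, 7). [GigaGuHsu2019]
* G. Koch, N. Nadirashvili, G. Seregin, V. Šverák, Acta Math. 203 (2009) 83–105, Thm 5.1,
  Remark 6.1, §1 (symmetries) (arXiv:0709.3599). [KochNadirashviliSereginSverak2009]

Not carried from this source module (not needed by the declarations re-homed here; their consumers are Summits-side): `unidirectionalVorticityLiouville`, `unidirectionalVorticityLiouville_end`, `stub_unidirectionalVorticityLiouville`, `unidirectionalVorticityLiouville_class`.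
-/

section Part3

open _root_.Set _root_.Function _root_.Filter _root_.Topology _root_.Metric _root_.Module
open scoped RealInnerProductSpace

namespace Literature.Analysis.NavierStokesZoomKit

open Literature.Analysis Literature.Analysis.FluidPDE
open Literature.Analysis.NavierStokesZoomKit.SymmetryModuliCountSymmetricLiouville

/-! ### Nested families of subspaces of `ℝ³` indexed by negative times stabilise in the far past -/

/-- **Stabilisation of a nested family of subspaces.** If `W : ℝ → Submodule ℝ ℝ³` is
non-decreasing along negative times (`W s ≤ W t` for `s < t < 0`), then on some far-past end
`t < t₁ < 0` it is constant: `W t = W t₁`. (The dimension `finrank (W t) ∈ {0,…,3}` is a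
non-decreasing integer function of `t`; at a time `t₁` where it attains its minimum over `t < 0`
every earlier subspace is contained in `W t₁` with the same dimension.) [folklore]
[cite: KochNadirashviliSereginSverak2009, Thm 1.1–1.3 (context: Liouville theorems for ancient solutions; this declaration is the cell’s own lemma or plumbing, NOT a printed statement)] -/
theorem exists_end_submodule_const (W : ℝ → Submodule ℝ (EuclideanSpace ℝ (Fin 3)))
    (hmono : ∀ s t : ℝ, s < t → t < 0 → W s ≤ W t) :
    ∃ t₁ < (0 : ℝ), ∀ t < t₁, W t = W t₁ := by
  classical
  have hP : ∃ n : ℕ, ∃ t < (0 : ℝ), finrank ℝ (W t) = n := ⟨_, -1, by norm_num, rfl⟩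
  obtain ⟨t₁, ht₁, hd⟩ := Nat.find_spec hP
  refine ⟨t₁, ht₁, fun t ht => ?_⟩
  have hle : W t ≤ W t₁ := hmono t t₁ ht ht₁
  refine Submodule.eq_of_le_of_finrank_eq hle (le_antisymm (Submodule.finrank_mono hle) ?_)
  rw [hd]
  exact Nat.find_min' hP ⟨t, ht.trans ht₁, rfl⟩

/-! ### The Liouville theorem -/

end Literature.Analysis.NavierStokesZoomKit

end Part3

/-!
## Part 4 — port of `Summits/NavierStokesRegularity/NavierStokesRegularity/Theorems/ScaledTopAlignmentMostTimesEnd.lean` (1 declarations kept)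

# Route `ScaledTopAlignment`: the NON-UNIDIRECTIONAL END of a non-trivial Type-I ancient mild field, a
# uniform vorticity floor on compact slice intervals, and slice selection under a final-density bound
# (support for the deciding crux W3ʷᵇ = `AprioriWindowBulkAlignment`, stmt-NavierStokesRegularity-19447,
# and its planned MOST-TIMES weakening W3ᵐᵗ; no import of the route file)

Ingredients 2–4 of the most-times glue kit (`ScaledTopAlignmentMostTimesGlueKit`):

* `exists_end_curl_not_unidirectional` — **a non-trivial Type-I ancient mild field has a
  NON-UNIDIRECTIONAL vorticity END**: the lines of translation invariance of the slices form subspaces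
  nested forward in time (forward uniqueness, `stub_translationInvariantAfter`), constant on a far-past
  end (`exists_end_submodule_const`); a non-zero stabilised line would make the field vanish (2.5-D
  Liouville `stub_lineLiouvilleEnd` + `vanishes_of_vanishes_before`), so on that end no slice vorticity
  is parallel to one vector (`stub_sliceInvariantOfCurlParallel`) — the architecture of Giga–Miura 2011
  §2.1 / the tree's `unidirectionalVorticityLiouville` run backwards;
* `exists_curl_floor_Icc` — on a compact slice interval of that end the slice vorticities have a uniform
  amplitude floor (joint continuity + compactness);
* `exists_slice_time_notMem` — a time set of final density `≤ θ` at `T` misses, at every small scale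
  `μ`, the physical time `T + μ s` of some slice `s ∈ (a, b]` whenever `θ|a| < b − a`;
* `tendsto_extend_of_strictMono` — sub-sequence bookkeeping for the diagonal zoom.
WHAT THIS IS NOT: not NS regularity; nothing here proves any door. References: Giga–Miura, CMP 303 (2011)
= HUPS #956, Thm 1.1, §2.1 [GigaMiura2011]; KNSS, Acta Math. 203 (2009), Thm 5.1, §6
[KochNadirashviliSereginSverak2009]; Giga–Gu–Hsu 2019 §2.4 [GigaGuHsu2019].

Not carried from this source module (not needed by the declarations re-homed here; their consumers are Summits-side): `exists_curl_floor_Icc`, `exists_slice_time_notMem`, `tendsto_extend_of_strictMono`.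
-/

section Part4

open _root_.MeasureTheory _root_.Set _root_.Function _root_.Filter _root_.Topology _root_.Metric
open scoped RealInnerProductSpace _root_.ENNReal
namespace Literature.Analysis.NavierStokesZoomKit
open Literature.Analysis Literature.Analysis.FluidPDE
open Literature.Analysis.NavierStokesZoomKit.SymmetryModuliCountSymmetricLiouville

/-! ### A non-trivial Type-I ancient mild field has a non-unidirectional vorticity end -/

/-- **Non-unidirectional end.** If `u ∈ A_C` (`IsTypeIAncientMild C u`) is not identically zero, then
on some far-past end `t < t₁ < 0` NO slice vorticity `curl u(t, ·)` is everywhere parallel to one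
non-zero vector. (Contrapositive-plus-stabilisation form of the tree's `unidirectionalVorticityLiouville`:
the subspaces of invariance lines of the slices are nested forward in time; on the end where they are
constant they must be `{0}`, else the 2.5-D Liouville theorem kills `u`; and a unidirectional slice is
invariant along its direction.) [cite: GigaMiura2011, Thm 1.1 and §2.1 (Commun. Math. Phys. 303 (2011) 289–300)] -/
theorem exists_end_curl_not_unidirectional {C : ℝ}
    {u : ℝ → EuclideanSpace ℝ (Fin 3) → EuclideanSpace ℝ (Fin 3)} (hu : IsTypeIAncientMild C u)
    (hne : ∃ t < (0 : ℝ), ∃ x, u t x ≠ 0) :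
    ∃ t₁ < (0 : ℝ), ∀ t < t₁, ¬ ∃ e : EuclideanSpace ℝ (Fin 3), e ≠ 0 ∧
      ∀ x, ∃ a : ℝ, curl (u t) x = a • e := by
  -- adapted from the tree's `unidirectionalVorticityLiouville` (same submodule family)
  let W : ℝ → Submodule ℝ (EuclideanSpace ℝ (Fin 3)) := fun t =>
    { carrier := {b | ∀ (h : ℝ) (x : EuclideanSpace ℝ (Fin 3)), u t (x + h • b) = u t x}
      add_mem' := fun {a b} ha hb h x => by
        rw [smul_add, ← add_assoc, hb h (x + h • a), ha h x]
      zero_mem' := fun h x => by rw [smul_zero, add_zero]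
      smul_mem' := fun c b hb h x => by rw [smul_smul]; exact hb (h * c) x }
  have hmemW : ∀ (t : ℝ) (b : EuclideanSpace ℝ (Fin 3)),
      b ∈ W t ↔ ∀ (h : ℝ) (x : EuclideanSpace ℝ (Fin 3)), u t (x + h • b) = u t x :=
    fun _ _ => Iff.rfl
  have hmono : ∀ s t : ℝ, s < t → t < 0 → W s ≤ W t := by
    intro s t hst ht b hb
    rw [hmemW] at hb ⊢
    intro h x
    exact stub_translationInvariantAfter C u hu s (h • b) (hst.trans ht) (fun y => hb h y) t hst ht x
  obtain ⟨t₁, ht₁, hconst⟩ := exists_end_submodule_const W hmono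
  refine ⟨t₁, ht₁, fun t ht hdir => ?_⟩
  obtain ⟨e, he, hpar⟩ := hdir
  have ht0 : t < 0 := ht.trans ht₁
  -- the unidirectional slice is invariant along `e`, so `e ∈ W t = W t₁`
  have hinvt : ∀ (h : ℝ) (x : EuclideanSpace ℝ (Fin 3)), u t (x + h • e) = u t x := fun h x =>
    stub_sliceInvariantOfCurlParallel (u t) ((hu.contDiff_slice ht0).of_le (WithTop.coe_le_coe.mpr le_top))
      (hu.isDivFree ht0) ⟨C / Real.sqrt (-t), fun x => hu.norm_le ht0 x⟩ e he hpar x h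
  have heW₁ : e ∈ W t₁ := by rw [← hconst t ht]; exact (hmemW t e).2 hinvt
  -- hence `u` is invariant along `e` on the whole end, and vanishes
  have hinv : ∀ t' < t₁, ∀ (x : EuclideanSpace ℝ (Fin 3)) (s : ℝ), u t' (x + s • e) = u t' x := by
    intro t' ht' x s
    have hmem : e ∈ W t' := by rw [hconst t' ht']; exact heW₁
    exact (hmemW t' e).1 hmem s x
  have hbefore : ∀ t' < t₁, ∀ x, u t' x = 0 := stub_lineLiouvilleEnd C u hu e t₁ he ht₁.le hinv
  obtain ⟨t₀, ht₀, x₀, hx₀⟩ := hne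
  exact hx₀ (vanishes_of_vanishes_before hu ht₁ hbefore t₀ ht₀ x₀)

end Literature.Analysis.NavierStokesZoomKit

end Part4

/-!
## Part 5 — port of `Summits/NavierStokesRegularity/NavierStokesRegularity/Theorems/LocalSineTubeDoorProfileAlignedWindowRigidityPlanarity.lean` (7 declarations kept)

# Route `LocalSineTubeDoor`, crux `ProfileAlignedWindowRigidity` (stmt-NavierStokesRegularity-20018) —
# support file 1/3: slice calculus (analyticity of `curl`, identity-theorem spreading, slice planarity)

Port to `Theorems/` of the slice-level part of the cell proof
`Summit.NavierStokesRegularity.NavierStokesRegularity.Cell.NsRegP1c.profileAlignedWindowRigidity_holds`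
(cell ns-regularity-ideate, seat p1, file `Sketch5.lean`/`Sketch8A.lean`, kernel-checked there; this seat p6 lands
it as route-directed support, `--supports stmt-NavierStokesRegularity-20018`).  Pure vector calculus on
`ℝ³ = EuclideanSpace ℝ (Fin 3)`, no Navier–Stokes input:

* `cross_eq_zero_spread` — (E) identity-theorem spreading: if `F` is real-analytic and `F × e = 0` on a
  nonempty open set, then `F × e = 0` everywhere (fed with `F = curl v(s)`, analytic by the tree's
  `Literature.Analysis.FluidPDE.analyticOnNhd_curl`);
* `translate_eq_of_cross_curl_eq_zero` — (S) the SLICE PLANARITY LEMMA: a bounded `C³` divergence-free field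
  with bounded gradient whose curl is everywhere parallel to `e` is invariant under translations along `e`
  (`ω × e = 0`, `div ω = 0` ⇒ `∂ₑ ω = 0` ⇒ `∂ₑ V` is curl-free, divergence-free and bounded, hence constant by
  the tree's Liouville theorem `eq_of_curl_eq_zero_of_isDivFree_of_bounded` (KNSS 2009, Lemma 3.1 / proof of
  Thm 5.2), hence `0` since `V` is bounded).

Companion files: `LocalSineTubeDoorProfileAlignedWindowRigidityAncient.lean` (Oseen-ancient class: analyticity,
forward/backward propagation of slice invariance, slice gradient bound) and
`LocalSineTubeDoorProfileAlignedWindowRigidity.lean` (the Type-I planar Liouville step and the route decl).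
WHAT THIS IS NOT: not a claim about Navier–Stokes regularity; support lemmas for a DRAFT route's crux.
-/

section Part5

open _root_.Set _root_.Filter _root_.Function
open scoped _root_.Topology
open Literature.Analysis Literature.Analysis.FluidPDE

namespace Literature.Analysis.NavierStokesZoomKit.LocalSineTubeDoorProfileAlignedWindowRigidityPlanarity

/-! ### Identity-theorem spreading (the curl of an analytic field is analytic: tree `analyticOnNhd_curl`) -/

/-- **(E) identity-theorem spreading** for `y ↦ F(y) × e`: if `F` is real-analytic on `ℝ³` and `F × e`
vanishes on a nonempty open set, it vanishes everywhere (`ℝ³` is preconnected).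
[cite: KochNadirashviliSereginSverak2009, Thm 1.1–1.3 (context: Liouville theorems for ancient solutions; this declaration is the cell’s own lemma or plumbing, NOT a printed statement)] -/
theorem cross_eq_zero_spread {F : (EuclideanSpace ℝ (Fin 3)) → (EuclideanSpace ℝ (Fin 3))} (hF : AnalyticOnNhd ℝ F univ) (e : (EuclideanSpace ℝ (Fin 3)))
    {U : Set (EuclideanSpace ℝ (Fin 3))} (hU : IsOpen U) (hne : U.Nonempty) (h : ∀ y ∈ U, cross (F y) e = 0) :
    ∀ y, cross (F y) e = 0 := by
  have hG : AnalyticOnNhd ℝ (fun y => cross (F y) e) univ := by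
    have h1 := (crossCLM.flip e).comp_analyticOnNhd hF
    simpa [Function.comp_def, crossCLM_apply] using h1
  obtain ⟨y₀, hy₀⟩ := hne
  have hev : (fun y => cross (F y) e) =ᶠ[𝓝 y₀] 0 :=
    Filter.eventually_of_mem (hU.mem_nhds hy₀) fun y hy => h y hy
  intro y
  have := hG.eqOn_zero_of_preconnected_of_eventuallyEq_zero isPreconnected_univ (mem_univ y₀) hev
    (mem_univ y)
  simpa using this

/-! ### (S) the slice planarity lemma

`ω := curl V = φ • e` componentwise from `ω × e = 0`; `∂ₑ ω = (∂ₑ φ) e = (div ω) e = 0`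
(`divergence_curl_eq_zero_holds`, `divergence_smul_const`); `W := ∂ₑ V` has `curl W = ∂ₑ ω = 0`
(`curl_fderiv_apply`), `div W = 0` (`IsDivFree.fderiv_apply`), `‖W‖ ≤ M'‖e‖`, hence is constant
(`eq_of_curl_eq_zero_of_isDivFree_of_bounded`); `V (y + l e) = V y + l • c` and `V` bounded force `c = 0`. -/

/-- Components of `a × e = 0`: `aᵢ eₖ = aₖ eᵢ`.
[cite: KochNadirashviliSereginSverak2009, Thm 1.1–1.3 (context: Liouville theorems for ancient solutions; this declaration is the cell’s own lemma or plumbing, NOT a printed statement)] -/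
theorem mul_comm_of_cross_eq_zero {a e : (EuclideanSpace ℝ (Fin 3))} (h : cross a e = 0) (i k : Fin 3) :
    a i * e k = a k * e i := by
  have h' : ∀ j : Fin 3, (cross a e) j = 0 := fun j => by rw [h]; rfl
  have h0 := h' 0
  have h1 := h' 1
  have h2 := h' 2
  simp only [cross, PiLp.toLp_apply, cross_apply, Matrix.cons_val_zero, Matrix.cons_val_one,
    Matrix.cons_val_two, Matrix.head_cons, Matrix.tail_cons] at h0 h1 h2
  fin_cases i <;> fin_cases k <;> simp <;> linarith

/-- If `a × e = 0` and `eₖ ≠ 0` then `a = (aₖ / eₖ) • e`.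
[cite: KochNadirashviliSereginSverak2009, Thm 1.1–1.3 (context: Liouville theorems for ancient solutions; this declaration is the cell’s own lemma or plumbing, NOT a printed statement)] -/
theorem eq_smul_of_cross_eq_zero {a e : (EuclideanSpace ℝ (Fin 3))} (h : cross a e = 0) {k : Fin 3} (hk : e k ≠ 0) :
    a = (a k / e k) • e := by
  ext i
  rw [PiLp.smul_apply, smul_eq_mul, div_mul_eq_mul_div, eq_div_iff hk]
  exact mul_comm_of_cross_eq_zero h i k

/-- A nonzero vector of `ℝ³` has a nonzero coordinate.
[cite: KochNadirashviliSereginSverak2009, Thm 1.1–1.3 (context: Liouville theorems for ancient solutions; this declaration is the cell’s own lemma or plumbing, NOT a printed statement)] -/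
theorem exists_apply_ne_zero {e : (EuclideanSpace ℝ (Fin 3))} (he : e ≠ 0) : ∃ k : Fin 3, e k ≠ 0 := by
  by_contra h
  push Not at h
  exact he (PiLp.ext fun k => by rw [h k]; rfl)

/-- **(P1)** If `curl V` is everywhere parallel to `e` (`V ∈ C³`), then `∂ₑ (curl V) = 0`.
[cite: KochNadirashviliSereginSverak2009, Thm 1.1–1.3 (context: Liouville theorems for ancient solutions; this declaration is the cell’s own lemma or plumbing, NOT a printed statement)] -/
theorem fderiv_curl_apply_eq_zero {V : (EuclideanSpace ℝ (Fin 3)) → (EuclideanSpace ℝ (Fin 3))} (hV : ContDiff ℝ 3 V) {e : (EuclideanSpace ℝ (Fin 3))}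
    (hal : ∀ y, cross (curl V y) e = 0) (x : (EuclideanSpace ℝ (Fin 3))) : fderiv ℝ (curl V) x e = 0 := by
  by_cases he : e = 0
  · simp [he]
  obtain ⟨k, hk⟩ := exists_apply_ne_zero he
  have hV2 : ContDiff ℝ 2 V := hV.of_le (by norm_cast)
  have hω2 : ContDiff ℝ 2 (curl V) := contDiff_curl (n := 2) (by exact_mod_cast hV)
  -- the scalar amplitude `φ = ωₖ / eₖ`
  set φ : (EuclideanSpace ℝ (Fin 3)) → ℝ := fun y => curl V y k / e k with hφdef
  have hφ2 : ContDiff ℝ 2 φ := by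
    have h1 : ContDiff ℝ 2 fun y => curl V y k :=
      (EuclideanSpace.proj k : (EuclideanSpace ℝ (Fin 3)) →L[ℝ] ℝ).contDiff.comp hω2
    exact h1.div_const _
  have hφd : Differentiable ℝ φ := hφ2.differentiable (by norm_num)
  have hωφ : curl V = fun y => φ y • e := funext fun y => eq_smul_of_cross_eq_zero (hal y) hk
  -- `∂ₑ φ = div ω = 0`
  have hdφ : fderiv ℝ φ x e = 0 := by
    rw [← divergence_smul_const e (hφd x), ← hωφ]
    exact divergence_curl_eq_zero_holds V hV2 x
  rw [hωφ, fderiv_smul_const (hφd x) e, ContinuousLinearMap.smulRight_apply, hdφ, zero_smul]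

/-- **(P2)** Under the hypotheses of (S), the directional derivative `∂ₑ V` is constant.
[cite: KochNadirashviliSereginSverak2009, Thm 1.1–1.3 (context: Liouville theorems for ancient solutions; this declaration is the cell’s own lemma or plumbing, NOT a printed statement)] -/
theorem fderiv_apply_const {V : (EuclideanSpace ℝ (Fin 3)) → (EuclideanSpace ℝ (Fin 3))} (hV : ContDiff ℝ 3 V) (hdiv : VectorCalculus.IsDivFree V)
    {M' : ℝ} (hM' : ∀ y, ‖fderiv ℝ V y‖ ≤ M') {e : (EuclideanSpace ℝ (Fin 3))} (hal : ∀ y, cross (curl V y) e = 0)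
    (x y : (EuclideanSpace ℝ (Fin 3))) : fderiv ℝ V x e = fderiv ℝ V y e := by
  have hV2 : ContDiff ℝ 2 V := hV.of_le (by norm_cast)
  have hW2 : ContDiff ℝ 2 fun z => fderiv ℝ V z e :=
    (hV.fderiv_right (m := 2) (by norm_cast)).clm_apply contDiff_const
  have hcurl : ∀ z, curl (fun w => fderiv ℝ V w e) z = 0 := fun z => by
    rw [curl_fderiv_apply hV2 z e, fderiv_curl_apply_eq_zero hV hal z]
  have hdivW : VectorCalculus.IsDivFree fun z => fderiv ℝ V z e := hdiv.fderiv_apply hV2 e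
  have hbd : ∀ z, ‖fderiv ℝ V z e‖ ≤ M' * ‖e‖ := fun z =>
    ((fderiv ℝ V z).le_opNorm e).trans (mul_le_mul_of_nonneg_right (hM' z) (norm_nonneg e))
  exact eq_of_curl_eq_zero_of_isDivFree_of_bounded hW2 hcurl hdivW hbd x y

/-- **(S) THE SLICE PLANARITY LEMMA.** A bounded `C³` divergence-free field `V : ℝ³ → ℝ³` with bounded
gradient whose curl is everywhere parallel to `e` (`curl V × e = 0`) is invariant under translations along
`e`: `V (y + l • e) = V y`.  (Giga–Miura 2011 §2 / KNSS 2009 proof of Thm 5.2 use the global version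
"unidirectional vorticity ⇒ two-dimensional flow"; here it is a pure calculus fact about one slice.)
[cite: KochNadirashviliSereginSverak2009, Thm 1.1–1.3 (context: Liouville theorems for ancient solutions; this declaration is the cell’s own lemma or plumbing, NOT a printed statement)] -/
theorem translate_eq_of_cross_curl_eq_zero {V : (EuclideanSpace ℝ (Fin 3)) → (EuclideanSpace ℝ (Fin 3))} {e : (EuclideanSpace ℝ (Fin 3))} (hV : ContDiff ℝ 3 V)
    (hdiv : VectorCalculus.IsDivFree V) {M : ℝ} (hM : ∀ y, ‖V y‖ ≤ M) {M' : ℝ}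
    (hM' : ∀ y, ‖fderiv ℝ V y‖ ≤ M') (hal : ∀ y, cross (curl V y) e = 0) (y : (EuclideanSpace ℝ (Fin 3))) (l : ℝ) :
    V (y + l • e) = V y := by
  have hV1 : Differentiable ℝ V := hV.differentiable (by norm_num)
  -- the constant value of `∂ₑ V`
  set c : (EuclideanSpace ℝ (Fin 3)) := fderiv ℝ V 0 e with hc
  have hconst : ∀ z, fderiv ℝ V z e = c := fun z => fderiv_apply_const hV hdiv hM' hal z 0
  -- the line map `g l = V (y + l e)` has derivative `c`
  set g : ℝ → (EuclideanSpace ℝ (Fin 3)) := fun l => V (y + l • e) with hg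
  have hgd : ∀ l, HasDerivAt g c l := fun l => by
    have hline : HasDerivAt (fun l : ℝ => y + l • e) e l := by
      simpa using ((hasDerivAt_id l).smul_const e).const_add y
    have h := (hV1 (y + l • e)).hasFDerivAt.comp_hasDerivAt l hline
    rwa [hconst] at h
  -- hence `g l − l • c` is constant
  have hd : ∀ l, HasDerivAt (fun l => g l - l • c) 0 l := fun l => by
    have h := (hgd l).sub ((hasDerivAt_id' l).smul_const c)
    simp only [one_smul, sub_self] at h
    exact h
  have hh : ∀ l, g l - l • c = g 0 - (0 : ℝ) • c := fun l =>
    is_const_of_deriv_eq_zero (f := fun l => g l - l • c) (fun l => (hd l).differentiableAt)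
      (fun l => (hd l).deriv) l 0
  have hlin : ∀ l, V (y + l • e) = V y + l • c := fun l => by
    have := hh l
    simp only [hg, zero_smul, sub_zero, zero_smul, add_zero] at this
    rw [← this]; abel
  -- boundedness of `V` forces `c = 0`
  have hc0 : c = 0 := by
    by_contra hne
    have hcpos : 0 < ‖c‖ := norm_pos_iff.2 hne
    set l : ℝ := (2 * M + 1) / ‖c‖ with hl
    have hM0 : 0 ≤ M := (norm_nonneg _).trans (hM y)
    have h1 : ‖l • c‖ ≤ 2 * M := by
      have : l • c = V (y + l • e) - V y := by rw [hlin l]; abel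
      rw [this]
      exact (norm_sub_le _ _).trans (by linarith [hM (y + l • e), hM y])
    have h2 : ‖l • c‖ = 2 * M + 1 := by
      rw [norm_smul, Real.norm_eq_abs, abs_of_nonneg (by positivity), hl,
        div_mul_cancel₀ _ hcpos.ne']
    linarith
  rw [hlin l, hc0, smul_zero, add_zero]

end Literature.Analysis.NavierStokesZoomKit.LocalSineTubeDoorProfileAlignedWindowRigidityPlanarity

end Part5

/-!
## Part 6 — port of `Summits/NavierStokesRegularity/NavierStokesRegularity/Theorems/IsobarTomographyTubeAlternativeStubOseenAncientAnalytic.lean` (2 declarations kept)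

# Bounded continuous Oseen-ancient fields are jointly real-analytic — crux
# stmt-NavierStokesRegularity-11739 (`IsobarTomography.TubeAlternative`), line
# `analytic-propagation-local-patch`, stub `stub_oseenAncientAnalytic`

A field `w : ℝ → ℝ³ → ℝ³`, continuous and bounded on the open slab `(-∞,0) × ℝ³` and satisfying
the Oseen integral identity `w(t) = e^{(t-s)Δ} w(s) − B¹_s(w,w)(t)` pointwise for all `s < t < 0`
(`B¹_s = oseenDuhamel 1 s`, `e^{τΔ} = UnboundedOperators.heatExtension · τ`), is jointly
real-analytic on the slab: `AnalyticOnNhd ℝ (uncurry w) (Iio 0 ×ˢ univ)`.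

Proof (the covering argument of Lemarié-Rieusset 2016, Thm. 9.12, PDF p. 263, in the tree's
rendering; template `Literature.Analysis.FluidPDE.exists_analytic_representative_of_mild_L3`,
here in the simpler setting of an everywhere bounded, continuous field). Fix `(t, x)` with `t < 0`,
let `M' = max M 1 > 0` (`M` the bound) and `h = ε/M'²` the lifespan of the PROVED local fact
`lemarieRieusset2016_local_analyticity_holds` (`ν = 1`), and restart at `s = t − h/2 < t < s + h`:
the datum `w(s)` is continuous, hence measurable, and essentially bounded by `M'`, so the local
fact provides a field `vl`, jointly real-analytic on `(s, s + h) × ℝ³ ∋ (t, x)`, solving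
`vl(τ) = e^{1·(τ-s)Δ} w(s) − B¹_s(vl,vl)(τ)` pointwise there with `‖vl‖ ≤ C M'`. On the window
`(s, T₂)`, `T₂ = min(s + h, 0) > t`, both `w` (by hypothesis, `τ < 0`) and `vl` are pointwise
bounded, jointly measurable (continuous) solutions of the same integral equation, so they agree
a.e. on every slice (`oseenMild_bounded_unique`, PROVED, KNSS 2009 §4), hence everywhere on every
slice (both slices are continuous; Mathlib `Continuous.ae_eq_iff_eq`). Thus `uncurry w = uncurry vl`
on the open neighbourhood `(s, T₂) × ℝ³` of `(t, x)`, and `uncurry w` is analytic at `(t, x)`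
(`AnalyticAt.congr`). No identity theorem is used here.

Not carried from this source module (not needed by the declarations re-homed here; their consumers are Summits-side): `zoom_action_eq`, `knssLimit_of_ancientPatch`.
-/

section Part6

-- the problem directory repeats the summit name (`NavierStokesRegularity/NavierStokesRegularity`,
namespace Literature.Analysis.NavierStokesZoomKit.TubeAlternative.AnalyticPropagation

open _root_.Set _root_.Filter _root_.Topology _root_.Function _root_.MeasureTheory
open Literature.Analysis.FluidPDE
open scoped _root_.ENNReal

/-- Slices `w t`, `t < 0`, of a field `w` with `uncurry w` continuous on the open slab
`(-∞,0) × ℝ³` are continuous (composition with the continuous embedding `x ↦ (t, x)`).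
[cite: KochNadirashviliSereginSverak2009, Thm 1.1–1.3 (context: Liouville theorems for ancient solutions; this declaration is the cell’s own lemma or plumbing, NOT a printed statement)] -/
theorem continuous_slice_of_continuousOn_slab {w : ℝ → (EuclideanSpace ℝ (Fin 3)) → (EuclideanSpace ℝ (Fin 3))}
    (hw : ContinuousOn (uncurry w) (Set.Iio 0 ×ˢ Set.univ)) {t : ℝ} (ht : t < 0) :
    Continuous (w t) :=
  hw.comp_continuous (continuous_const.prodMk continuous_id) fun x => ⟨ht, mem_univ x⟩

/-- **Stub `stub_oseenAncientAnalytic` (line `analytic-propagation-local-patch` of crux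
`IsobarTomography.TubeAlternative`).** A field `w`, continuous and bounded on the open slab
`(-∞,0) × ℝ³` and satisfying the Oseen integral identity
`w t x = e^{(t-s)Δ}(w s) x − oseenDuhamel 1 s w w t x` for all `s < t < 0` and all `x`, has
`uncurry w` jointly real-analytic on `Iio 0 ×ˢ univ`. Source: Lemarié-Rieusset 2016, Thm. 9.12
(local analyticity of Oseen's scheme, PROVED in the tree as
`lemarieRieusset2016_local_analyticity_holds`), restarted at `s = t − h/2` for every `t < 0`, and
uniqueness of bounded solutions of the Oseen integral equation (`oseenMild_bounded_unique`,
KNSS 2009 §4), upgraded from a.e. to everywhere by continuity of the slices.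
[cite: KochNadirashviliSereginSverak2009, Thm 1.1–1.3 (context: Liouville theorems for ancient solutions; this declaration is the cell’s own lemma or plumbing, NOT a printed statement)] -/
theorem stub_oseenAncientAnalytic :
    ∀ (w : ℝ → (EuclideanSpace ℝ (Fin 3)) → (EuclideanSpace ℝ (Fin 3))), ContinuousOn (uncurry w) (Set.Iio 0 ×ˢ Set.univ) →
    (∃ M : ℝ, ∀ t < 0, ∀ x : (EuclideanSpace ℝ (Fin 3)), ‖w t x‖ ≤ M) →
    (∀ s t : ℝ, s < t → t < 0 → ∀ x : (EuclideanSpace ℝ (Fin 3)),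
      w t x = Literature.Analysis.UnboundedOperators.heatExtension (w s) (t - s) x -
        oseenDuhamel 1 s w w t x) →
    AnalyticOnNhd ℝ (uncurry w) (Set.Iio 0 ×ˢ Set.univ) := by
  intro w hcont hbd hos
  obtain ⟨ε, hε, C, -, hLoc⟩ := lemarieRieusset2016_local_analyticity_holds
  obtain ⟨M, hM⟩ := hbd
  -- a positive bound `M' = max M 1`
  set M' : ℝ := max M 1
  have hM'0 : 0 < M' := one_pos.trans_le (le_max_right _ _)
  have hMM' : M ≤ M' := le_max_left _ _
  -- the lifespan of the local fact at `ν = 1`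
  have hh0 : 0 < ε * 1 / M' ^ 2 := by positivity
  set h : ℝ := ε * 1 / M' ^ 2
  intro z hz
  obtain ⟨ht, -⟩ := mem_prod.1 hz
  have ht0 : z.1 < 0 := ht
  -- restart time `s = t - h/2` and window end `T₂ = min (s + h) 0`
  obtain ⟨s, hst, htsh⟩ : ∃ s : ℝ, s < z.1 ∧ z.1 < s + h :=
    ⟨z.1 - h / 2, by linarith, by linarith⟩
  have hs0 : s < 0 := hst.trans ht0
  obtain ⟨T₂, htT₂, hT₂h, hT₂0⟩ : ∃ T₂ : ℝ, z.1 < T₂ ∧ T₂ ≤ s + h ∧ T₂ ≤ 0 :=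
    ⟨min (s + h) 0, lt_min htsh ht0, min_le_left _ _, min_le_right _ _⟩
  -- the datum `w s`: continuous, hence measurable, essentially bounded by `M'`
  have hws : Continuous (w s) := continuous_slice_of_continuousOn_slab hcont hs0
  have ha : AEStronglyMeasurable (w s) volume := hws.aestronglyMeasurable
  have haM : eLpNorm (w s) ∞ volume ≤ ENNReal.ofReal M' := by
    rw [eLpNorm_exponent_top]
    exact eLpNormEssSup_le_of_ae_bound (Eventually.of_forall fun x => (hM s hs0 x).trans hMM')
  -- the local analytic Oseen solution from `w s` at time `s`
  obtain ⟨vl, hvl_an, hvl_eq, hvl_bd⟩ := hLoc one_pos s hM'0 ha haM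
  -- uniqueness of bounded solutions on `(s, T₂)`, common bound `M'' = max M' (C M')`
  set M'' : ℝ := max M' (C * M')
  have hM''0 : 0 ≤ M'' := hM'0.le.trans (le_max_left _ _)
  have hsub : Ioo s T₂ ×ˢ (univ : Set (EuclideanSpace ℝ (Fin 3))) ⊆ Iio 0 ×ˢ univ :=
    prod_mono (fun τ hτ => hτ.2.trans_le hT₂0) Subset.rfl
  have hum : AEStronglyMeasurable (uncurry w) (volume.restrict (Ioo s T₂ ×ˢ univ)) :=
    (hcont.mono hsub).aestronglyMeasurable (measurableSet_Ioo.prod MeasurableSet.univ)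
  have hvm : AEStronglyMeasurable (uncurry vl) (volume.restrict (Ioo s T₂ ×ˢ univ)) :=
    (hvl_an.continuousOn.mono (prod_mono (Ioo_subset_Ioo_right hT₂h) Subset.rfl)).aestronglyMeasurable
      (measurableSet_Ioo.prod MeasurableSet.univ)
  have huM : ∀ τ ∈ Ioo s T₂, ∀ y, ‖w τ y‖ ≤ M'' := fun τ hτ y =>
    ((hM τ (hτ.2.trans_le hT₂0) y).trans hMM').trans (le_max_left _ _)
  have hvM : ∀ τ ∈ Ioo s T₂, ∀ y, ‖vl τ y‖ ≤ M'' := fun τ hτ y =>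
    (hvl_bd τ ⟨hτ.1, hτ.2.trans_le hT₂h⟩ y).trans (le_max_right _ _)
  have hu : ∀ τ ∈ Ioo s T₂, w τ =ᵐ[volume] fun x =>
      Literature.Analysis.UnboundedOperators.heatExtension (w s) (τ - s) x -
        oseenDuhamel 1 s w w τ x :=
    fun τ hτ => Eventually.of_forall fun x => hos s τ hτ.1 (hτ.2.trans_le hT₂0) x
  have hv : ∀ τ ∈ Ioo s T₂, vl τ =ᵐ[volume] fun x =>
      Literature.Analysis.UnboundedOperators.heatExtension (w s) (τ - s) x -
        oseenDuhamel 1 s vl vl τ x := by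
    intro τ hτ
    refine Eventually.of_forall fun x => ?_
    have e := hvl_eq τ ⟨hτ.1, hτ.2.trans_le hT₂h⟩ x
    rwa [one_mul] at e
  have hae : ∀ τ ∈ Ioo s T₂, w τ =ᵐ[volume] vl τ :=
    oseenMild_bounded_unique (U := fun τ x =>
      Literature.Analysis.UnboundedOperators.heatExtension (w s) (τ - s) x)
      one_pos hM''0 hum hvm huM hvM hu hv
  -- a.e. equal continuous slices coincide
  have heq : ∀ τ ∈ Ioo s T₂, w τ = vl τ := fun τ hτ =>
    ((continuous_slice_of_continuousOn_slab hcont (hτ.2.trans_le hT₂0)).ae_eq_iff_eq volume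
      (continuousOn_univ.1
        (analyticOnNhd_slice hvl_an ⟨hτ.1, hτ.2.trans_le hT₂h⟩).continuousOn)).1 (hae τ hτ)
  -- `uncurry w = uncurry vl` near `z`, and `uncurry vl` is analytic at `z`
  have hzmem : z ∈ Ioo s (s + h) ×ˢ (univ : Set (EuclideanSpace ℝ (Fin 3))) := mem_prod.2 ⟨⟨hst, htsh⟩, mem_univ _⟩
  have hzmem' : z ∈ Ioo s T₂ ×ˢ (univ : Set (EuclideanSpace ℝ (Fin 3))) := mem_prod.2 ⟨⟨hst, htT₂⟩, mem_univ _⟩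
  refine (hvl_an z hzmem).congr ?_
  filter_upwards [(isOpen_Ioo.prod isOpen_univ).mem_nhds hzmem'] with y hy
  obtain ⟨hy1, -⟩ := mem_prod.1 hy
  change vl y.1 y.2 = w y.1 y.2
  rw [heq y.1 hy1]

end Literature.Analysis.NavierStokesZoomKit.TubeAlternative.AnalyticPropagation

/-! ## Appendix (stub `stub_peakZoomPatch` of the same line): scale covariance of the isobaric
action, and the sup-normalisation of a Type-I ancient mild field with an isobaric patch

Two bookkeeping steps of the vorticity-scale zoom of the line (file
`IsobarTomographyTubeAlternativeStubPeakZoomPatch.lean`), both elementary consequences of the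
parabolic scaling `Φ(s, y) = (t₀ + β s, x₀ + γ y)` (tree: `stPull`, `stAffine`,
`IsClassicalNSSolutionOn.stRescale`, `oseen_smul_stPull`, `setIntegral_preimage_comp_stAffine`). -/

namespace Literature.Analysis.NavierStokesZoomKit.TubeAlternative.AnalyticPropagation

open _root_.Set _root_.Filter _root_.Topology _root_.Function _root_.MeasureTheory _root_.Metric
open scoped RealInnerProductSpace
open Literature.Analysis Literature.Analysis.FluidPDE

/-! ### The isobaric action is scale-free -/

end Literature.Analysis.NavierStokesZoomKit.TubeAlternative.AnalyticPropagation

end Part6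

/-!
## Part 7 — port of `Summits/NavierStokesRegularity/NavierStokesRegularity/Theorems/LocalSineTubeDoorProfileAlignedWindowRigidityAncient.lean` (8 declarations kept)

# Route `LocalSineTubeDoor`, crux `ProfileAlignedWindowRigidity` (stmt-NavierStokesRegularity-20018) —
# support file 2/3: the Oseen-ancient class (analyticity, propagation of slice invariance, gradient bound)

Port to `Theorems/` of the class-𝔄 part of the cell proof
`Summit.NavierStokesRegularity.NavierStokesRegularity.Cell.NsRegP1c.profileAlignedWindowRigidity_holds`
(cell ns-regularity-ideate, seat p1, `Sketch5.lean`/`Sketch8A.lean`, kernel-checked there; landed by seat p6 as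
route-directed support, `--supports stmt-NavierStokesRegularity-20018`).

The OSEEN-ANCIENT class 𝔄 of the cell (no new definition is introduced; its four properties are carried as
explicit hypotheses `hcont`, `hbdd`, `hmild`, `hdiv` throughout): a field `v : ℝ → ℝ³ → ℝ³` with
`uncurry v` continuous on the open slab `(−∞,0) × ℝ³`, bounded on every sub-slab `(−∞,−δ)`, `δ > 0`,
satisfying the unit-viscosity Oseen (mild) identity
`v t y = heatExtension (v s) (t − s) y − oseenDuhamel 1 s v v t y` pointwise for all `s < t < 0`, and (where
needed) with divergence-free slices.  The route's Type-I profile class (rate `‖v(t,x)‖ ≤ C/√(−t)`) lies in 𝔄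
(`bdd_of_hasTypeITimeDecay`).  Proved here:

* `shift` — time shifts `τ ↦ v(τ − δ)`, `δ > 0`, are GLOBALLY bounded continuous Oseen-ancient fields
  (tree `oseenDuhamel_translate`);
* `analyticOnNhd_uncurry`, `analyticOnNhd_slice` — joint real-analyticity on the open slab (tree THEOREM
  `Theorems.TubeAlternative.AnalyticPropagation.stub_oseenAncientAnalytic` = Lemarié-Rieusset 2016 Thm 9.12 +
  bounded-mild uniqueness, applied to the shifts);
* `translate_eq_forward` — (F) invariance of a slice under translations along `e` propagates FORWARD in time
  (bounded-mild uniqueness `oseenMild_bounded_unique`, KNSS 2009 §4, + translation covariance of the heat and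
  Oseen–Duhamel operators);
* `translate_eq_backward` — (T) … and BACKWARD to `−∞` (time analyticity + identity theorem on the connected
  interval `(−∞,0)`: Masuda's 1967 move in place of backward uniqueness);
* `exists_fderiv_slice_bound` — (D) every slice has bounded gradient (KNSS 2009 Prop. 4.1 = tree THEOREM
  `knss2009_smoothing_holds`, `k = 1`, `l = 0`, restarted from the bounded continuous slice `v(2s)`; the
  pointwise mild identity identifies the smooth representative with `v s` itself).

WHAT THIS IS NOT: not a claim about Navier–Stokes regularity; support lemmas for a DRAFT route's crux.
-/

section Part7

open _root_.Set _root_.Filter _root_.Function _root_.MeasureTheory _root_.Metric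
open scoped _root_.Topology _root_.ENNReal
open Literature.Analysis Literature.Analysis.FluidPDE

namespace Literature.Analysis.NavierStokesZoomKit.LocalSineTubeDoorProfileAlignedWindowRigidityAncient

variable {v : ℝ → (EuclideanSpace ℝ (Fin 3)) → (EuclideanSpace ℝ (Fin 3))}

/-- The Type-I time rate `‖v(t,y)‖ ≤ C/√(−t)` bounds `v` by `|C|/√δ` on every sub-slab `(−∞,−δ)`, `δ > 0`:
the route's Type-I profile class lies in the Oseen-ancient class 𝔄.
[cite: KochNadirashviliSereginSverak2009, Thm 1.1–1.3 (context: Liouville theorems for ancient solutions; this declaration is the cell’s own lemma or plumbing, NOT a printed statement)] -/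
theorem bdd_of_hasTypeITimeDecay {C : ℝ} (hrate : HasTypeITimeDecay C v) :
    ∀ δ : ℝ, 0 < δ → ∃ B : ℝ, ∀ t < -δ, ∀ y : (EuclideanSpace ℝ (Fin 3)), ‖v t y‖ ≤ B := by
  intro δ hδ
  refine ⟨|C| / Real.sqrt δ, fun t ht y => ?_⟩
  have hδt : Real.sqrt δ ≤ Real.sqrt (-t) := Real.sqrt_le_sqrt (by linarith)
  have hsδ : 0 < Real.sqrt δ := Real.sqrt_pos.2 hδ
  calc ‖v t y‖ ≤ C / Real.sqrt (-t) := hrate t (by linarith) y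
    _ ≤ |C| / Real.sqrt (-t) := div_le_div_of_nonneg_right (le_abs_self C) (Real.sqrt_nonneg _)
    _ ≤ |C| / Real.sqrt δ := div_le_div_of_nonneg_left (abs_nonneg C) hsδ hδt

/-- Slices `v t`, `t < 0`, of a field continuous on the open slab are continuous.
[cite: KochNadirashviliSereginSverak2009, Thm 1.1–1.3 (context: Liouville theorems for ancient solutions; this declaration is the cell’s own lemma or plumbing, NOT a printed statement)] -/
theorem continuous_slice (hcont : ContinuousOn (uncurry v) (Iio (0 : ℝ) ×ˢ univ)) {t : ℝ}
    (ht : t < 0) : Continuous (v t) :=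
  hcont.comp_continuous (continuous_const.prodMk continuous_id) fun x => ⟨ht, mem_univ x⟩

/-- **Time shift.** For `δ > 0` the field `τ ↦ v(τ − δ)` is continuous on the open slab, GLOBALLY bounded
on `(−∞,0)`, and satisfies the Oseen identity between any two negative times (time translation of the
Oseen–Duhamel operator, tree `oseenDuhamel_translate`).
[cite: KochNadirashviliSereginSverak2009, Thm 1.1–1.3 (context: Liouville theorems for ancient solutions; this declaration is the cell’s own lemma or plumbing, NOT a printed statement)] -/
theorem shift (hcont : ContinuousOn (uncurry v) (Iio (0 : ℝ) ×ˢ univ))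
    (hbdd : ∀ δ : ℝ, 0 < δ → ∃ B : ℝ, ∀ t < -δ, ∀ y : (EuclideanSpace ℝ (Fin 3)), ‖v t y‖ ≤ B)
    (hmild : ∀ s t : ℝ, s < t → t < 0 → ∀ y : (EuclideanSpace ℝ (Fin 3)),
      v t y = UnboundedOperators.heatExtension (v s) (t - s) y - oseenDuhamel 1 s v v t y)
    {δ : ℝ} (hδ : 0 < δ) :
    ContinuousOn (uncurry fun τ => v (τ + -δ)) (Iio (0 : ℝ) ×ˢ univ) ∧
    (∃ M : ℝ, ∀ t < 0, ∀ y : (EuclideanSpace ℝ (Fin 3)), ‖(fun τ => v (τ + -δ)) t y‖ ≤ M) ∧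
    (∀ s t : ℝ, s < t → t < 0 → ∀ y : (EuclideanSpace ℝ (Fin 3)),
      (fun τ => v (τ + -δ)) t y =
        UnboundedOperators.heatExtension ((fun τ => v (τ + -δ)) s) (t - s) y -
          oseenDuhamel 1 s (fun τ => v (τ + -δ)) (fun τ => v (τ + -δ)) t y) := by
  refine ⟨?_, ?_, ?_⟩
  · have hφ : Continuous fun z : ℝ × (EuclideanSpace ℝ (Fin 3)) => (z.1 + -δ, z.2) :=
      (continuous_fst.add continuous_const).prodMk continuous_snd
    have hmaps : MapsTo (fun z : ℝ × (EuclideanSpace ℝ (Fin 3)) => (z.1 + -δ, z.2)) (Iio (0 : ℝ) ×ˢ univ)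
        (Iio (0 : ℝ) ×ˢ univ) := by
      intro z hz
      obtain ⟨h1, -⟩ := mem_prod.1 hz
      refine mem_prod.2 ⟨?_, mem_univ _⟩
      simp only [mem_Iio] at h1 ⊢
      linarith
    exact hcont.comp hφ.continuousOn hmaps
  · obtain ⟨B, hB⟩ := hbdd δ hδ
    exact ⟨B, fun t ht y => hB (t + -δ) (by linarith) y⟩
  · intro s t hst ht0 y
    have h := hmild (s + -δ) (t + -δ) (by linarith) (by linarith) y
    have hts : t + -δ - (s + -δ) = t - s := by ring
    rw [hts] at h
    rw [oseenDuhamel_translate 1 s (-δ) v v t y]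
    exact h

/-- **Joint real-analyticity on the open slab** `(−∞,0) × ℝ³` of an Oseen-ancient field (tree THEOREM
`stub_oseenAncientAnalytic` — Lemarié-Rieusset 2016 Thm 9.12 + bounded-mild uniqueness — applied to the
globally bounded time shifts `τ ↦ v(τ − δ)` and translated back).
[cite: KochNadirashviliSereginSverak2009, Thm 1.1–1.3 (context: Liouville theorems for ancient solutions; this declaration is the cell’s own lemma or plumbing, NOT a printed statement)] -/
theorem analyticOnNhd_uncurry (hcont : ContinuousOn (uncurry v) (Iio (0 : ℝ) ×ˢ univ))
    (hbdd : ∀ δ : ℝ, 0 < δ → ∃ B : ℝ, ∀ t < -δ, ∀ y : (EuclideanSpace ℝ (Fin 3)), ‖v t y‖ ≤ B)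
    (hmild : ∀ s t : ℝ, s < t → t < 0 → ∀ y : (EuclideanSpace ℝ (Fin 3)),
      v t y = UnboundedOperators.heatExtension (v s) (t - s) y - oseenDuhamel 1 s v v t y) :
    AnalyticOnNhd ℝ (uncurry v) (Iio (0 : ℝ) ×ˢ univ) := by
  intro z hz
  obtain ⟨hz1, -⟩ := mem_prod.1 hz
  have hz1' : z.1 < 0 := hz1
  obtain ⟨δ, hδ0, hzδ⟩ : ∃ δ : ℝ, 0 < δ ∧ z.1 + δ < 0 := ⟨-z.1 / 2, by linarith, by linarith⟩
  obtain ⟨hc, hb, hm⟩ := shift hcont hbdd hmild hδ0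
  have han :=
    Literature.Analysis.NavierStokesZoomKit.TubeAlternative.AnalyticPropagation.stub_oseenAncientAnalytic
      (fun τ => v (τ + -δ)) hc hb hm
  have hw : AnalyticAt ℝ (uncurry fun τ => v (τ + -δ)) (z.1 + δ, z.2) :=
    han _ (mem_prod.2 ⟨hzδ, mem_univ _⟩)
  have hφ : AnalyticAt ℝ (fun p : ℝ × (EuclideanSpace ℝ (Fin 3)) => (p.1 + δ, p.2)) z :=
    (analyticAt_fst.add analyticAt_const).prod analyticAt_snd
  refine (hw.comp_of_eq hφ rfl).congr (Filter.Eventually.of_forall fun p => ?_)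
  show v (p.1 + δ + -δ) p.2 = v p.1 p.2
  rw [add_neg_cancel_right]

/-- Slices `v t`, `t < 0`, of an Oseen-ancient field are real-analytic on `ℝ³`.
[cite: KochNadirashviliSereginSverak2009, Thm 1.1–1.3 (context: Liouville theorems for ancient solutions; this declaration is the cell’s own lemma or plumbing, NOT a printed statement)] -/
theorem analyticOnNhd_slice (hcont : ContinuousOn (uncurry v) (Iio (0 : ℝ) ×ˢ univ))
    (hbdd : ∀ δ : ℝ, 0 < δ → ∃ B : ℝ, ∀ t < -δ, ∀ y : (EuclideanSpace ℝ (Fin 3)), ‖v t y‖ ≤ B)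
    (hmild : ∀ s t : ℝ, s < t → t < 0 → ∀ y : (EuclideanSpace ℝ (Fin 3)),
      v t y = UnboundedOperators.heatExtension (v s) (t - s) y - oseenDuhamel 1 s v v t y)
    {t : ℝ} (ht : t < 0) : AnalyticOnNhd ℝ (v t) univ := by
  intro x _
  have hz : AnalyticAt ℝ (uncurry v) (t, x) :=
    analyticOnNhd_uncurry hcont hbdd hmild (t, x) (mem_prod.2 ⟨ht, mem_univ _⟩)
  exact hz.comp (analyticAt_const.prod analyticAt_id)

/-- **(F) translation invariance propagates FORWARD** (bounded-mild uniqueness, tree THEOREM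
`oseenMild_bounded_unique`: `v` and its translate `v(·, · + l e)` solve the same Oseen problem on `(s, t/2)`
from the same slice `v(s)`; continuous slices a.e. equal coincide).  If `v(s)` is invariant under translations
along `e`, so is every later slice `v(t)`, `s ≤ t < 0`.
[cite: KochNadirashviliSereginSverak2009, Thm 1.1–1.3 (context: Liouville theorems for ancient solutions; this declaration is the cell’s own lemma or plumbing, NOT a printed statement)] -/
theorem translate_eq_forward (hcont : ContinuousOn (uncurry v) (Iio (0 : ℝ) ×ˢ univ))
    (hbdd : ∀ δ : ℝ, 0 < δ → ∃ B : ℝ, ∀ t < -δ, ∀ y : (EuclideanSpace ℝ (Fin 3)), ‖v t y‖ ≤ B)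
    (hmild : ∀ s t : ℝ, s < t → t < 0 → ∀ y : (EuclideanSpace ℝ (Fin 3)),
      v t y = UnboundedOperators.heatExtension (v s) (t - s) y - oseenDuhamel 1 s v v t y)
    {s : ℝ} {e : (EuclideanSpace ℝ (Fin 3))} (h : ∀ (y : (EuclideanSpace ℝ (Fin 3))) (l : ℝ), v s (y + l • e) = v s y) :
    ∀ t, s ≤ t → t < 0 → ∀ (y : (EuclideanSpace ℝ (Fin 3))) (l : ℝ), v t (y + l • e) = v t y := by
  intro t hst ht0
  rcases hst.eq_or_lt with rfl | hst'
  · exact h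
  intro y l
  set a : (EuclideanSpace ℝ (Fin 3)) := l • e with ha
  obtain ⟨T₂, htT₂, hT₂0⟩ : ∃ T₂ : ℝ, t < T₂ ∧ T₂ < 0 := ⟨t / 2, by linarith, by linarith⟩
  obtain ⟨B, hB⟩ := hbdd (-T₂) (by linarith)
  have hB' : ∀ τ ∈ Ioo s T₂, ∀ y, ‖v τ y‖ ≤ max B 0 := fun τ hτ y =>
    (hB τ (by linarith [hτ.2]) y).trans (le_max_left _ _)
  have hsub : Ioo s T₂ ×ˢ (univ : Set (EuclideanSpace ℝ (Fin 3))) ⊆ Iio 0 ×ˢ univ :=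
    prod_mono (fun τ hτ => hτ.2.trans hT₂0) Subset.rfl
  have hum : AEStronglyMeasurable (uncurry v) (volume.restrict (Ioo s T₂ ×ˢ univ)) :=
    (hcont.mono hsub).aestronglyMeasurable (measurableSet_Ioo.prod MeasurableSet.univ)
  have hcont₂ : ContinuousOn (uncurry fun τ y => v τ (y + a)) (Ioo s T₂ ×ˢ univ) := by
    have hφ : Continuous fun z : ℝ × (EuclideanSpace ℝ (Fin 3)) => (z.1, z.2 + a) :=
      continuous_fst.prodMk (continuous_snd.add continuous_const)
    have hmaps : MapsTo (fun z : ℝ × (EuclideanSpace ℝ (Fin 3)) => (z.1, z.2 + a)) (Ioo s T₂ ×ˢ univ)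
        (Iio (0 : ℝ) ×ˢ univ) := fun z hz =>
      mem_prod.2 ⟨(mem_prod.1 hz).1.2.trans hT₂0, mem_univ _⟩
    exact hcont.comp hφ.continuousOn hmaps
  have hvm : AEStronglyMeasurable (uncurry fun τ y => v τ (y + a))
      (volume.restrict (Ioo s T₂ ×ˢ univ)) :=
    hcont₂.aestronglyMeasurable (measurableSet_Ioo.prod MeasurableSet.univ)
  have hvM : ∀ τ ∈ Ioo s T₂, ∀ y, ‖(fun τ y => v τ (y + a)) τ y‖ ≤ max B 0 := fun τ hτ y =>
    hB' τ hτ (y + a)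
  have hu : ∀ τ ∈ Ioo s T₂, v τ =ᵐ[volume] fun x =>
      UnboundedOperators.heatExtension (v s) (τ - s) x - oseenDuhamel 1 s v v τ x :=
    fun τ hτ => Eventually.of_forall fun x => hmild s τ hτ.1 (hτ.2.trans hT₂0) x
  have hv₂ : ∀ τ ∈ Ioo s T₂, (fun τ y => v τ (y + a)) τ =ᵐ[volume] fun x =>
      UnboundedOperators.heatExtension (v s) (τ - s) x -
        oseenDuhamel 1 s (fun τ y => v τ (y + a)) (fun τ y => v τ (y + a)) τ x := by
    intro τ hτ
    refine Eventually.of_forall fun x => ?_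
    have hm := hmild s τ hτ.1 (hτ.2.trans hT₂0) (x + a)
    have hheat : UnboundedOperators.heatExtension (v s) (τ - s) (x + a) =
        UnboundedOperators.heatExtension (v s) (τ - s) x := by
      rw [← heatExtension_comp_add_right (v s) a (τ - s) x]
      congr 1
      funext z
      rw [ha]
      exact h z l
    show v τ (x + a) = UnboundedOperators.heatExtension (v s) (τ - s) x -
      oseenDuhamel 1 s (fun τ y => v τ (y + a)) (fun τ y => v τ (y + a)) τ x
    rw [oseenDuhamel_comp_add_right 1 s v v a τ x, ← hheat]
    exact hm
  have hae := oseenMild_bounded_unique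
    (U := fun τ x => UnboundedOperators.heatExtension (v s) (τ - s) x)
    one_pos (le_max_right B 0) hum hvm hB' hvM hu hv₂
  have ht : t ∈ Ioo s T₂ := ⟨hst', htT₂⟩
  have hg : Continuous fun y => v t (y + a) :=
    (continuous_slice hcont ht0).comp (continuous_id.add continuous_const)
  have heq : v t = fun y => v t (y + a) :=
    ((continuous_slice hcont ht0).ae_eq_iff_eq volume hg).1 (hae t ht)
  have hy := congrFun heq y
  rw [ha] at hy
  exact hy.symm

/-- **(T) translation invariance propagates BACKWARD** — time analyticity (`analyticOnNhd_uncurry`) and the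
identity theorem on the connected interval `(−∞,0)` (Masuda 1967's move replacing backward uniqueness): if
every slice `v(t)`, `s ≤ t < 0`, is invariant under translations along `e`, then so is every slice `v(t)`,
`t < 0`.
[cite: KochNadirashviliSereginSverak2009, Thm 1.1–1.3 (context: Liouville theorems for ancient solutions; this declaration is the cell’s own lemma or plumbing, NOT a printed statement)] -/
theorem translate_eq_backward (hcont : ContinuousOn (uncurry v) (Iio (0 : ℝ) ×ˢ univ))
    (hbdd : ∀ δ : ℝ, 0 < δ → ∃ B : ℝ, ∀ t < -δ, ∀ y : (EuclideanSpace ℝ (Fin 3)), ‖v t y‖ ≤ B)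
    (hmild : ∀ s t : ℝ, s < t → t < 0 → ∀ y : (EuclideanSpace ℝ (Fin 3)),
      v t y = UnboundedOperators.heatExtension (v s) (t - s) y - oseenDuhamel 1 s v v t y)
    {s : ℝ} (hs : s < 0) {e : (EuclideanSpace ℝ (Fin 3))}
    (h : ∀ t, s ≤ t → t < 0 → ∀ (y : (EuclideanSpace ℝ (Fin 3))) (l : ℝ), v t (y + l • e) = v t y) :
    ∀ t < 0, ∀ (y : (EuclideanSpace ℝ (Fin 3))) (l : ℝ), v t (y + l • e) = v t y := by
  intro t ht y l
  have hg : AnalyticOnNhd ℝ (fun τ => v τ (y + l • e) - v τ y) (Iio 0) := by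
    intro τ hτ
    have h1 : AnalyticAt ℝ (uncurry v) (τ, y + l • e) :=
      analyticOnNhd_uncurry hcont hbdd hmild _ (mem_prod.2 ⟨hτ, mem_univ _⟩)
    have h2 : AnalyticAt ℝ (uncurry v) (τ, y) :=
      analyticOnNhd_uncurry hcont hbdd hmild _ (mem_prod.2 ⟨hτ, mem_univ _⟩)
    have hι₁ : AnalyticAt ℝ (fun σ : ℝ => (σ, y + l • e)) τ := analyticAt_id.prod analyticAt_const
    have hι₂ : AnalyticAt ℝ (fun σ : ℝ => (σ, y)) τ := analyticAt_id.prod analyticAt_const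
    have h1' : AnalyticAt ℝ (fun σ => v σ (y + l • e)) τ := h1.comp_of_eq hι₁ rfl
    have h2' : AnalyticAt ℝ (fun σ => v σ y) τ := h2.comp_of_eq hι₂ rfl
    exact h1'.sub h2'
  have hs2 : s / 2 ∈ Iio (0 : ℝ) := by
    simp only [mem_Iio]
    linarith
  have hev : (fun τ => v τ (y + l • e) - v τ y) =ᶠ[𝓝 (s / 2)] 0 := by
    filter_upwards [isOpen_Ioo.mem_nhds (show s / 2 ∈ Ioo s 0 from ⟨by linarith, by linarith⟩)]
      with τ hτ
    simp only [Pi.zero_apply, sub_eq_zero]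
    exact h τ hτ.1.le hτ.2 y l
  have := hg.eqOn_zero_of_preconnected_of_eventuallyEq_zero isPreconnected_Iio hs2 hev ht
  simpa [sub_eq_zero] using this

/-- **(D) slice gradient bound** (KNSS 2009 Prop. 4.1 = tree THEOREM `knss2009_smoothing_holds` with `k = 1`,
`l = 0`): every slice `v(s)`, `s < 0`, of an Oseen-ancient field has bounded gradient.  Restart the Oseen
integral equation from the bounded continuous slice `v(2s)` on the window `(2s, s/2)`; the class identity
`hmild` is POINTWISE, so the smooth canonical representative of KNSS Prop. 4.1 coincides with `v s` itself.
[cite: KochNadirashviliSereginSverak2009, Thm 1.1–1.3 (context: Liouville theorems for ancient solutions; this declaration is the cell’s own lemma or plumbing, NOT a printed statement)] -/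
theorem exists_fderiv_slice_bound (hcont : ContinuousOn (uncurry v) (Iio (0 : ℝ) ×ˢ univ))
    (hbdd : ∀ δ : ℝ, 0 < δ → ∃ B : ℝ, ∀ t < -δ, ∀ y : (EuclideanSpace ℝ (Fin 3)), ‖v t y‖ ≤ B)
    (hmild : ∀ s t : ℝ, s < t → t < 0 → ∀ y : (EuclideanSpace ℝ (Fin 3)),
      v t y = UnboundedOperators.heatExtension (v s) (t - s) y - oseenDuhamel 1 s v v t y)
    {s : ℝ} (hs : s < 0) : ∃ M' : ℝ, ∀ y, ‖fderiv ℝ (v s) y‖ ≤ M' := by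
  have hT : 2 * s < s / 2 := by linarith
  have h2s0 : 2 * s < 0 := by linarith
  obtain ⟨B, hB⟩ := hbdd (-s / 2) (by linarith)
  set M : ℝ := max B 0 with hM
  have hM0 : 0 ≤ M := le_max_right _ _
  have hbound : ∀ t < s / 2, ∀ y, ‖v t y‖ ≤ M := fun t ht y =>
    (hB t (by linarith) y).trans (le_max_left _ _)
  -- hypotheses of KNSS Prop. 4.1 on the window `(2s, s/2)` with datum `v (2s)`
  have ha : AEStronglyMeasurable (v (2 * s)) volume :=
    (continuous_slice hcont h2s0).aestronglyMeasurable
  have haM : eLpNorm (v (2 * s)) ∞ volume ≤ ENNReal.ofReal M := by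
    rw [eLpNorm_exponent_top]
    exact eLpNormEssSup_le_of_ae_bound (Eventually.of_forall fun y => hbound _ (by linarith) y)
  have hsub : Ioo (2 * s) (s / 2) ×ˢ (univ : Set (EuclideanSpace ℝ (Fin 3))) ⊆ Iio 0 ×ˢ univ :=
    prod_mono (fun t ht => lt_trans ht.2 (by linarith)) subset_rfl
  have hu : AEStronglyMeasurable (uncurry v) (volume.restrict (Ioo (2 * s) (s / 2) ×ˢ univ)) :=
    (hcont.mono hsub).aestronglyMeasurable (measurableSet_Ioo.prod MeasurableSet.univ)
  have hub : ∀ t ∈ Ioo (2 * s) (s / 2), eLpNorm (v t) ∞ volume ≤ ENNReal.ofReal M := by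
    intro t ht
    rw [eLpNorm_exponent_top]
    exact eLpNormEssSup_le_of_ae_bound (Eventually.of_forall fun y => hbound t ht.2 y)
  have hmild' : ∀ t ∈ Ioo (2 * s) (s / 2), v t =ᵐ[volume] fun x =>
      UnboundedOperators.heatExtension (v (2 * s)) (1 * (t - 2 * s)) x
        - oseenDuhamel 1 (2 * s) v v t x := fun t ht =>
    Eventually.of_forall fun x => by
      rw [one_mul]; exact hmild (2 * s) t ht.1 (by linarith [ht.2]) x
  obtain ⟨-, -, hk⟩ := knss2009_smoothing_holds (EuclideanSpace ℝ (Fin 3)) one_pos hT hM0 ha haM hu hub hmild'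
  obtain ⟨C, hC⟩ := hk 1 0
  have hsmem : s ∈ Ioo (2 * s) (s / 2) := ⟨by linarith, by linarith⟩
  -- the canonical representative IS `v s` (pointwise identity of the class)
  have hrep : (fun y => iteratedDeriv 0 (fun τ =>
      UnboundedOperators.heatExtension (v (2 * s)) (1 * (τ - 2 * s)) y
        - oseenDuhamel 1 (2 * s) v v τ y) s) = v s := by
    funext y
    rw [iteratedDeriv_zero, one_mul]
    exact (hmild (2 * s) s (by linarith) hs y).symm
  have hpos : 0 < (s - 2 * s) ^ (((1 : ℕ) : ℝ) / 2 + ((0 : ℕ) : ℝ)) := by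
    apply Real.rpow_pos_of_pos; linarith
  refine ⟨C / (s - 2 * s) ^ (((1 : ℕ) : ℝ) / 2 + ((0 : ℕ) : ℝ)), fun y => ?_⟩
  have h := hC s hsmem y
  rw [hrep, norm_iteratedFDeriv_one] at h
  rw [le_div_iff₀ hpos, mul_comm]
  exact h

end Literature.Analysis.NavierStokesZoomKit.LocalSineTubeDoorProfileAlignedWindowRigidityAncient

end Part7

/-!
## Part 8 — port of `Summits/NavierStokesRegularity/NavierStokesRegularity/Theorems/LocalSineTubeDoorProfileAlignedWindowRigidity.lean` (5 declarations kept)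

# Route `LocalSineTubeDoor`, crux `ProfileAlignedWindowRigidity` (stmt-NavierStokesRegularity-20018) — PROVED
# file 3/3: the Type-I planar Liouville step and the route decl

Port to `Theorems/` of the cell proof
`Summit.NavierStokesRegularity.NavierStokesRegularity.Cell.NsRegP1c.profileAlignedWindowRigidity_holds`
(cell ns-regularity-ideate, seat p1, `Sketch5.lean` L3245 / `Sketch8A.lean`, kernel-checked there; landed by seat p6,
`--supports stmt-NavierStokesRegularity-20018`; the final theorem's type is LITERALLY the route decl
`Summit.NavierStokesRegularity.NavierStokesRegularity.Theses.LocalSineTubeDoor.ProfileAlignedWindowRigidity`).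

RIGIDITY OF TYPE-I PROFILES WITH AN ALIGNED WINDOW.  Let `v : (−∞,0) × ℝ³ → ℝ³` have the Type-I time rate
`‖v(t,x)‖ ≤ C/√(−t)`, be continuous on the open slab, unit-viscosity Oseen-mild between any two negative times and
divergence-free.  Then `curl v(−1,·)` is continuous, and if `curl v(−1,y) × e = 0` for all `y` in a nonempty open
`U` (some `e ≠ 0`), then `v(t,·) ≡ 0` for every `t < 0`.  Chain (all tree + the two companion files):

1. (E) slice analyticity (`…Ancient.analyticOnNhd_slice`) + `curl` analytic (tree `analyticOnNhd_curl`) + identity theorem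
   (`…Planarity.cross_eq_zero_spread`): alignment spreads from the window to all of `ℝ³` at time `s`
   (`cross_curl_eq_zero_of_window`);
2. (S)+(D) slice planarity (`…Planarity.translate_eq_of_cross_curl_eq_zero` with the gradient bound
   `…Ancient.exists_fderiv_slice_bound`): `v(s)` is invariant under translations along `e`;
3. (F)+(T) the invariance propagates to every `t < 0` (`…Ancient.translate_eq_forward/backward`);
4. (N₁) ANCIENT PLANAR LIOUVILLE WITH THE TYPE-I RATE (`eq_zero_of_translate_eq`): the tree THEOREM
   `KNSS2009_typeI_rate_liouville_holds` (Koch–Nadirashvili–Seregin–Šverák 2009, proof of Thm 6.2, arXiv p. 13: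
   planar descent + Thm 5.1 + Remark 6.1 + caloric Liouville), stated along the axis `e₂` for globally bounded
   fields, transported to an arbitrary direction `e ≠ 0` by the reflection exchanging `e₂` and `e/‖e‖`
   (`Submodule.reflection_sub`; covariance `heatExtension_conj_linearIsometryEquiv`,
   `oseenDuhamel_symm_conj_linearIsometryEquiv`, `IsDivFree.conj_linearIsometryEquiv`) and to the
   sub-slab-bounded class by the time shift `t ↦ t − δ` (`…Ancient.shift`), under which the rate only improves.

Sources: KNSS 2009 (arXiv:0709.3599) Thm 5.1 / proof of Thm 6.2; Giga–Miura 2011 (doi:10.1007/s00220-011-1197-x)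
§2 (unidirectional ⇒ 2D ⇒ Liouville); Lemarié-Rieusset 2016 Thm 9.12 (analyticity); Seregin 2014 §6.3 (gauge).
WHAT THIS IS NOT: not a claim about Navier–Stokes regularity; it closes the support cone of ONE crux
(rank 3, `provable-now`) of a DRAFT rung-leaf route whose open input is the local zoom `LocalPointZoom`.

Not carried from this source module (not needed by the declarations re-homed here; their consumers are Summits-side): `continuous_curl_slice`, `profileAlignedWindowRigidity_proof`.
-/

section Part8

open _root_.Set _root_.Filter _root_.Function _root_.MeasureTheory _root_.Metric
open scoped _root_.Topology _root_.ENNReal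
open Literature.Analysis Literature.Analysis.FluidPDE
open Literature.Analysis.NavierStokesZoomKit.LocalSineTubeDoorProfileAlignedWindowRigidityPlanarity
open Literature.Analysis.NavierStokesZoomKit.LocalSineTubeDoorProfileAlignedWindowRigidityAncient

namespace Literature.Analysis.NavierStokesZoomKit.LocalSineTubeDoorProfileAlignedWindowRigidity

variable {v : ℝ → (EuclideanSpace ℝ (Fin 3)) → (EuclideanSpace ℝ (Fin 3))}

/-- **(E′) alignment spreads over the slice**: for an Oseen-ancient field and `s < 0`, if `curl v(s) × e = 0`
on a nonempty open set then `curl v(s) × e = 0` on all of `ℝ³` (slice analyticity + identity theorem).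
[cite: KochNadirashviliSereginSverak2009, Thm 1.1–1.3 (context: Liouville theorems for ancient solutions; this declaration is the cell’s own lemma or plumbing, NOT a printed statement)] -/
theorem cross_curl_eq_zero_of_window (hcont : ContinuousOn (uncurry v) (Iio (0 : ℝ) ×ˢ univ))
    (hbdd : ∀ δ : ℝ, 0 < δ → ∃ B : ℝ, ∀ t < -δ, ∀ y : (EuclideanSpace ℝ (Fin 3)), ‖v t y‖ ≤ B)
    (hmild : ∀ s t : ℝ, s < t → t < 0 → ∀ y : (EuclideanSpace ℝ (Fin 3)),
      v t y = UnboundedOperators.heatExtension (v s) (t - s) y - oseenDuhamel 1 s v v t y)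
    {s : ℝ} (hs : s < 0) (e : (EuclideanSpace ℝ (Fin 3))) {U : Set (EuclideanSpace ℝ (Fin 3))} (hU : IsOpen U) (hne : U.Nonempty)
    (h : ∀ y ∈ U, cross (curl (v s) y) e = 0) : ∀ y, cross (curl (v s) y) e = 0 :=
  cross_eq_zero_spread (analyticOnNhd_curl (analyticOnNhd_slice hcont hbdd hmild hs)) e hU hne h

/-- **(S)+(D)+(F)+(T)**: for an Oseen-ancient field with divergence-free slices, if `curl v(s) × e = 0` on all
of `ℝ³` at ONE time `s < 0`, then EVERY slice `v(t)`, `t < 0`, is invariant under translations along `e`.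
[cite: KochNadirashviliSereginSverak2009, Thm 1.1–1.3 (context: Liouville theorems for ancient solutions; this declaration is the cell’s own lemma or plumbing, NOT a printed statement)] -/
theorem translate_eq_of_cross_curl_eq_zero_slice
    (hcont : ContinuousOn (uncurry v) (Iio (0 : ℝ) ×ˢ univ))
    (hbdd : ∀ δ : ℝ, 0 < δ → ∃ B : ℝ, ∀ t < -δ, ∀ y : (EuclideanSpace ℝ (Fin 3)), ‖v t y‖ ≤ B)
    (hmild : ∀ s t : ℝ, s < t → t < 0 → ∀ y : (EuclideanSpace ℝ (Fin 3)),
      v t y = UnboundedOperators.heatExtension (v s) (t - s) y - oseenDuhamel 1 s v v t y)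
    (hdiv : ∀ t < 0, VectorCalculus.IsDivFree (v t))
    {s : ℝ} (hs : s < 0) {e : (EuclideanSpace ℝ (Fin 3))} (hal : ∀ y, cross (curl (v s) y) e = 0) :
    ∀ t < 0, ∀ (y : (EuclideanSpace ℝ (Fin 3))) (l : ℝ), v t (y + l • e) = v t y := by
  have hC : ContDiff ℝ 3 (v s) := (analyticOnNhd_slice hcont hbdd hmild hs).contDiff
  obtain ⟨B, hB⟩ := hbdd (-s / 2) (by linarith)
  have hbd : ∀ y, ‖v s y‖ ≤ B := fun y => hB s (by linarith) y
  obtain ⟨M', hM'⟩ := exists_fderiv_slice_bound hcont hbdd hmild hs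
  have hinv : ∀ (y : (EuclideanSpace ℝ (Fin 3))) (l : ℝ), v s (y + l • e) = v s y := fun y l =>
    translate_eq_of_cross_curl_eq_zero hC (hdiv s hs) hbd hM' hal y l
  exact translate_eq_backward hcont hbdd hmild hs
    (translate_eq_forward hcont hbdd hmild hinv)

/-- `EuclideanSpace.single 1 δ' = δ' • e₂`.
[cite: KochNadirashviliSereginSverak2009, Thm 1.1–1.3 (context: Liouville theorems for ancient solutions; this declaration is the cell’s own lemma or plumbing, NOT a printed statement)] -/
theorem single_one_eq_smul (δ' : ℝ) :
    (EuclideanSpace.single (1 : Fin 3) δ' : (EuclideanSpace ℝ (Fin 3))) = δ' • EuclideanSpace.single (1 : Fin 3) (1 : ℝ) := by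
  ext j
  simp only [EuclideanSpace.single, PiLp.single_apply, PiLp.smul_apply, smul_eq_mul, mul_ite, mul_one, mul_zero]

/-- **(N₁) ancient planar Liouville with the Type-I rate** (KNSS 2009, proof of Thm 6.2, Liouville step; tree
THEOREM `KNSS2009_typeI_rate_liouville_holds` + rotation to the axis `e₂` + time shift): a Type-I-rate,
continuous, Oseen-mild, divergence-free field on `(−∞,0) × ℝ³` all of whose slices are invariant under
translations along some `e ≠ 0` vanishes identically.
[cite: KochNadirashviliSereginSverak2009, Thm 1.1–1.3 (context: Liouville theorems for ancient solutions; this declaration is the cell’s own lemma or plumbing, NOT a printed statement)] -/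
theorem eq_zero_of_translate_eq {C : ℝ} (hrate : HasTypeITimeDecay C v)
    (hcont : ContinuousOn (uncurry v) (Iio (0 : ℝ) ×ˢ univ))
    (hmild : ∀ s t : ℝ, s < t → t < 0 → ∀ y : (EuclideanSpace ℝ (Fin 3)),
      v t y = UnboundedOperators.heatExtension (v s) (t - s) y - oseenDuhamel 1 s v v t y)
    (hdiv : ∀ t < 0, VectorCalculus.IsDivFree (v t)) {e : (EuclideanSpace ℝ (Fin 3))} (he : e ≠ 0)
    (hinv : ∀ t < 0, ∀ (y : (EuclideanSpace ℝ (Fin 3))) (l : ℝ), v t (y + l • e) = v t y) : ∀ t < 0, ∀ y, v t y = 0 := by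
  have hbdd := bdd_of_hasTypeITimeDecay hrate
  -- the unit vector `ê` and the reflection `R` with `R e₂ = ê`; `L := R⁻¹`
  set ehat : (EuclideanSpace ℝ (Fin 3)) := (‖e‖⁻¹ : ℝ) • e with hehat
  have hehat1 : ‖ehat‖ = 1 := norm_smul_inv_norm he
  have he2 : ‖(EuclideanSpace.single (1 : Fin 3) (1 : ℝ) : (EuclideanSpace ℝ (Fin 3)))‖ = ‖ehat‖ := by
    rw [EuclideanSpace.single, PiLp.norm_single, norm_one, hehat1]
  set R : (EuclideanSpace ℝ (Fin 3)) ≃ₗᵢ[ℝ] (EuclideanSpace ℝ (Fin 3)) := Submodule.reflection (ℝ ∙ (EuclideanSpace.single (1 : Fin 3) (1 : ℝ) - ehat))ᗮ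
    with hR
  have hRe : R (EuclideanSpace.single (1 : Fin 3) (1 : ℝ)) = ehat := Submodule.reflection_sub he2
  set L : (EuclideanSpace ℝ (Fin 3)) ≃ₗᵢ[ℝ] (EuclideanSpace ℝ (Fin 3)) := R.symm with hL
  have hLs : ∀ x, L.symm x = R x := fun x => by rw [hL, LinearIsometryEquiv.symm_symm]
  -- it suffices to prove vanishing on every shifted slab
  suffices key : ∀ δ : ℝ, 0 < δ → ∀ t < 0, ∀ x : (EuclideanSpace ℝ (Fin 3)), v (t + -δ) (L.symm x) = 0 by
    intro t ht y
    have h := key (-t / 2) (by linarith) (t / 2) (by linarith) (L y)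
    rw [LinearIsometryEquiv.symm_apply_apply] at h
    have htt : t / 2 + -(-t / 2) = t := by ring
    rwa [htt] at h
  intro δ hδ
  obtain ⟨hc', ⟨M, hM⟩, hm'⟩ := shift hcont hbdd hmild hδ
  -- the conjugated, shifted field
  set u : ℝ → (EuclideanSpace ℝ (Fin 3)) → (EuclideanSpace ℝ (Fin 3)) := fun t x => L (v (t + -δ) (L.symm x)) with hu
  have hLiou := KNSS2009_typeI_rate_liouville_holds (C := C) (W := u)
  -- (a) continuity
  have ha : ContinuousOn (uncurry u) (Iio (0 : ℝ) ×ˢ univ) := by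
    have h1 : ContinuousOn (fun p : ℝ × (EuclideanSpace ℝ (Fin 3)) => (p.1, L.symm p.2)) (Iio (0 : ℝ) ×ˢ univ) :=
      (continuous_fst.prodMk (L.symm.continuous.comp continuous_snd)).continuousOn
    have h2 : MapsTo (fun p : ℝ × (EuclideanSpace ℝ (Fin 3)) => (p.1, L.symm p.2)) (Iio (0 : ℝ) ×ˢ univ) (Iio 0 ×ˢ univ) :=
      fun p hp => mem_prod.2 ⟨(mem_prod.1 hp).1, mem_univ _⟩
    exact L.continuous.comp_continuousOn (hc'.comp h1 h2)
  -- (b) global bound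
  have hb : ∃ K : ℝ, ∀ t < 0, ∀ x, ‖u t x‖ ≤ K :=
    ⟨M, fun t ht x => by rw [hu]; dsimp only; rw [L.norm_map]; exact hM t ht _⟩
  -- (c) weakly divergence-free slices
  have hc : ∀ t < 0, IsWeaklyDivFree (u t) := by
    intro t ht
    have htδ : t + -δ < 0 := by linarith
    have hsm : ContDiff ℝ 1 (v (t + -δ)) := (analyticOnNhd_slice hcont hbdd hmild htδ).contDiff
    have hdiv' : VectorCalculus.IsDivFree (fun y => L (v (t + -δ) (L.symm y))) :=
      (hdiv (t + -δ) htδ).conj_linearIsometryEquiv L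
    exact VectorCalculus.IsDivFree.isWeaklyDivFree_holds hdiv'
      (L.contDiff.comp (hsm.comp L.symm.contDiff))
  -- (d) the Oseen identity, by covariance
  have hd : ∀ s t : ℝ, s < t → t < 0 → ∀ x,
      u t x = UnboundedOperators.heatExtension (u s) (t - s) x - oseenDuhamel 1 s u u t x := by
    intro s t hst ht0 x
    have h1 : UnboundedOperators.heatExtension (u s) (t - s) x =
        L (UnboundedOperators.heatExtension (v (s + -δ)) (t - s) (L.symm x)) :=
      heatExtension_conj_linearIsometryEquiv L (v (s + -δ)) (t - s) x
    have h2 := oseenDuhamel_symm_conj_linearIsometryEquiv L.symm 1 s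
      (fun τ => v (τ + -δ)) (fun τ => v (τ + -δ)) t x
    simp only [LinearIsometryEquiv.symm_symm] at h2
    have h3 := hm' s t hst ht0 (L.symm x)
    dsimp only at h3
    show L (v (t + -δ) (L.symm x)) = _
    rw [h1, h2, h3, map_sub]
  -- (e) invariance along `e₂`
  have he' : ∀ t < 0, ∀ (x : (EuclideanSpace ℝ (Fin 3))) (δ' : ℝ), u t (x + EuclideanSpace.single 1 δ') = u t x := by
    intro t ht x δ'
    have htδ : t + -δ < 0 := by linarith
    show L (v (t + -δ) (L.symm (x + EuclideanSpace.single 1 δ'))) = L (v (t + -δ) (L.symm x))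
    rw [map_add, single_one_eq_smul, LinearIsometryEquiv.map_smul, hLs (EuclideanSpace.single 1 1),
      hRe, hehat, smul_smul]
    rw [hinv (t + -δ) htδ (L.symm x) (δ' * ‖e‖⁻¹)]
  -- (f) the rate only improves under the shift
  have hf : ∀ t < 0, ∀ x, Real.sqrt (-t) * ‖u t x‖ ≤ C := by
    intro t ht x
    have htδ : t + -δ < 0 := by linarith
    have hnorm : ‖u t x‖ = ‖v (t + -δ) (L.symm x)‖ := by rw [hu]; dsimp only; rw [L.norm_map]
    have hr := hrate (t + -δ) htδ (L.symm x)
    have hspos : 0 < Real.sqrt (-(t + -δ)) := Real.sqrt_pos.2 (by linarith)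
    have hle : Real.sqrt (-t) ≤ Real.sqrt (-(t + -δ)) := Real.sqrt_le_sqrt (by linarith)
    rw [hnorm]
    calc Real.sqrt (-t) * ‖v (t + -δ) (L.symm x)‖
        ≤ Real.sqrt (-(t + -δ)) * ‖v (t + -δ) (L.symm x)‖ :=
          mul_le_mul_of_nonneg_right hle (norm_nonneg _)
      _ ≤ Real.sqrt (-(t + -δ)) * (C / Real.sqrt (-(t + -δ))) :=
          mul_le_mul_of_nonneg_left hr hspos.le
      _ = C := by field_simp
  intro t ht x
  have h0 := hLiou ha hb hc hd he' hf t ht x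
  have h0' : L (v (t + -δ) (L.symm x)) = 0 := h0
  exact (LinearIsometryEquiv.map_eq_zero_iff L).1 h0'

/-- **Door 2C restricted to Type-I profiles.**  A Type-I-rate, continuous, Oseen-mild, divergence-free field on
`(−∞,0) × ℝ³` whose vorticity at ONE negative time `s` is parallel to a fixed `e ≠ 0` on ONE nonempty open set
vanishes identically.
[cite: KochNadirashviliSereginSverak2009, Thm 1.1–1.3 (context: Liouville theorems for ancient solutions; this declaration is the cell’s own lemma or plumbing, NOT a printed statement)] -/
theorem eq_zero_of_aligned_window {C : ℝ} (hrate : HasTypeITimeDecay C v)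
    (hcont : ContinuousOn (uncurry v) (Iio (0 : ℝ) ×ˢ univ))
    (hmild : ∀ s t : ℝ, s < t → t < 0 → ∀ y : (EuclideanSpace ℝ (Fin 3)),
      v t y = UnboundedOperators.heatExtension (v s) (t - s) y - oseenDuhamel 1 s v v t y)
    (hdiv : ∀ t < 0, VectorCalculus.IsDivFree (v t)) {s : ℝ} (hs : s < 0) {e : (EuclideanSpace ℝ (Fin 3))} (he : e ≠ 0)
    {U : Set (EuclideanSpace ℝ (Fin 3))} (hU : IsOpen U) (hne : U.Nonempty) (hal : ∀ y ∈ U, cross (curl (v s) y) e = 0) :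
    ∀ t < 0, ∀ y, v t y = 0 := by
  have hbdd := bdd_of_hasTypeITimeDecay hrate
  exact eq_zero_of_translate_eq hrate hcont hmild hdiv he
    (translate_eq_of_cross_curl_eq_zero_slice hcont hbdd hmild hdiv hs
      (cross_curl_eq_zero_of_window hcont hbdd hmild hs e hU hne hal))

end Literature.Analysis.NavierStokesZoomKit.LocalSineTubeDoorProfileAlignedWindowRigidity

end Part8

/-!
## Part 9 — port of `Summits/NavierStokesRegularity/NavierStokesRegularity/Theorems/ClockStretchingLawClockCeilingSingularStretchingNearZero.lean` (1 declarations kept)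

# Route ClockStretchingLaw, crux `ClockCeiling` (stmt-NavierStokesRegularity-10570) — a singular
# Type-I model stretches its vorticity at the full gauge rate near the singular time

Portrait clause for the crux's Type-I class `𝒦_C` (jointly smooth on `(−∞,0) × ℝ³`,
divergence-free, KNSS/Oseen-mild, `‖u(t,x)‖ ≤ C/√(−t)`, scale-invariant local energies
`A, E ≤ C`), complementing the far-past rung `farPastStretchingRung`:

**`singularStretchingNearZero`.** If `u ∈ 𝒦_C` is SINGULAR at the space–time origin (unbounded
on every backward parabolic cylinder `Q(0, r)`), then for every `T < 0` and every `θ < 1` there is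
a point `(t, x)` with `T < t < 0`, `ω(t,x) ≠ 0` and gauge stretching rate along the vorticity
direction `(−t)⟪∇u(t,x) ξ, ξ⟫ > θ`. In words: `limsup_{t → 0⁻} sup_{ω ≠ 0} (−t)⟪S ξ, ξ⟫ ≥ 1`
along every singular Type-I model — the ancient-solution counterpart of the Beale–Kato–Majda
mechanism, with the sharp constant `1` of the maximum principle.

## Proof

By contradiction: a uniform bound `(−t)⟪∇u ξ, ξ⟫ ≤ θ < 1` on `(T, 0) × ℝ³ ∩ {ω ≠ 0}` is
scale-invariant, so it holds for the zooms `u_c = c u(c² ·, c ·)` on `(T/c², 0)`. Along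
`c_j = 1/(j+1) → 0` a subsequence of zooms converges pointwise to an element `W ∈ 𝒦_C`
(`ClockLaw.Birth.stub_zoomExtraction`), singular at the origin by persistence of singularities
(`ClockLaw.Birth.stub_limitSingular` with the landed class pressure `classPressure_holds`), hence
`W ≢ 0`. Gradients converge (`tendsto_fderiv_apply_of_typeI` under the class-uniform KNSS bound
`‖∇²u_c‖ ≤ K(C)(−t)^{−3/2}` of `uniformBounds_exists_mixed`), so wherever `curl W(t,x) ≠ 0` the
curls, the vorticity directions and the stretching rates of the zooms converge to those of `W`,
and `W` inherits `(−t)⟪∇W ξ, ξ⟫ ≤ θ` for ALL `t < 0`. The far-past rung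
(`farPastStretchingRung`, `T = 0`) forces `W ≡ 0` — contradiction.

## References

* G. Koch, N. Nadirashvili, G. Seregin, V. Šverák, Acta Math. 203 (2009) 83–105, Prop. 4.1,
  Lemma 3.1, Remark 6.1 (arXiv:0709.3599). [KochNadirashviliSereginSverak2009]
* D. Albritton, T. Barker, *Global weak Besov solutions of the Navier–Stokes equations and
  applications*, ARMA 232 (2019), Lemma 2.2, Prop. 2.3 (persistence of singularities,
  arXiv:1811.00502). [AlbrittonBarker2019]
* J. T. Beale, T. Kato, A. Majda, Comm. Math. Phys. 94 (1984) 61–66. [BealeKatoMajda1984]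

Not carried from this source module (not needed by the declarations re-homed here; their consumers are Summits-side): `fderiv_nsZoom_origin`, `curl_nsZoom_origin`, `gaugeStretching_nsZoom_origin`, `singularStretchingNearZero`, `stub_singularStretchingNearZero`.
-/

section Part9

open _root_.Set _root_.Function _root_.Filter _root_.Topology _root_.Metric
open scoped RealInnerProductSpace

namespace Literature.Analysis.NavierStokesZoomKit

open Literature.Analysis Literature.Analysis.FluidPDE

/-- Normalising a positive multiple of a vector gives the same unit vector:
`‖a v‖⁻¹ (a v) = ‖v‖⁻¹ v` for `0 < a`. [folklore]
[cite: GigaMiura2011, §2 proof of Thm 1.1 / Cor. 2.6 (source of the blow-up argument along the vorticity direction this module implements; this declaration is the cell’s own lemma, NOT a printed statement)] -/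
theorem inv_norm_smul_smul_of_pos {a : ℝ} (ha : 0 < a) (v : EuclideanSpace ℝ (Fin 3)) :
    ‖a • v‖⁻¹ • (a • v) = ‖v‖⁻¹ • v := by
  rw [norm_smul, Real.norm_of_nonneg ha.le, mul_inv, smul_smul, mul_comm a⁻¹, mul_assoc,
    inv_mul_cancel₀ ha.ne', mul_one]

end Literature.Analysis.NavierStokesZoomKit

end Part9

/-!
## Part 10 — port of `Summits/NavierStokesRegularity/NavierStokesRegularity/Theorems/ScaledTopAlignmentDirectionGradientSelection.lean` (3 declarations kept)

# Route `ScaledTopAlignment`: slice selection under a square-integrable-in-time majorant, and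
# differentiability of the vorticity direction (tools for the tree's discharge of Giga–Miura 2011,
# Cor. 2.6, `ScaledTopAlignmentGigaMiuraDirectionGradient`; support for the deciding crux W3ᵐᵗ =
# `AprioriMostTimesBulkAlignment`, stmt-NavierStokesRegularity-19551; no import of the route file)

Giga–Miura 2011, Cor. 2.6 (HUPS #956 p. 9) assumes `∫ ‖∇ζ(t)‖²_{L^∞(Ω_d(t))} dt < ∞` — a hypothesis
that is INTEGRATED IN TIME and SCALING INVARIANT. Under the Type-I zoom `t = T + λ_j² s/ν`,
`y ↦ x_j + λ_j y`, the zoomed direction fields have gradient bound `H_j(s) = λ_j g(T + λ_j² s/ν)`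
(`g` a majorant of the printed `L^∞` norm), and scaling invariance is exactly the statement that
`∫_{(a,b)} H_j(s)² ds = ν ∫_{(T + λ_j² a/ν, T + λ_j² b/ν)} g(t)² dt` — a tail of the finite integral
`∫_{(0,T)} g²`, which tends to zero. Fatou then gives `liminf_j H_j(s)² = 0` for a.e. slice `s`, hence
a slice `s₀ ∈ (a, b)` at which `H_j(s₀) < η` frequently in `j`, for every `η > 0`
(`exists_slice_frequently_lt_of_sqIntegrable`). This is the "selection of an a.e. slice" step of the
discharge; the other two declarations are the affine substitution it uses
(`setLIntegral_Ioo_comp_add_mul`) and the differentiability of `ξ = ω/|ω|` away from `ω = 0`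
(`differentiableAt_vorticityDirection`), used for the mean-value step.
WHAT THIS IS NOT: not NS regularity; measure theory and calculus only.

## References
* Y. Giga, H. Miura, Comm. Math. Phys. 303 (2011) 289–300 = HUPS #956: Cor. 2.6, Rmk. 2.7–2.8
  (pp. 9–10). [GigaMiura2011]
-/

section Part10

open _root_.MeasureTheory _root_.Set _root_.Function _root_.Filter _root_.Topology _root_.Metric
open scoped RealInnerProductSpace _root_.ENNReal _root_.NNReal

namespace Literature.Analysis.NavierStokesZoomKit

open Literature.Analysis Literature.Analysis.FluidPDE

/-! ### Two elementary lemmas -/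

/-- Affine substitution `t = c + μ s` (`μ > 0`) in a lower integral over an interval:
`∫_{(a,b)} G(c + μ s) ds = μ⁻¹ ∫_{(c + μ a, c + μ b)} G(t) dt`, for every `G : ℝ → [0, ∞]`
(Mathlib's `Real.map_volume_mul_left`, `lintegral_map_equiv`, `lintegral_add_right_eq_self`).
[folklore]
[cite: GigaMiura2011, §2 proof of Thm 1.1 / Cor. 2.6 (source of the blow-up argument along the vorticity direction this module implements; this declaration is the cell’s own lemma, NOT a printed statement)] -/
theorem setLIntegral_Ioo_comp_add_mul {μ : ℝ} (hμ : 0 < μ) (c a b : ℝ) (G : ℝ → ℝ≥0∞) :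
    ∫⁻ s in Ioo a b, G (c + μ * s) =
      ENNReal.ofReal μ⁻¹ * ∫⁻ t in Ioo (c + μ * a) (c + μ * b), G t := by
  -- adapted from the tree's `Literature.Analysis.FluidPDE.lintegral_comp_mul_add` (TaoY6RadialChange)
  set Φ : ℝ → ℝ≥0∞ := (Ioo (c + μ * a) (c + μ * b)).indicator G with hΦ
  have hind : ∀ s, (Ioo a b).indicator (fun s => G (c + μ * s)) s = Φ (μ * s + c) := by
    intro s
    by_cases hs : s ∈ Ioo a b
    · have hs' : μ * s + c ∈ Ioo (c + μ * a) (c + μ * b) :=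
        ⟨by nlinarith [hs.1], by nlinarith [hs.2]⟩
      rw [indicator_of_mem hs, hΦ, indicator_of_mem hs', add_comm]
    · have hs' : μ * s + c ∉ Ioo (c + μ * a) (c + μ * b) := by
        intro h
        exact hs ⟨by nlinarith [h.1], by nlinarith [h.2]⟩
      rw [indicator_of_notMem hs, hΦ, indicator_of_notMem hs']
  rw [← lintegral_indicator measurableSet_Ioo, ← lintegral_indicator measurableSet_Ioo]
  simp_rw [hind]
  have h1 : ∫⁻ r, Φ (μ * r + c) = ∫⁻ r, Φ (μ * r) := by
    have h := lintegral_add_right_eq_self (μ := (volume : Measure ℝ)) (fun r => Φ (μ * r)) (c / μ)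
    rw [← h]
    refine lintegral_congr fun r => ?_
    congr 1
    field_simp
  rw [h1]
  have h2 : ∫⁻ r, Φ (μ * r) = ∫⁻ s, Φ s ∂(Measure.map (μ * ·) volume) :=
    (lintegral_map_equiv Φ (Homeomorph.mulLeft₀ μ hμ.ne').toMeasurableEquiv).symm
  rw [h2, Real.map_volume_mul_left hμ.ne', lintegral_smul_measure, abs_of_pos (inv_pos.2 hμ),
    smul_eq_mul]

/-- The vorticity direction `ξ = ω/|ω|` is differentiable wherever `ω` is differentiable and
non-zero. [folklore]
[cite: GigaMiura2011, §2 proof of Thm 1.1 / Cor. 2.6 (source of the blow-up argument along the vorticity direction this module implements; this declaration is the cell’s own lemma, NOT a printed statement)] -/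
theorem differentiableAt_vorticityDirection
    {ω : EuclideanSpace ℝ (Fin 3) → EuclideanSpace ℝ (Fin 3)} {x : EuclideanSpace ℝ (Fin 3)}
    (hω : DifferentiableAt ℝ ω x) (hx : ω x ≠ 0) :
    DifferentiableAt ℝ (vorticityDirection ω) x := by
  have h1 : DifferentiableAt ℝ (fun y => ‖ω y‖) x := hω.norm ℝ hx
  have h2 : DifferentiableAt ℝ (fun y => ‖ω y‖⁻¹) x := h1.inv (norm_ne_zero_iff.2 hx)
  show DifferentiableAt ℝ (fun y => ‖ω y‖⁻¹ • ω y) x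
  exact h2.smul hω

/-! ### Slice selection under a square-integrable-in-time majorant -/

/-- **Selection of an a.e. slice.** Let `g : ℝ → [0, ∞]` be measurable with `∫_{(0,T)} g² < ∞`
(`T > 0`, `ν > 0`), let `λ_j > 0`, `λ_j → 0`, and let `a < b < 0`. Then some slice `s₀ ∈ (a, b)`
has `λ_j g(T + λ_j² s₀/ν) < η` frequently in `j`, for every `η > 0`: the scaled majorants
`H_j(s) = λ_j g(T + λ_j² s/ν)` satisfy `∫_{(a,b)} H_j² = ν ∫_{(T + λ_j² a/ν, T + λ_j² b/ν)} g² → 0`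
(affine substitution + absolute continuity of the finite integral, `tendsto_setLIntegral_zero`), so
`liminf_j H_j(s)² = 0` for a.e. `s ∈ (a, b)` by Fatou (`lintegral_liminf_le'`). [folklore]
[cite: GigaMiura2011, §2 proof of Thm 1.1 / Cor. 2.6 (source of the blow-up argument along the vorticity direction this module implements; this declaration is the cell’s own lemma, NOT a printed statement)] -/
theorem exists_slice_frequently_lt_of_sqIntegrable {ν T : ℝ} (hν : 0 < ν) (hT : 0 < T)
    {g : ℝ → ℝ≥0∞} (hgm : Measurable g) (hg2 : (∫⁻ t in Ioo 0 T, g t ^ 2) < ∞)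
    {lam : ℕ → ℝ} (hlam : ∀ j, 0 < lam j) (hlam0 : Tendsto lam atTop (𝓝 0))
    {a b : ℝ} (hab : a < b) (hb : b < 0) :
    ∃ s₀ ∈ Ioo a b, ∀ η : ℝ, 0 < η → ∃ᶠ j in atTop,
      ENNReal.ofReal (lam j) * g (T + lam j ^ 2 / ν * s₀) < ENNReal.ofReal η := by
  have hc : ∀ j, 0 < lam j ^ 2 / ν := fun j => div_pos (pow_pos (hlam j) 2) hν
  have hc0 : Tendsto (fun j => lam j ^ 2 / ν) atTop (𝓝 0) := by
    have h := (hlam0.pow 2).div_const ν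
    rw [zero_pow two_ne_zero, zero_div] at h
    exact h
  set H : ℕ → ℝ → ℝ≥0∞ := fun j s => ENNReal.ofReal (lam j) * g (T + lam j ^ 2 / ν * s) with hHdef
  have hgc : ∀ j, Measurable fun s : ℝ => g (T + lam j ^ 2 / ν * s) := fun j =>
    hgm.comp ((measurable_id.const_mul (lam j ^ 2 / ν)).const_add T)
  have hHm : ∀ j, Measurable (H j) := fun j => (hgc j).const_mul _
  -- the change of variables
  have hInt : ∀ j, ∫⁻ s in Ioo a b, H j s ^ 2 =
      ENNReal.ofReal ν * ∫⁻ t in Ioo (T + lam j ^ 2 / ν * a) (T + lam j ^ 2 / ν * b), g t ^ 2 := by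
    intro j
    have e1 : (fun s => H j s ^ 2) =
        fun s => ENNReal.ofReal (lam j) ^ 2 * g (T + lam j ^ 2 / ν * s) ^ 2 := by
      funext s; simp only [hHdef]; rw [mul_pow]
    have h3 : ∫⁻ s in Ioo a b, g (T + lam j ^ 2 / ν * s) ^ 2 = ENNReal.ofReal (lam j ^ 2 / ν)⁻¹ *
        ∫⁻ t in Ioo (T + lam j ^ 2 / ν * a) (T + lam j ^ 2 / ν * b), g t ^ 2 :=
      setLIntegral_Ioo_comp_add_mul (hc j) T a b (fun t => g t ^ 2)
    have e2 : ENNReal.ofReal (lam j) ^ 2 * ENNReal.ofReal (lam j ^ 2 / ν)⁻¹ = ENNReal.ofReal ν := by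
      rw [← ENNReal.ofReal_pow (hlam j).le, ← ENNReal.ofReal_mul (pow_nonneg (hlam j).le 2)]
      congr 1
      have hl : lam j ^ 2 ≠ 0 := pow_ne_zero 2 (hlam j).ne'
      rw [div_eq_mul_inv, mul_inv, inv_inv, ← mul_assoc, mul_inv_cancel₀ hl, one_mul]
    rw [e1, lintegral_const_mul _ ((hgc j).pow_const 2), h3, ← mul_assoc, e2]
  -- the physical windows shrink into `(0, T)` and their length tends to zero
  have hsub : ∀ᶠ j in atTop, Ioo (T + lam j ^ 2 / ν * a) (T + lam j ^ 2 / ν * b) ⊆ Ioo 0 T := by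
    have h1 : Tendsto (fun j => lam j ^ 2 / ν * (-a)) atTop (𝓝 (0 * (-a))) := hc0.mul_const _
    rw [zero_mul] at h1
    filter_upwards [h1.eventually_lt_const hT] with j hj
    intro t ht
    have hb' : lam j ^ 2 / ν * b < 0 := mul_neg_of_pos_of_neg (hc j) hb
    exact ⟨by linarith [ht.1], by linarith [ht.2]⟩
  have hvol : Tendsto (fun j => (volume.restrict (Ioo 0 T))
      (Ioo (T + lam j ^ 2 / ν * a) (T + lam j ^ 2 / ν * b))) atTop (𝓝 0) := by
    have h1 : Tendsto (fun j => ENNReal.ofReal (lam j ^ 2 / ν * (b - a))) atTop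
        (𝓝 (ENNReal.ofReal (0 * (b - a)))) := ENNReal.tendsto_ofReal (hc0.mul_const _)
    rw [zero_mul, ENNReal.ofReal_zero] at h1
    refine tendsto_of_tendsto_of_tendsto_of_le_of_le tendsto_const_nhds h1 (fun _ => zero_le)
      fun j => ?_
    calc (volume.restrict (Ioo 0 T)) (Ioo (T + lam j ^ 2 / ν * a) (T + lam j ^ 2 / ν * b))
        ≤ volume (Ioo (T + lam j ^ 2 / ν * a) (T + lam j ^ 2 / ν * b)) :=
          Measure.le_iff'.1 Measure.restrict_le_self _
      _ = ENNReal.ofReal (lam j ^ 2 / ν * (b - a)) := by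
          rw [Real.volume_Ioo]; ring_nf
  have htail : Tendsto (fun j => ∫⁻ t in Ioo (T + lam j ^ 2 / ν * a) (T + lam j ^ 2 / ν * b),
      g t ^ 2 ∂(volume.restrict (Ioo 0 T))) atTop (𝓝 0) :=
    tendsto_setLIntegral_zero (μ := volume.restrict (Ioo 0 T))
      (s := fun j => Ioo (T + lam j ^ 2 / ν * a) (T + lam j ^ 2 / ν * b)) hg2.ne hvol
  have hL2 : Tendsto (fun j => ∫⁻ s in Ioo a b, H j s ^ 2) atTop (𝓝 0) := by
    have h1 : Tendsto (fun j => ENNReal.ofReal ν *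
        ∫⁻ t in Ioo (T + lam j ^ 2 / ν * a) (T + lam j ^ 2 / ν * b),
          g t ^ 2 ∂(volume.restrict (Ioo 0 T))) atTop (𝓝 0) := by
      have h := ENNReal.Tendsto.const_mul (a := ENNReal.ofReal ν) htail (Or.inr ENNReal.ofReal_ne_top)
      rwa [mul_zero] at h
    refine h1.congr' ?_
    filter_upwards [hsub] with j hj
    rw [hInt j, Measure.restrict_restrict measurableSet_Ioo, inter_eq_self_of_subset_left hj]
  -- Fatou
  have hFatou : ∫⁻ s in Ioo a b, liminf (fun j => H j s ^ 2) atTop = 0 := by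
    refine le_antisymm ?_ zero_le
    calc ∫⁻ s in Ioo a b, liminf (fun j => H j s ^ 2) atTop
        ≤ liminf (fun j => ∫⁻ s in Ioo a b, H j s ^ 2) atTop :=
          lintegral_liminf_le' fun j => ((hHm j).pow_const 2).aemeasurable
      _ = 0 := hL2.liminf_eq
  have hae0 : ∀ᵐ s ∂(volume.restrict (Ioo a b)), liminf (fun j => H j s ^ 2) atTop = 0 := by
    have h := (lintegral_eq_zero_iff' (Measurable.liminf fun j => (hHm j).pow_const 2).aemeasurable).1
      hFatou
    filter_upwards [h] with s hs
    simpa using hs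
  -- an admissible slice `s₀ ∈ (a, b)`
  have hab0 : volume (Ioo a b) ≠ 0 := by
    rw [Real.volume_Ioo]; exact (ENNReal.ofReal_pos.2 (by linarith)).ne'
  haveI : (ae (volume.restrict (Ioo a b))).NeBot :=
    ae_neBot.2 (by rwa [Ne, Measure.restrict_eq_zero])
  obtain ⟨s₀, hs₀mem, hs₀⟩ := ((ae_restrict_mem measurableSet_Ioo).and hae0).exists
  have hfreq : ∀ η : ℝ, 0 < η → ∃ᶠ j in atTop, H j s₀ < ENNReal.ofReal η := by
    intro η hη
    have hη' : (0 : ℝ≥0∞) < ENNReal.ofReal η ^ 2 := ENNReal.pow_pos (ENNReal.ofReal_pos.2 hη) 2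
    have hlt : liminf (fun j => H j s₀ ^ 2) atTop < ENNReal.ofReal η ^ 2 := by rw [hs₀]; exact hη'
    refine (frequently_lt_of_liminf_lt (h := hlt)).mono fun j hj => ?_
    by_contra hle
    have hge : ENNReal.ofReal η ≤ H j s₀ := not_lt.1 hle
    have : ENNReal.ofReal η ^ 2 ≤ H j s₀ ^ 2 := by gcongr
    exact absurd hj (not_lt.2 this)
  exact ⟨s₀, hs₀mem, hfreq⟩

end Literature.Analysis.NavierStokesZoomKit

end Part10

/-!
## Part 11 — port of `Summits/NavierStokesRegularity/NavierStokesRegularity/Theorems/ScaledTopAlignmentGigaMiuraDirectionGradient.lean` (2 declarations kept)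

# Route `ScaledTopAlignment`: Giga–Miura 2011, **Corollary 2.6** — a square-integrable-in-time `L^∞`
# bound on the gradient of the vorticity direction over the top region excludes Type-I blow-up —
# PROVED in the tree's Leray–Hopf frame (support for the deciding crux W3ᵐᵗ =
# `AprioriMostTimesBulkAlignment`, stmt-NavierStokesRegularity-19551; no import of the route file)

Source: Y. Giga, H. Miura, *On vorticity directions near singularities for the Navier–Stokes flows
with infinite energy*, Comm. Math. Phys. **303** (2011) 289–300 [GigaMiura2011], read in the
submitted text = Hokkaido University Preprint Series in Mathematics #956 (render
`run/shared/lean/pub/ns-regularity-ideate/ns-regularity-ideate-lit/renders/GM11-HokkaidoPreprint956-full/`,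
pp. 9–10; the render's subscript glyph `L1` is `L^∞`, see the render README's glyph caveat and
p. 10, l. 1–3: "This assumption [Beirão da Veiga–Berselli's `2/a + 3/b = 1/2`] is not scaling
invariant while ours is scaling invariant. It is easy to generalize our assumption in this form with
`2/a + 3/b = 1` and `2 ≤ a < ∞`" — the exponent pair of Cor. 2.6 is `(a, b) = (2, ∞)`).

* **Corollary 2.6** (p. 9, verbatim up to notation). "Let `u` be a type I mild solution of (NS)
  for `ℝ³ × (−1, 0)`. For a given `d > 0` assume that `∫_{−1}^{0} ‖∇ζ‖²_{L^∞(Ω_d(t))}(t) dt < +∞`,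
  where `Ω_d(t)` is defined as Theorem 1.1 [`Ω_d(t) = {x ∈ ℝ³ : |ω(x,t)| > d}`, `ζ = ω/|ω|`,
  `ω = curl u`]. Then `u` does not blow up at `t = 0`."
* **Remark 2.7** (p. 9): "Our assumption implies that `∇ζ` [of the blow-up limit] is identically
  zero. Hence `ζ` turns out to be a constant vector as in the proof of Proposition 2.2. Thus the
  proof is reduced to one of Theorem 1.1."

This is the one PRINTED member of the vorticity-direction family of regularity criteria whose
hypothesis is INTEGRATED IN TIME (so that `‖∇ζ(t)‖_{L^∞(Ω_d(t))}` may be unbounded on a sparse set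
of times) — the nearest print ancestor of the route's MOST-TIMES door W3ᵐᵗ (stmt-19551), which asks
for window-bulk alignment only off an exceptional time set of final density `< 1`.

## What is proved here

* `hasSmoothExtensionPast_of_directionGradient_sqIntegrable_typeI` — Cor. 2.6 in the frame of the
  tree's `Literature.Analysis.FluidPDE.gigaMiura_continuousAlignment_typeI` (GM11 Thm 1.1; the named
  Literature statement `Literature.Analysis.FluidPDE.gigaMiura2011_directionGradient_typeI` is this
  theorem's type and is discharged from it by name in a companion file): a
  classical solution on `ℝ³ × [0, T)`, Leray–Hopf from `u 0`, bounded on every `[0, T'] × ℝ³`,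
  Type I at `T` (`IsTypeIBlowup u T`); the printed hypothesis is rendered by a measurable
  majorant `g : ℝ → [0, ∞]` of `t ↦ ‖∇ξ(t)‖_{L^∞(Ω_d(t))}` with `∫_{(0,T)} g² < ∞`
  (`‖D ξ(t,·)(x)‖ₑ ≤ g t` whenever `|ω(t,x)| > d`, `ξ = vorticityDirection (curl (u t))`, operator
  norm of the Fréchet derivative; for the classical solutions of the frame the printed
  `t ↦ ‖∇ζ(t)‖_{L^∞(Ω_d(t))}` is itself such a `g` — it is lower semicontinuous, the sup of a
  jointly continuous quantity over an open `t`-dependent set — so the two readings agree);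
  conclusion `HasSmoothExtensionPast ν 0 u T`, as for Thm 1.1.
* `false_of_directionGradient_sqIntegrable_typeI` — the blow-up form: the hypotheses plus
  "no smooth extension past `T`" are contradictory — **Cor. 2.6 is PROVED**.

## The proof (Remark 2.7 made honest; the cell's Type-I zoom kit)

1. The flexible Type-I zoom with locally uniform slice convergence
   (`typeIZoom_ancientMild_limit_flexible_locUnif`): a non-trivial Type-I ancient mild limit `W`,
   `(λ_j²/ν) ω(T + λ_j² s/ν, x_j + λ_j y) → curl W(s)(y)` locally uniformly in `y`, every `s < 0`.
2. A non-unidirectional — in particular non-irrotational — vorticity END `s < t₁` of `W`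
   (`exists_end_curl_not_unidirectional`).
3. **Selection of an a.e. slice (new; companion module
   `ScaledTopAlignmentDirectionGradientSelection`, `exists_slice_frequently_lt_of_sqIntegrable`).**
   The zoomed direction fields `ζ_j(s, y) = ξ(T + λ_j² s/ν, x_j + λ_j y)` have
   `‖∇_y ζ_j(s, ·)‖ ≤ λ_j g(T + λ_j² s/ν) =: H_j(s)` on the zoomed top region, and by the affine
   substitution `t = T + λ_j² s/ν`, `∫_{(a,b)} H_j(s)² ds = ν ∫_{(T + λ_j² a/ν, T + λ_j² b/ν)} g(t)² dt → 0`
   (absolute continuity of the finite integral `∫_{(0,T)} g²`) — scaling invariance of the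
   hypothesis is exactly what makes the powers of `λ_j` cancel. Fatou gives `liminf_j H_j(s)² = 0`
   for a.e. `s ∈ (a, b) = (t₁ − 1, t₁)`, hence a slice `s₀ < t₁` with `H_j(s₀) < η` frequently in
   `j`, for every `η > 0`.
4. **Mean value on the zoomed direction field (new).** At `s₀` pick `y₀` with `curl W(s₀)(y₀) ≠ 0`
   and a closed ball `B̄(y₀, r)` on which `|curl W(s₀)| > ¾|curl W(s₀)(y₀)|`; by the locally uniform
   convergence the zoomed vorticities exceed `½|curl W(s₀)(y₀)| > d λ_j²/ν` on the ball for large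
   `j`, i.e. the ball's preimage lies in `Ω_d`, so `ζ_j(s₀, ·)` is differentiable there
   (`differentiableAt_vorticityDirection`) with `‖∇ζ_j‖ ≤ H_j(s₀)` (chain rule) and
   `|ζ_j(s₀,y) − ζ_j(s₀,y₀)| ≤ H_j(s₀) r`
   (`Convex.norm_image_sub_le_of_norm_fderiv_le`). Since `ζ_j(s₀, y) → curl W(s₀)(y)/|curl W(s₀)(y)|`
   and `H_j(s₀) < η` frequently, the limit directions agree on the ball: `curl W(s₀)` is parallel to
   `curl W(s₀)(y₀)` on `B(y₀, r)`.
5. LocalSineTubeDoor's window rigidity `eq_zero_of_aligned_window` (slice analyticity + identity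
   theorem + Giga–Miura's 2D reduction + KNSS planar Liouville) forces `W ≡ 0` — contradiction.

WHAT THIS IS NOT: not NS regularity — a Type-I-CONDITIONAL regularity criterion from print, now a
tree theorem; it does not prove the door W3ᵐᵗ (an a-priori statement about all Leray–Hopf flows) and
leaves the residual hard core NoTypeII (stmt-0056) untouched.

## References
* Y. Giga, H. Miura, Comm. Math. Phys. 303 (2011) 289–300 = HUPS #956: Cor. 2.6, Rmk. 2.7–2.8
  (pp. 9–10), Thm 1.1 (p. 3), §2.1 (pp. 5–9). [GigaMiura2011]
* G. Koch, N. Nadirashvili, G. Seregin, V. Šverák, Acta Math. 203 (2009) 83–105 = arXiv:0709.3599: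
  Prop. 4.1, Lemma 6.1, Thm 5.1, §6. [KochNadirashviliSereginSverak2009]
* H. Beirão da Veiga, L. C. Berselli, Differential Integral Equations 15 (2002) 345–356 (the
  `∇ξ ∈ L^a(L^b)`, `2/a + 3/b = 1/2` criterion quoted in Rmk. 2.8). [BeiraodaVeigaBerselli2002]
-/

section Part11

open _root_.MeasureTheory _root_.Set _root_.Function _root_.Filter _root_.Topology _root_.Metric
open scoped RealInnerProductSpace _root_.ENNReal _root_.NNReal

namespace Literature.Analysis.NavierStokesZoomKit

open Literature.Analysis Literature.Analysis.FluidPDE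
open Literature.Analysis.NavierStokesZoomKit.LocalSineTubeDoorProfileAlignedWindowRigidity

/-! ### The blow-up form and Cor. 2.6 -/

set_option maxHeartbeats 800000 in
/-- **A square-integrable-in-time `L^∞(Ω_d)` bound on `∇ξ` kills Type-I blow-up** (blow-up form
of Giga–Miura 2011, Cor. 2.6). Let `(u, p)` be a classical solution on `ℝ³ × [0, T)`, Leray–Hopf
from `u 0`, bounded on every `[0, T'] × ℝ³` (`T' < T`), with the Type-I rate at `T` and no smooth
extension past `T`, and let `g : ℝ → [0,∞]` be measurable with `∫_{(0,T)} g² < ∞` and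
`‖D(ξ(t))(x)‖ₑ ≤ g t` whenever `t ∈ (0,T)` and `|ω(t,x)| > d` (`d > 0`). Then `False` (steps 1–5
of the module docstring). [cite: GigaMiura2011, Cor. 2.6 with Rmk. 2.7 (§2.1; HUPS preprint #956 p. 9)] -/
theorem false_of_directionGradient_sqIntegrable_typeI {ν T : ℝ} (hν : 0 < ν) (hT : 0 < T)
    {u : ℝ → EuclideanSpace ℝ (Fin 3) → EuclideanSpace ℝ (Fin 3)}
    {p : ℝ → EuclideanSpace ℝ (Fin 3) → ℝ}
    (hsol : IsClassicalNSSolutionOn (Ico 0 T) ν 0 u p) (hLH : IsLerayHopfOn T ν 0 (u 0) u)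
    (hslab : ∀ T' < T, ∃ M : ℝ, ∀ t ∈ Icc 0 T', ∀ x, ‖u t x‖ ≤ M)
    (hI : IsTypeIBlowup u T) (hext : ¬ HasSmoothExtensionPast ν 0 u T)
    {d : ℝ} (hd : 0 < d) {g : ℝ → ℝ≥0∞} (hgm : Measurable g)
    (hg2 : (∫⁻ t in Ioo 0 T, g t ^ 2) < ∞)
    (hDξ : ∀ t ∈ Ioo 0 T, ∀ x : EuclideanSpace ℝ (Fin 3), d < ‖curl (u t) x‖ →
      ‖fderiv ℝ (vorticityDirection (curl (u t))) x‖ₑ ≤ g t) : False := by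
  classical
  -- Step 1: the flexible zoom with locally uniform slice convergence, base times `τ_j = T - T/(j+2)`
  set τ : ℕ → ℝ := fun j => T - T / ((j : ℝ) + 2) with hτdef
  have hτ : ∀ j, τ j ∈ Ico 0 T := fun j => by
    have h2 : (0 : ℝ) < (j : ℝ) + 2 := by positivity
    have h3 : T / ((j : ℝ) + 2) ≤ T := by
      rw [div_le_iff₀ h2]; nlinarith [(Nat.cast_nonneg j : (0 : ℝ) ≤ j)]
    have h4 : 0 < T / ((j : ℝ) + 2) := div_pos hT h2
    simp only [hτdef, mem_Ico]
    constructor <;> linarith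
  have hτT : Tendsto τ atTop (𝓝 T) := by
    have h1 : Tendsto (fun j : ℕ => T / ((j : ℝ) + 2)) atTop (𝓝 0) := by
      have h := (tendsto_one_div_add_atTop_nhds_zero_nat (𝕜 := ℝ)).comp (tendsto_add_atTop_nat 1)
      have h' : Tendsto (fun j : ℕ => T * (1 / ((j : ℝ) + 2))) atTop (𝓝 (T * 0)) := by
        refine (h.congr fun j => ?_).const_mul T
        simp only [comp_apply, Nat.cast_add, Nat.cast_one]
        ring
      rw [mul_zero] at h'
      exact h'.congr fun j => by ring
    have h2 := h1.const_sub T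
    rw [sub_zero] at h2
    exact h2
  obtain ⟨φ, -, C, W, xc, lam, hWcl, hW0, hlam, -, hlam0, -, hflex, hLU⟩ :=
    typeIZoom_ancientMild_limit_flexible_locUnif hν hT hsol hLH hslab hI hext hτ hτT
  have hc : ∀ j, 0 < lam j ^ 2 / ν := fun j => div_pos (pow_pos (hlam j) 2) hν
  have hc0 : Tendsto (fun j => lam j ^ 2 / ν) atTop (𝓝 0) := by
    have h := (hlam0.pow 2).div_const ν
    rw [zero_pow two_ne_zero, zero_div] at h
    exact h
  -- Step 2: a non-unidirectional vorticity end `s < t₁` of `W`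
  obtain ⟨t₁, ht₁, hend⟩ := exists_end_curl_not_unidirectional hWcl ⟨-1, by norm_num, 0, hW0⟩
  have hnz : ∀ s < t₁, ∃ y, curl (W s) y ≠ 0 := by
    intro s hs
    by_contra h
    push Not at h
    have he1 : (EuclideanSpace.single (0 : Fin 3) (1 : ℝ) : EuclideanSpace ℝ (Fin 3)) ≠ 0 := by
      intro h0
      have := congr_arg (fun v : EuclideanSpace ℝ (Fin 3) => v 0) h0
      simp at this
    exact hend s hs ⟨EuclideanSpace.single 0 1, he1, fun y => ⟨0, by rw [h y, zero_smul]⟩⟩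
  -- Step 3: an a.e.-good slice `s₀ ∈ (t₁ - 1, t₁)`: the scaled direction-gradient majorants
  -- `λ_j g(T + λ_j² s₀/ν)` are `< η` frequently in `j`, for every `η > 0` (Fatou on the `L²` tail,
  -- `exists_slice_frequently_lt_of_sqIntegrable`)
  obtain ⟨s₀, hs₀mem, hfreq⟩ := exists_slice_frequently_lt_of_sqIntegrable (T := T) hν hT hgm hg2 hlam
    hlam0 (show t₁ - 1 < t₁ by linarith) ht₁
  have hs₀t₁ : s₀ < t₁ := hs₀mem.2
  have hs₀0 : s₀ < 0 := hs₀t₁.trans ht₁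
  set H : ℕ → ℝ≥0∞ := fun j => ENNReal.ofReal (lam j) * g (T + lam j ^ 2 / ν * s₀) with hHdef
  -- Step 4: the slice `s₀`: a ball on which the limit vorticity stays away from zero
  set Ω : EuclideanSpace ℝ (Fin 3) → EuclideanSpace ℝ (Fin 3) := curl (W s₀) with hΩdef
  obtain ⟨y₀, hy₀⟩ := hnz s₀ hs₀t₁
  have hΩc : Continuous Ω :=
    continuous_curl ((hWcl.contDiff_slice hs₀0).of_le (by exact_mod_cast le_top))
  set m₀ : ℝ := ‖Ω y₀‖ with hm₀def
  have hm₀ : 0 < m₀ := norm_pos_iff.2 hy₀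
  obtain ⟨r, hr, hball⟩ : ∃ r : ℝ, 0 < r ∧ ∀ y ∈ closedBall y₀ r, ‖Ω y - Ω y₀‖ < m₀ / 4 := by
    obtain ⟨δ, hδ, hδ'⟩ := Metric.continuousAt_iff.1 hΩc.continuousAt (m₀ / 4) (by positivity)
    refine ⟨δ / 2, by positivity, fun y hy => ?_⟩
    rw [← dist_eq_norm]
    exact hδ' (lt_of_le_of_lt (mem_closedBall.1 hy) (by linarith))
  have hΩne : ∀ y ∈ closedBall y₀ r, 3 * m₀ / 4 < ‖Ω y‖ := by
    intro y hy
    have h1 := hball y hy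
    have h2 : ‖Ω y₀‖ - ‖Ω y‖ ≤ ‖Ω y - Ω y₀‖ := by
      rw [← norm_neg (Ω y - Ω y₀), neg_sub]; exact norm_sub_norm_le _ _
    linarith
  have hΩne' : ∀ y ∈ closedBall y₀ r, Ω y ≠ 0 := fun y hy => by
    have := hΩne y hy
    exact norm_pos_iff.1 (by linarith)
  -- the vorticity zooms on the slice `s₀`, the physical times and the zoomed direction fields
  set F : ℕ → EuclideanSpace ℝ (Fin 3) → EuclideanSpace ℝ (Fin 3) := fun j y =>
    (lam j ^ 2 / ν) • curl (u (T + lam j ^ 2 * s₀ / ν)) (xc j + lam j • y) with hFdef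
  set tt : ℕ → ℝ := fun j => T + lam j ^ 2 * s₀ / ν with httdef
  have htt : ∀ j, T + lam j ^ 2 / ν * s₀ = tt j := fun j => by rw [httdef]; ring
  set ζ : ℕ → EuclideanSpace ℝ (Fin 3) → EuclideanSpace ℝ (Fin 3) := fun j y =>
    vorticityDirection (curl (u (tt j))) (xc j + lam j • y) with hζdef
  have hU : TendstoUniformlyOn F Ω atTop (closedBall y₀ r) :=
    (tendstoLocallyUniformly_iff_forall_isCompact.1 (hLU s₀ hs₀0)) _ (isCompact_closedBall _ _)
  have hev1 : ∀ᶠ j in atTop, ∀ y ∈ closedBall y₀ r, m₀ / 2 < ‖F j y‖ := by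
    filter_upwards [Metric.tendstoUniformlyOn_iff.1 hU (m₀ / 4) (by positivity)] with j hj y hy
    have h1 := hj y hy
    rw [dist_eq_norm] at h1
    have h2 := hΩne y hy
    have h3 : ‖Ω y‖ ≤ ‖Ω y - F j y‖ + ‖F j y‖ := by
      calc ‖Ω y‖ = ‖(Ω y - F j y) + F j y‖ := by rw [sub_add_cancel]
        _ ≤ ‖Ω y - F j y‖ + ‖F j y‖ := norm_add_le _ _
    linarith
  have hev2 : ∀ᶠ j in atTop, lam j ^ 2 / ν * d < m₀ / 2 := by
    have h1 : Tendsto (fun j => lam j ^ 2 / ν * d) atTop (𝓝 (0 * d)) := hc0.mul_const d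
    rw [zero_mul] at h1
    exact h1.eventually_lt_const (by positivity)
  have hev3 : ∀ᶠ j in atTop, tt j ∈ Ioo 0 T := by
    have h1 : Tendsto (fun j => lam j ^ 2 / ν * (-s₀)) atTop (𝓝 (0 * (-s₀))) := hc0.mul_const _
    rw [zero_mul] at h1
    filter_upwards [h1.eventually_lt_const hT] with j hj
    have h2 : lam j ^ 2 / ν * s₀ < 0 := mul_neg_of_pos_of_neg (hc j) hs₀0
    rw [← htt j]
    exact ⟨by linarith, by linarith⟩
  -- Step 5: on the good indices the zoomed direction field is `H j`-Lipschitz on the ball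
  have hgood : ∀ᶠ j in atTop, ∀ η : ℝ, H j < ENNReal.ofReal η →
      ∀ y ∈ closedBall y₀ r, ‖ζ j y - ζ j y₀‖ ≤ η * r := by
    filter_upwards [hev1, hev2, hev3] with j h1 h2 h3 η hH y hy
    -- `g (tt j)` is finite on a good index
    have hHj : H j = ENNReal.ofReal (lam j) * g (tt j) := by
      simp only [hHdef]; rw [htt j]
    have hlamj : ENNReal.ofReal (lam j) ≠ 0 := (ENNReal.ofReal_pos.2 (hlam j)).ne'
    have hgfin : g (tt j) ≠ ∞ := by
      intro htop
      rw [hHj, htop, ENNReal.mul_top hlamj] at hH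
      exact absurd hH (not_lt.2 le_top)
    have hη0 : (H j).toReal < η := ENNReal.toReal_lt_of_lt_ofReal hH
    have hHreal : (H j).toReal = lam j * (g (tt j)).toReal := by
      rw [hHj, ENNReal.toReal_mul, ENNReal.toReal_ofReal (hlam j).le]
    -- the ball's preimage lies in the top region `Ω_d(tt j)`
    have htop : ∀ z ∈ closedBall y₀ r, d < ‖curl (u (tt j)) (xc j + lam j • z)‖ := by
      intro z hz
      have hF := h1 z hz
      have e : ‖F j z‖ = lam j ^ 2 / ν * ‖curl (u (tt j)) (xc j + lam j • z)‖ := by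
        simp only [hFdef, httdef]
        rw [norm_smul, Real.norm_of_nonneg (hc j).le]
      rw [e] at hF
      exact lt_of_mul_lt_mul_left (h2.trans hF) (hc j).le
    -- differentiability of the direction field there, with the derivative bound
    have hmem : tt j ∈ Ico 0 T := ⟨h3.1.le, h3.2⟩
    have hωdiff : Differentiable ℝ (curl (u (tt j))) :=
      (contDiff_curl (n := 1) ((hsol.contDiff_velocity hmem).of_le (by exact_mod_cast le_top))).differentiable
        (by simp)
    have hξdiff : ∀ z ∈ closedBall y₀ r,
        DifferentiableAt ℝ (vorticityDirection (curl (u (tt j)))) (xc j + lam j • z) := fun z hz =>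
      differentiableAt_vorticityDirection (hωdiff _) (norm_pos_iff.1 (hd.trans (htop z hz)))
    have hξbd : ∀ z ∈ closedBall y₀ r,
        ‖fderiv ℝ (vorticityDirection (curl (u (tt j)))) (xc j + lam j • z)‖ ≤ (g (tt j)).toReal := by
      intro z hz
      have h := ENNReal.toReal_mono hgfin (hDξ (tt j) h3 _ (htop z hz))
      rwa [toReal_enorm] at h
    have hζder : ∀ z ∈ closedBall y₀ r, HasFDerivAt (ζ j)
        ((fderiv ℝ (vorticityDirection (curl (u (tt j)))) (xc j + lam j • z)).comp
          (lam j • ContinuousLinearMap.id ℝ (EuclideanSpace ℝ (Fin 3)))) z := by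
      intro z hz
      have haff : HasFDerivAt (fun y : EuclideanSpace ℝ (Fin 3) => xc j + lam j • y)
          (lam j • ContinuousLinearMap.id ℝ (EuclideanSpace ℝ (Fin 3))) z :=
        ((hasFDerivAt_id z).const_smul (lam j)).const_add (xc j)
      exact (hξdiff z hz).hasFDerivAt.comp z haff
    have hζbd : ∀ z ∈ closedBall y₀ r, ‖fderiv ℝ (ζ j) z‖ ≤ (g (tt j)).toReal * lam j := by
      intro z hz
      rw [(hζder z hz).fderiv]
      refine (ContinuousLinearMap.opNorm_comp_le _ _).trans ?_
      refine mul_le_mul (hξbd z hz) ?_ (norm_nonneg _) ENNReal.toReal_nonneg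
      rw [norm_smul, Real.norm_of_nonneg (hlam j).le]
      have := ContinuousLinearMap.norm_id_le (𝕜 := ℝ) (E := EuclideanSpace ℝ (Fin 3))
      nlinarith [(hlam j).le]
    -- mean value on the convex ball
    have hmv : ‖ζ j y - ζ j y₀‖ ≤ (g (tt j)).toReal * lam j * ‖y - y₀‖ :=
      (convex_closedBall y₀ r).norm_image_sub_le_of_norm_fderiv_le
        (fun z hz => (hζder z hz).differentiableAt) hζbd (mem_closedBall_self hr.le) hy
    have hyr : ‖y - y₀‖ ≤ r := by rw [← dist_eq_norm]; exact mem_closedBall.1 hy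
    have hC : (g (tt j)).toReal * lam j < η := by rw [mul_comm, ← hHreal]; exact hη0
    have hCnn : 0 ≤ (g (tt j)).toReal * lam j := mul_nonneg ENNReal.toReal_nonneg (hlam j).le
    calc ‖ζ j y - ζ j y₀‖ ≤ (g (tt j)).toReal * lam j * ‖y - y₀‖ := hmv
      _ ≤ (g (tt j)).toReal * lam j * r := mul_le_mul_of_nonneg_left hyr hCnn
      _ ≤ η * r := mul_le_mul_of_nonneg_right hC.le hr.le
  -- the zoomed directions converge to the direction of the limit vorticity on the ball
  have hζlim : ∀ y ∈ closedBall y₀ r, Tendsto (fun j => ζ j y) atTop (𝓝 (‖Ω y‖⁻¹ • Ω y)) := by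
    intro y hy
    have hconv : Tendsto (fun j => F j y) atTop (𝓝 (Ω y)) :=
      hflex s₀ hs₀0 (fun _ => s₀) tendsto_const_nhds y
    have hnd : ContinuousAt (fun v : EuclideanSpace ℝ (Fin 3) => ‖v‖⁻¹ • v) (Ω y) :=
      (continuous_norm.continuousAt.inv₀ (norm_ne_zero_iff.2 (hΩne' y hy))).smul continuousAt_id
    refine (hnd.tendsto.comp hconv).congr fun j => ?_
    show ‖F j y‖⁻¹ • F j y = ζ j y
    simp only [hFdef, hζdef, httdef, vorticityDirection_apply]
    exact inv_norm_smul_smul_of_pos (hc j) _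
  -- hence the limit directions agree on the ball
  have hpar : ∀ y ∈ closedBall y₀ r, ‖Ω y‖⁻¹ • Ω y = ‖Ω y₀‖⁻¹ • Ω y₀ := by
    intro y hy
    set D : ℝ := ‖‖Ω y‖⁻¹ • Ω y - ‖Ω y₀‖⁻¹ • Ω y₀‖ with hDdef
    have hDlim : Tendsto (fun j => ‖ζ j y - ζ j y₀‖) atTop (𝓝 D) :=
      ((hζlim y hy).sub (hζlim y₀ (mem_closedBall_self hr.le))).norm
    have hDle : ∀ η : ℝ, 0 < η → D ≤ η * r := by
      intro η hη
      by_contra hlt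
      push Not at hlt
      have hev : ∀ᶠ j in atTop, η * r < ‖ζ j y - ζ j y₀‖ := hDlim.eventually (lt_mem_nhds hlt)
      obtain ⟨j, hj1, hj2, hj3⟩ := ((hfreq η hη).and_eventually (hgood.and hev)).exists
      exact absurd (hj2 η hj1 y hy) (not_le.2 hj3)
    have hD0 : D ≤ 0 := by
      by_contra hpos
      push Not at hpos
      have h := hDle (D / (2 * r)) (by positivity)
      have e : D / (2 * r) * r = D / 2 := by field_simp
      linarith
    have hD00 : D = 0 := le_antisymm hD0 (norm_nonneg _)
    exact sub_eq_zero.1 (norm_eq_zero.1 hD00)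
  -- Step 6: `curl W(s₀)` is parallel to `Ω y₀` on the open ball — window rigidity kills `W`
  have hal : ∀ y ∈ ball y₀ r, cross (curl (W s₀) y) (Ω y₀) = 0 := by
    intro y hy
    have hy' : y ∈ closedBall y₀ r := ball_subset_closedBall hy
    have hΩy : Ω y ≠ 0 := hΩne' y hy'
    have e1 : Ω y = (‖Ω y‖ * ‖Ω y₀‖⁻¹) • Ω y₀ := by
      calc Ω y = ‖Ω y‖ • (‖Ω y‖⁻¹ • Ω y) := by rw [smul_inv_smul₀ (norm_ne_zero_iff.2 hΩy)]
        _ = ‖Ω y‖ • (‖Ω y₀‖⁻¹ • Ω y₀) := by rw [hpar y hy']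
        _ = (‖Ω y‖ * ‖Ω y₀‖⁻¹) • Ω y₀ := by rw [mul_smul]
    show cross (Ω y) (Ω y₀) = 0
    rw [e1]
    ext i
    fin_cases i <;> (simp [cross]; try ring)
  exact hW0 (eq_zero_of_aligned_window hWcl.hasTypeITimeDecay hWcl.continuousOn_uncurry
    (fun s t hst ht' x => hWcl.mild_eq_heatExtension hst ht' x) (fun t ht' => hWcl.isDivFree ht')
    hs₀0 hy₀ isOpen_ball ⟨y₀, mem_ball_self hr⟩ hal (-1) (by norm_num) 0)

/-- **Giga–Miura 2011, Corollary 2.6 — PROVED** (explicit form; the named Literature statement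
`Literature.Analysis.FluidPDE.gigaMiura2011_directionGradient_typeI` is discharged from this by name).
Let `ν > 0`, `T > 0`, and let `(u, p)` be a classical unforced Navier–Stokes solution on
`ℝ³ × [0, T)` which is Leray–Hopf on `[0, T)` and bounded on `ℝ³ × [0, T']` for every `T' < T`, with
a possible blow-up at `T` of Type I (`IsTypeIBlowup u T`). If for some `d > 0` the function
`t ↦ ‖∇ξ(t)‖_{L^∞(Ω_d(t))}` (`Ω_d(t) = {x : |ω(x,t)| > d}`, `ξ = ω/|ω|`) admits a measurable
majorant `g : ℝ → [0, ∞]` with `∫_{(0,T)} g² < ∞` (`‖D(ξ(t))(x)‖ₑ ≤ g t` whenever `t ∈ (0, T)`,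
`|ω(t,x)| > d`), then `u` continues as a classical solution past `T`. Printed for Type I mild
solutions on `ℝ³ × (−1, 0)`, `ν = 1`, hypothesis `∫_{−1}^{0} ‖∇ζ‖²_{L^∞(Ω_d(t))} dt < +∞`.
[cite: GigaMiura2011, Cor. 2.6 with Rmk. 2.7 (§2.1; HUPS preprint #956 p. 9)] -/
theorem hasSmoothExtensionPast_of_directionGradient_sqIntegrable_typeI {ν T : ℝ} (hν : 0 < ν)
    (hT : 0 < T) {u : ℝ → EuclideanSpace ℝ (Fin 3) → EuclideanSpace ℝ (Fin 3)}
    {p : ℝ → EuclideanSpace ℝ (Fin 3) → ℝ}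
    (hsol : IsClassicalNSSolutionOn (Ico 0 T) ν 0 u p) (hLH : IsLerayHopfOn T ν 0 (u 0) u)
    (hbdd : ∀ T' < T, ∃ M : ℝ, ∀ t ∈ Icc 0 T', ∀ x, ‖u t x‖ ≤ M)
    (hI : IsTypeIBlowup u T)
    (hD : ∃ d : ℝ, 0 < d ∧ ∃ g : ℝ → ℝ≥0∞, Measurable g ∧ (∫⁻ t in Ioo 0 T, g t ^ 2) < ∞ ∧
      ∀ t ∈ Ioo 0 T, ∀ x : EuclideanSpace ℝ (Fin 3), d < ‖curl (u t) x‖ →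
        ‖fderiv ℝ (vorticityDirection (curl (u t))) x‖ₑ ≤ g t) :
    HasSmoothExtensionPast ν 0 u T := by
  obtain ⟨d, hd, g, hgm, hg2, hDξ⟩ := hD
  by_contra hext
  exact false_of_directionGradient_sqIntegrable_typeI hν hT hsol hLH hbdd hI hext hd hgm hg2 hDξ

end Literature.Analysis.NavierStokesZoomKit

end Part11

/-!
## Part 12 — port of `Summits/NavierStokesRegularity/NavierStokesRegularity/Theorems/ScaledTopAlignmentDirectionGradientLaLbTools.lean` (3 declarations kept)

# Route `ScaledTopAlignment`: tools for the `L^a(L^b)` direction-gradient criterion (Giga–Miura 2011,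
# Rmk. 2.8: the scaling-invariant family `2/a + 3/b = 1`) — slice selection under an integrable
# majorant, smoothness of the vorticity direction, and the dilation inequality for ball integrals
# (support for the deciding crux W3ᵐᵗ = `AprioriMostTimesBulkAlignment`, stmt-NavierStokesRegularity-19551;
# no import of the route file)

Giga–Miura 2011 (HUPS #956 p. 10, after Cor. 2.6 / Rmk. 2.8): "It is easy to generalize our
assumption in this form with `2/a + 3/b = 1` and `2 ≤ a < ∞`", i.e. Type I +
`∇ζ ∈ L^a(−1, 0; L^b(Ω_d(t)))` excludes blow-up. Under the Type-I zoom `t = T + λ_j² s/ν`,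
`y ↦ x_j + λ_j y`, the `L^b` norm of the gradient of the zoomed direction field over a unit-scale ball
is `≤ λ_j^{1−3/b} ‖∇ξ(t)‖_{L^b(Ω_d(t))}`, and scaling invariance (`a(1 − 3/b) = 2`) turns the `a`-th
power of this bound, integrated in slice time, into a tail of the finite integral
`∫_{(0,T)} ‖∇ξ(t)‖^a_{L^b(Ω_d(t))} dt`. This module supplies the three exponent-free tools the
discharge (`ScaledTopAlignmentGigaMiuraDirectionGradientLaLb`) needs:

* `exists_slice_frequently_lt_of_integrable` — for measurable `Φ ≥ 0` with `∫_{(0,T)} Φ < ∞`,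
  scales `λ_j → 0⁺` and `a < b < 0`, some slice `s₀ ∈ (a, b)` has `λ_j² Φ(T + λ_j² s₀/ν) < ε`
  frequently in `j`, for every `ε > 0` (affine substitution, absolute continuity of the integral,
  Fatou) — the exponent-free form of `exists_slice_frequently_lt_of_sqIntegrable`
  (`ScaledTopAlignmentDirectionGradientSelection`, `Φ = g²`);
* `contDiffAt_vorticityDirection` — `ξ = ω/|ω|` is `Cⁿ` at points where `ω` is `Cⁿ` and non-zero;
* `setLIntegral_ball_comp_add_smul_le` — `∫_{B(y₀,r)} Φ(v + c y) dy ≤ c⁻³ ∫_S Φ` whenever the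
  dilated ball `v + c B(y₀, r)` lies in `S` (`ℝ³`, `c > 0`).
WHAT THIS IS NOT: not NS regularity; measure theory and calculus only.

## References
* Y. Giga, H. Miura, Comm. Math. Phys. 303 (2011) 289–300 = HUPS #956: Cor. 2.6, Rmk. 2.7–2.8
  (pp. 9–10). [GigaMiura2011]
-/

section Part12

open _root_.MeasureTheory _root_.Set _root_.Function _root_.Filter _root_.Topology _root_.Metric
open scoped RealInnerProductSpace _root_.ENNReal _root_.NNReal

namespace Literature.Analysis.NavierStokesZoomKit

open Literature.Analysis Literature.Analysis.FluidPDE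

/-! ### Slice selection under an integrable-in-time majorant -/

/-- **Selection of an a.e. slice (exponent-free form).** Let `Φ : ℝ → [0, ∞]` be measurable with
`∫_{(0,T)} Φ < ∞` (`T > 0`, `ν > 0`), let `λ_j > 0`, `λ_j → 0`, and let `a < b < 0`. Then some slice
`s₀ ∈ (a, b)` has `λ_j² Φ(T + λ_j² s₀/ν) < ε` frequently in `j`, for every `ε > 0`: by the affine
substitution `t = T + λ_j² s/ν`, `∫_{(a,b)} λ_j² Φ(T + λ_j² s/ν) ds = ν ∫_{(T + λ_j² a/ν, T + λ_j² b/ν)} Φ → 0`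
(absolute continuity of the finite integral, `tendsto_setLIntegral_zero`), so
`liminf_j λ_j² Φ(T + λ_j² s/ν) = 0` for a.e. `s ∈ (a, b)` by Fatou (`lintegral_liminf_le'`). [folklore]
[cite: GigaMiura2011, §2 proof of Thm 1.1 / Cor. 2.6 (source of the blow-up argument along the vorticity direction this module implements; this declaration is the cell’s own lemma, NOT a printed statement)] -/
theorem exists_slice_frequently_lt_of_integrable {ν T : ℝ} (hν : 0 < ν) (hT : 0 < T)
    {Φ : ℝ → ℝ≥0∞} (hΦm : Measurable Φ) (hΦ : (∫⁻ t in Ioo 0 T, Φ t) < ∞)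
    {lam : ℕ → ℝ} (hlam : ∀ j, 0 < lam j) (hlam0 : Tendsto lam atTop (𝓝 0))
    {a b : ℝ} (hab : a < b) (hb : b < 0) :
    ∃ s₀ ∈ Ioo a b, ∀ ε : ℝ≥0∞, 0 < ε → ∃ᶠ j in atTop,
      ENNReal.ofReal (lam j) ^ 2 * Φ (T + lam j ^ 2 / ν * s₀) < ε := by
  have hc : ∀ j, 0 < lam j ^ 2 / ν := fun j => div_pos (pow_pos (hlam j) 2) hν
  have hc0 : Tendsto (fun j => lam j ^ 2 / ν) atTop (𝓝 0) := by
    have h := (hlam0.pow 2).div_const ν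
    rw [zero_pow two_ne_zero, zero_div] at h
    exact h
  set H : ℕ → ℝ → ℝ≥0∞ := fun j s => ENNReal.ofReal (lam j) ^ 2 * Φ (T + lam j ^ 2 / ν * s)
    with hHdef
  have hΦc : ∀ j, Measurable fun s : ℝ => Φ (T + lam j ^ 2 / ν * s) := fun j =>
    hΦm.comp ((measurable_id.const_mul (lam j ^ 2 / ν)).const_add T)
  have hHm : ∀ j, Measurable (H j) := fun j => (hΦc j).const_mul _
  -- the change of variables
  have hInt : ∀ j, ∫⁻ s in Ioo a b, H j s =
      ENNReal.ofReal ν * ∫⁻ t in Ioo (T + lam j ^ 2 / ν * a) (T + lam j ^ 2 / ν * b), Φ t := by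
    intro j
    have h3 : ∫⁻ s in Ioo a b, Φ (T + lam j ^ 2 / ν * s) = ENNReal.ofReal (lam j ^ 2 / ν)⁻¹ *
        ∫⁻ t in Ioo (T + lam j ^ 2 / ν * a) (T + lam j ^ 2 / ν * b), Φ t :=
      setLIntegral_Ioo_comp_add_mul (hc j) T a b Φ
    have e2 : ENNReal.ofReal (lam j) ^ 2 * ENNReal.ofReal (lam j ^ 2 / ν)⁻¹ = ENNReal.ofReal ν := by
      rw [← ENNReal.ofReal_pow (hlam j).le, ← ENNReal.ofReal_mul (pow_nonneg (hlam j).le 2)]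
      congr 1
      have hl : lam j ^ 2 ≠ 0 := pow_ne_zero 2 (hlam j).ne'
      rw [div_eq_mul_inv, mul_inv, inv_inv, ← mul_assoc, mul_inv_cancel₀ hl, one_mul]
    simp only [hHdef]
    rw [lintegral_const_mul _ (hΦc j), h3, ← mul_assoc, e2]
  -- the physical windows shrink into `(0, T)` and their length tends to zero
  have hsub : ∀ᶠ j in atTop, Ioo (T + lam j ^ 2 / ν * a) (T + lam j ^ 2 / ν * b) ⊆ Ioo 0 T := by
    have h1 : Tendsto (fun j => lam j ^ 2 / ν * (-a)) atTop (𝓝 (0 * (-a))) := hc0.mul_const _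
    rw [zero_mul] at h1
    filter_upwards [h1.eventually_lt_const hT] with j hj
    intro t ht
    have hb' : lam j ^ 2 / ν * b < 0 := mul_neg_of_pos_of_neg (hc j) hb
    exact ⟨by linarith [ht.1], by linarith [ht.2]⟩
  have hvol : Tendsto (fun j => (volume.restrict (Ioo 0 T))
      (Ioo (T + lam j ^ 2 / ν * a) (T + lam j ^ 2 / ν * b))) atTop (𝓝 0) := by
    have h1 : Tendsto (fun j => ENNReal.ofReal (lam j ^ 2 / ν * (b - a))) atTop
        (𝓝 (ENNReal.ofReal (0 * (b - a)))) := ENNReal.tendsto_ofReal (hc0.mul_const _)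
    rw [zero_mul, ENNReal.ofReal_zero] at h1
    refine tendsto_of_tendsto_of_tendsto_of_le_of_le tendsto_const_nhds h1 (fun _ => zero_le)
      fun j => ?_
    calc (volume.restrict (Ioo 0 T)) (Ioo (T + lam j ^ 2 / ν * a) (T + lam j ^ 2 / ν * b))
        ≤ volume (Ioo (T + lam j ^ 2 / ν * a) (T + lam j ^ 2 / ν * b)) :=
          Measure.le_iff'.1 Measure.restrict_le_self _
      _ = ENNReal.ofReal (lam j ^ 2 / ν * (b - a)) := by
          rw [Real.volume_Ioo]; ring_nf
  have htail : Tendsto (fun j => ∫⁻ t in Ioo (T + lam j ^ 2 / ν * a) (T + lam j ^ 2 / ν * b),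
      Φ t ∂(volume.restrict (Ioo 0 T))) atTop (𝓝 0) :=
    tendsto_setLIntegral_zero (μ := volume.restrict (Ioo 0 T))
      (s := fun j => Ioo (T + lam j ^ 2 / ν * a) (T + lam j ^ 2 / ν * b)) hΦ.ne hvol
  have hL1 : Tendsto (fun j => ∫⁻ s in Ioo a b, H j s) atTop (𝓝 0) := by
    have h1 : Tendsto (fun j => ENNReal.ofReal ν *
        ∫⁻ t in Ioo (T + lam j ^ 2 / ν * a) (T + lam j ^ 2 / ν * b),
          Φ t ∂(volume.restrict (Ioo 0 T))) atTop (𝓝 0) := by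
      have h := ENNReal.Tendsto.const_mul (a := ENNReal.ofReal ν) htail (Or.inr ENNReal.ofReal_ne_top)
      rwa [mul_zero] at h
    refine h1.congr' ?_
    filter_upwards [hsub] with j hj
    rw [hInt j, Measure.restrict_restrict measurableSet_Ioo, inter_eq_self_of_subset_left hj]
  -- Fatou
  have hFatou : ∫⁻ s in Ioo a b, liminf (fun j => H j s) atTop = 0 := by
    refine le_antisymm ?_ zero_le
    calc ∫⁻ s in Ioo a b, liminf (fun j => H j s) atTop
        ≤ liminf (fun j => ∫⁻ s in Ioo a b, H j s) atTop :=
          lintegral_liminf_le' fun j => (hHm j).aemeasurable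
      _ = 0 := hL1.liminf_eq
  have hae0 : ∀ᵐ s ∂(volume.restrict (Ioo a b)), liminf (fun j => H j s) atTop = 0 := by
    have h := (lintegral_eq_zero_iff' (Measurable.liminf fun j => hHm j).aemeasurable).1 hFatou
    filter_upwards [h] with s hs
    simpa using hs
  -- an admissible slice `s₀ ∈ (a, b)`
  have hab0 : volume (Ioo a b) ≠ 0 := by
    rw [Real.volume_Ioo]; exact (ENNReal.ofReal_pos.2 (by linarith)).ne'
  haveI : (ae (volume.restrict (Ioo a b))).NeBot :=
    ae_neBot.2 (by rwa [Ne, Measure.restrict_eq_zero])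
  obtain ⟨s₀, hs₀mem, hs₀⟩ := ((ae_restrict_mem measurableSet_Ioo).and hae0).exists
  refine ⟨s₀, hs₀mem, fun ε hε => ?_⟩
  have hlt : liminf (fun j => H j s₀) atTop < ε := by rw [hs₀]; exact hε
  exact frequently_lt_of_liminf_lt (h := hlt)

/-! ### Smoothness of the vorticity direction away from `ω = 0` -/

/-- The vorticity direction `ξ = ω/|ω|` is `Cⁿ` at every point where `ω` is `Cⁿ` and non-zero
(the norm is smooth away from the origin of an inner product space). [folklore]
[cite: GigaMiura2011, §2 proof of Thm 1.1 / Cor. 2.6 (source of the blow-up argument along the vorticity direction this module implements; this declaration is the cell’s own lemma, NOT a printed statement)] -/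
theorem contDiffAt_vorticityDirection {n : WithTop ℕ∞}
    {ω : EuclideanSpace ℝ (Fin 3) → EuclideanSpace ℝ (Fin 3)} {x : EuclideanSpace ℝ (Fin 3)}
    (hω : ContDiffAt ℝ n ω x) (hx : ω x ≠ 0) :
    ContDiffAt ℝ n (vorticityDirection ω) x := by
  have h1 : ContDiffAt ℝ n (fun y => ‖ω y‖) x := hω.norm ℝ hx
  have h2 : ContDiffAt ℝ n (fun y => ‖ω y‖⁻¹) x := h1.inv (norm_ne_zero_iff.2 hx)
  show ContDiffAt ℝ n (fun y => ‖ω y‖⁻¹ • ω y) x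
  exact h2.smul hω

/-! ### Dilation inequality for ball integrals on `ℝ³` -/

/-- **Dilated ball integrals.** On `ℝ³`, for `c > 0`, `v`, a ball `B(y₀, r)` whose dilate
`v + c B(y₀, r)` lies in a set `S`, and every `Φ : ℝ³ → [0, ∞]`:
`∫_{B(y₀,r)} Φ(v + c y) dy ≤ (c³)⁻¹ ∫_S Φ(x) dx` (substitution `x = v + c y`, Lebesgue measure
scales by `c³`; the tree's `PoincareBall.lintegral_comp_smul_add`). [folklore]
[cite: GigaMiura2011, §2 proof of Thm 1.1 / Cor. 2.6 (source of the blow-up argument along the vorticity direction this module implements; this declaration is the cell’s own lemma, NOT a printed statement)] -/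
theorem setLIntegral_ball_comp_add_smul_le (Φ : EuclideanSpace ℝ (Fin 3) → ℝ≥0∞) {c : ℝ}
    (hc : 0 < c) (v y₀ : EuclideanSpace ℝ (Fin 3)) {r : ℝ} {S : Set (EuclideanSpace ℝ (Fin 3))}
    (hS : MeasurableSet S) (hsub : ∀ y ∈ ball y₀ r, v + c • y ∈ S) :
    ∫⁻ y in ball y₀ r, Φ (v + c • y) ≤ ENNReal.ofReal (c ^ 3)⁻¹ * ∫⁻ x in S, Φ x := by
  have h1 : ∫⁻ y in ball y₀ r, Φ (v + c • y) ≤ ∫⁻ y, S.indicator Φ (c • y + v) := by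
    rw [← lintegral_indicator measurableSet_ball]
    refine lintegral_mono fun y => ?_
    by_cases hy : y ∈ ball y₀ r
    · have hmem : c • y + v ∈ S := by rw [add_comm]; exact hsub y hy
      rw [indicator_of_mem hy, indicator_of_mem hmem, add_comm]
    · rw [indicator_of_notMem hy]; exact zero_le
  refine h1.trans (le_of_eq ?_)
  rw [PoincareBall.lintegral_comp_smul_add (S.indicator Φ) hc.ne' v, lintegral_indicator hS,
    finrank_euclideanSpace_fin, abs_of_nonneg (inv_nonneg.2 (pow_nonneg hc.le 3))]

end Literature.Analysis.NavierStokesZoomKit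

end Part12

/-!
## Part 13 — port of `Summits/NavierStokesRegularity/NavierStokesRegularity/Theorems/ScaledTopAlignmentGigaMiuraDirectionGradientLaLb.lean` (2 declarations kept)

# Route `ScaledTopAlignment`: the scaling-invariant `L^a(L^b)` direction-gradient criterion under
# Type I (Giga–Miura 2011, Rmk. 2.8: `2/a + 3/b = 1`, `2 < a < ∞`) — PROVED in the tree's Leray–Hopf
# frame (support for the deciding crux W3ᵐᵗ = `AprioriMostTimesBulkAlignment`,
# stmt-NavierStokesRegularity-19551; no import of the route file)

Source: Y. Giga, H. Miura, Comm. Math. Phys. **303** (2011) 289–300 [GigaMiura2011] = HUPS #956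
(render `run/shared/lean/pub/ns-regularity-ideate/ns-regularity-ideate-lit/renders/GM11-HokkaidoPreprint956-full/`),
p. 9 Cor. 2.6 (tree: `ScaledTopAlignmentGigaMiuraDirectionGradient`) and p. 10, Rmk. 2.8 (verbatim
up to notation): "In [BB], regularity of a weak solution of (NS) is established under the assumption
that `∫_{−1}^{0} ‖∇ζ‖^a_{L^b(Ω_d(t))}(t) dt < +∞` for `2/a + 3/b = 1/2`. This assumption is not
scaling invariant while ours is scaling invariant. It is easy to generalize our assumption in this
form with `2/a + 3/b = 1` and `2 ≤ a < ∞`." This module proves that generalisation for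
`2 < a < ∞`, `3 < b < ∞`; the endpoint `(a, b) = (2, ∞)` is Cor. 2.6
(`hasSmoothExtensionPast_of_directionGradient_sqIntegrable_typeI`). For `b < ∞` the spatial norm is
an INTEGRAL over the top region — a BULK condition tolerating large `∇ξ` on small sets — and the
time norm is an integral too: among printed direction criteria this family is the closest analogue
of the route's bulk, most-times door W3ᵐᵗ (stmt-19551).

Proof (`false_of_directionGradient_LaLb_typeI`) = the proof of Cor. 2.6 with Morrey's inequality in
place of the mean-value inequality: flexible Type-I zoom with locally uniform slice convergence
(`typeIZoom_ancientMild_limit_flexible_locUnif`) and a non-unidirectional end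
(`exists_end_curl_not_unidirectional`); scaling — on a ball whose zoom preimage lies in `Ω_d(t)` the
zoomed direction field `ζ_j = ξ(t_j, x_j + λ_j ·)` has `‖∇ζ_j‖_{L^b(B)} ≤ λ_j^{1−3/b} G(t_j)` (chain
rule + `setLIntegral_ball_comp_add_smul_le`) and `(λ_j^{1−3/b} G)^a = λ_j² G^a` BECAUSE
`a(1 − 3/b) = 2`, so `exists_slice_frequently_lt_of_integrable` (Fatou on the tail of `∫ G^a`) gives a
slice `s₀` with `λ_j^{1−3/b} G(t_j(s₀)) < η` frequently; Morrey on the ball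
(`Literature.Analysis.FunctionSpaces.morrey_holder_of_convex`, `b > 3 = dim`) makes the limit
direction constant there; LocalSineTubeDoor's `eq_zero_of_aligned_window` kills the limit.
WHAT THIS IS NOT: not NS regularity — a Type-I-CONDITIONAL criterion (a remark of the source made
into a theorem); it does not prove W3ᵐᵗ and leaves the residual NoTypeII (stmt-0056) untouched.

## References
* Y. Giga, H. Miura, Comm. Math. Phys. 303 (2011) 289–300 = HUPS #956: Cor. 2.6, Rmk. 2.7–2.8
  (pp. 9–10). [GigaMiura2011]
* R. A. Adams, *Sobolev Spaces* (1975), Lemma 5.17 (Morrey's inequality on convex cells). [Adams1975]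
-/

section Part13

open _root_.MeasureTheory _root_.Set _root_.Function _root_.Filter _root_.Topology _root_.Metric
open scoped RealInnerProductSpace _root_.ENNReal _root_.NNReal

namespace Literature.Analysis.NavierStokesZoomKit

open Literature.Analysis Literature.Analysis.FluidPDE
open Literature.Analysis.NavierStokesZoomKit.LocalSineTubeDoorProfileAlignedWindowRigidity

set_option maxHeartbeats 1600000 in
/-- **An `L^a(0,T; L^b(Ω_d))` bound on `∇ξ`, `2/a + 3/b = 1`, `3 < b < ∞`, kills Type-I blow-up**
(blow-up form of Giga–Miura 2011, Rmk. 2.8). Let `(u, p)` be a classical solution on `ℝ³ × [0, T)`,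
Leray–Hopf from `u 0`, bounded on every `[0, T'] × ℝ³` (`T' < T`), with the Type-I rate at `T` and no
smooth extension past `T`; let `d > 0`, `3 < b < ∞`, `2/a + 3/b = 1`, and let `G : ℝ → [0,∞]` be
measurable with `∫_{(0,T)} G^a < ∞` and `‖D(ξ(t))‖_{L^b(Ω_d(t))} ≤ G t` for `t ∈ (0,T)`
(`Ω_d(t) = {x : |ω(t,x)| > d}`, `ξ = vorticityDirection (curl (u t))`). Then `False`.
[cite: GigaMiura2011, Rmk. 2.8 with Cor. 2.6 / Rmk. 2.7 (§2.1; HUPS preprint #956 pp. 9–10)] -/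
theorem false_of_directionGradient_LaLb_typeI {ν T : ℝ} (hν : 0 < ν) (hT : 0 < T)
    {u : ℝ → EuclideanSpace ℝ (Fin 3) → EuclideanSpace ℝ (Fin 3)}
    {p : ℝ → EuclideanSpace ℝ (Fin 3) → ℝ}
    (hsol : IsClassicalNSSolutionOn (Ico 0 T) ν 0 u p) (hLH : IsLerayHopfOn T ν 0 (u 0) u)
    (hslab : ∀ T' < T, ∃ M : ℝ, ∀ t ∈ Icc 0 T', ∀ x, ‖u t x‖ ≤ M)
    (hI : IsTypeIBlowup u T) (hext : ¬ HasSmoothExtensionPast ν 0 u T)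
    {d : ℝ} (hd : 0 < d) {a : ℝ} {b : ℝ≥0} (hb3 : 3 < (b : ℝ)) (hab : 2 / a + 3 / (b : ℝ) = 1)
    {G : ℝ → ℝ≥0∞} (hGm : Measurable G) (hGa : (∫⁻ t in Ioo 0 T, G t ^ a) < ∞)
    (hDξ : ∀ t ∈ Ioo 0 T, eLpNorm (fderiv ℝ (vorticityDirection (curl (u t)))) (b : ℝ≥0∞)
      (volume.restrict {x | d < ‖curl (u t) x‖}) ≤ G t) : False := by
  -- exponents: `γ = 1 - 3/b ∈ (0, 1)`, `a γ = 2`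
  have hb0 : (0 : ℝ) < b := by linarith
  set γ : ℝ := 1 - 3 / (b : ℝ) with hγdef
  have hγ0 : 0 < γ := by
    rw [hγdef, sub_pos, div_lt_one hb0]; exact hb3
  have haγ : 2 / a = γ := by rw [hγdef]; linarith
  have hapos : 0 < a := by
    by_contra hle; push Not at hle
    linarith [div_nonpos_of_nonneg_of_nonpos (by norm_num : (0 : ℝ) ≤ 2) hle]
  have hγa : γ * a = 2 := by rw [← haγ]; field_simp
  have hbγ : (b : ℝ) * γ = (b : ℝ) - 3 := by rw [hγdef]; field_simp
  have hb1 : (1 : ℝ≥0) ≤ b := by exact_mod_cast (show (1 : ℝ) ≤ (b : ℝ) by linarith)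
  have hbne0 : ((b : ℝ≥0) : ℝ≥0∞) ≠ 0 := by
    exact_mod_cast (show (b : ℝ≥0) ≠ 0 from fun h => by rw [h] at hb0; simp at hb0)
  have hbtop : ((b : ℝ≥0) : ℝ≥0∞) ≠ ⊤ := ENNReal.coe_ne_top
  have hbreal : ((b : ℝ≥0) : ℝ≥0∞).toReal = (b : ℝ) := ENNReal.coe_toReal b
  classical
  -- Step 1: the flexible zoom with locally uniform slice convergence, base times `τ_j = T - T/(j+2)`
  set τ : ℕ → ℝ := fun j => T - T / ((j : ℝ) + 2) with hτdef
  have hτ : ∀ j, τ j ∈ Ico 0 T := fun j => by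
    have h2 : (0 : ℝ) < (j : ℝ) + 2 := by positivity
    have h3 : T / ((j : ℝ) + 2) ≤ T := div_le_self hT.le (by linarith)
    have h4 : 0 < T / ((j : ℝ) + 2) := div_pos hT h2
    simp only [hτdef, mem_Ico]
    constructor <;> linarith
  have hτT : Tendsto τ atTop (𝓝 T) := by
    have h1 : Tendsto (fun j : ℕ => T / ((j : ℝ) + 2)) atTop (𝓝 0) :=
      tendsto_const_nhds.div_atTop (tendsto_atTop_add_const_right _ _ tendsto_natCast_atTop_atTop)
    have h2 := h1.const_sub T
    rw [sub_zero] at h2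
    exact h2
  obtain ⟨φ, -, C, W, xc, lam, hWcl, hW0, hlam, -, hlam0, -, hflex, hLU⟩ :=
    typeIZoom_ancientMild_limit_flexible_locUnif hν hT hsol hLH hslab hI hext hτ hτT
  have hc : ∀ j, 0 < lam j ^ 2 / ν := fun j => div_pos (pow_pos (hlam j) 2) hν
  have hc0 : Tendsto (fun j => lam j ^ 2 / ν) atTop (𝓝 0) := by
    have h := (hlam0.pow 2).div_const ν
    rw [zero_pow two_ne_zero, zero_div] at h
    exact h
  -- Step 2: a non-unidirectional vorticity end `s < t₁` of `W`
  obtain ⟨t₁, ht₁, hend⟩ := exists_end_curl_not_unidirectional hWcl ⟨-1, by norm_num, 0, hW0⟩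
  have hnz : ∀ s < t₁, ∃ y, curl (W s) y ≠ 0 := fun s hs => by
    by_contra h
    push Not at h
    refine hend s hs ⟨EuclideanSpace.single 0 1, fun h0 => ?_, fun y => ⟨0, by rw [h y, zero_smul]⟩⟩
    simpa using congr_arg (fun v : EuclideanSpace ℝ (Fin 3) => v 0) h0
  -- Step 3: an a.e.-good slice `s₀ ∈ (t₁ - 1, t₁)`: `λ_j² G(T + λ_j² s₀/ν)^a < ε` frequently in `j`,
  -- for every `ε > 0` (Fatou on the tail of `∫ G^a`, `exists_slice_frequently_lt_of_integrable`)
  have hΦm : Measurable fun t => G t ^ a := (ENNReal.continuous_rpow_const.measurable).comp hGm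
  obtain ⟨s₀, hs₀mem, hfreq⟩ := exists_slice_frequently_lt_of_integrable (T := T) hν hT hΦm hGa hlam
    hlam0 (show t₁ - 1 < t₁ by linarith) ht₁
  have hs₀t₁ : s₀ < t₁ := hs₀mem.2
  have hs₀0 : s₀ < 0 := hs₀t₁.trans ht₁
  -- the scaled majorant `Q j = λ_j^γ G(t_j)` and its `a`-th power `λ_j² G(t_j)^a`
  set Q : ℕ → ℝ≥0∞ := fun j => ENNReal.ofReal (lam j ^ γ) * G (T + lam j ^ 2 / ν * s₀) with hQdef
  have hQa : ∀ j, Q j ^ a = ENNReal.ofReal (lam j) ^ 2 * G (T + lam j ^ 2 / ν * s₀) ^ a := by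
    intro j
    simp only [hQdef]
    rw [ENNReal.mul_rpow_of_nonneg _ _ hapos.le,
      ENNReal.ofReal_rpow_of_nonneg (Real.rpow_nonneg (hlam j).le γ) hapos.le,
      ← Real.rpow_mul (hlam j).le, hγa, ← ENNReal.ofReal_pow (hlam j).le]
    norm_num
  have hfreqQ : ∀ η : ℝ, 0 < η → ∃ᶠ j in atTop, Q j < ENNReal.ofReal η := by
    intro η hη
    have hε : (0 : ℝ≥0∞) < ENNReal.ofReal η ^ a := ENNReal.rpow_pos (ENNReal.ofReal_pos.2 hη) ENNReal.ofReal_ne_top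
    refine (hfreq _ hε).mono fun j hj => ?_
    rw [← hQa j] at hj
    by_contra hle
    exact absurd hj (not_lt.2 (ENNReal.rpow_le_rpow (not_lt.1 hle) hapos.le))
  -- Step 4: the slice `s₀`: a ball on which the limit vorticity stays away from zero
  set Ω : EuclideanSpace ℝ (Fin 3) → EuclideanSpace ℝ (Fin 3) := curl (W s₀) with hΩdef
  obtain ⟨y₀, hy₀⟩ := hnz s₀ hs₀t₁
  have hΩc : Continuous Ω :=
    continuous_curl ((hWcl.contDiff_slice hs₀0).of_le (by exact_mod_cast le_top))
  set m₀ : ℝ := ‖Ω y₀‖ with hm₀def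
  have hm₀ : 0 < m₀ := norm_pos_iff.2 hy₀
  obtain ⟨r, hr, hball⟩ : ∃ r : ℝ, 0 < r ∧ ∀ y ∈ closedBall y₀ r, ‖Ω y - Ω y₀‖ < m₀ / 4 := by
    obtain ⟨δ, hδ, hδ'⟩ := Metric.continuousAt_iff.1 hΩc.continuousAt (m₀ / 4) (by positivity)
    refine ⟨δ / 2, by positivity, fun y hy => ?_⟩
    rw [← dist_eq_norm]
    exact hδ' (lt_of_le_of_lt (mem_closedBall.1 hy) (by linarith))
  have hΩne : ∀ y ∈ closedBall y₀ r, 3 * m₀ / 4 < ‖Ω y‖ := fun y hy => by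
    have h2 : ‖Ω y₀‖ - ‖Ω y‖ ≤ ‖Ω y - Ω y₀‖ := by
      rw [← norm_neg (Ω y - Ω y₀), neg_sub]; exact norm_sub_norm_le _ _
    linarith [hball y hy]
  have hΩne' : ∀ y ∈ closedBall y₀ r, Ω y ≠ 0 := fun y hy => norm_pos_iff.1 (by linarith [hΩne y hy])
  -- the vorticity zooms on the slice `s₀`, the physical times and the zoomed direction fields
  set F : ℕ → EuclideanSpace ℝ (Fin 3) → EuclideanSpace ℝ (Fin 3) := fun j y =>
    (lam j ^ 2 / ν) • curl (u (T + lam j ^ 2 * s₀ / ν)) (xc j + lam j • y) with hFdef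
  set tt : ℕ → ℝ := fun j => T + lam j ^ 2 * s₀ / ν with httdef
  have htt : ∀ j, T + lam j ^ 2 / ν * s₀ = tt j := fun j => by rw [httdef]; ring
  set ζ : ℕ → EuclideanSpace ℝ (Fin 3) → EuclideanSpace ℝ (Fin 3) := fun j y =>
    vorticityDirection (curl (u (tt j))) (xc j + lam j • y) with hζdef
  have hU : TendstoUniformlyOn F Ω atTop (closedBall y₀ r) :=
    (tendstoLocallyUniformly_iff_forall_isCompact.1 (hLU s₀ hs₀0)) _ (isCompact_closedBall _ _)
  have hev1 : ∀ᶠ j in atTop, ∀ y ∈ closedBall y₀ r, m₀ / 2 < ‖F j y‖ := by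
    filter_upwards [Metric.tendstoUniformlyOn_iff.1 hU (m₀ / 4) (by positivity)] with j hj y hy
    have h1 := hj y hy
    rw [dist_eq_norm] at h1
    have h3 : ‖Ω y‖ ≤ ‖Ω y - F j y‖ + ‖F j y‖ := by
      calc ‖Ω y‖ = ‖(Ω y - F j y) + F j y‖ := by rw [sub_add_cancel]
        _ ≤ ‖Ω y - F j y‖ + ‖F j y‖ := norm_add_le _ _
    linarith [hΩne y hy]
  have hev2 : ∀ᶠ j in atTop, lam j ^ 2 / ν * d < m₀ / 2 := by
    have h1 : Tendsto (fun j => lam j ^ 2 / ν * d) atTop (𝓝 (0 * d)) := hc0.mul_const d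
    rw [zero_mul] at h1
    exact h1.eventually_lt_const (by positivity)
  have hev3 : ∀ᶠ j in atTop, tt j ∈ Ioo 0 T := by
    have h1 : Tendsto (fun j => lam j ^ 2 / ν * (-s₀)) atTop (𝓝 (0 * (-s₀))) := hc0.mul_const _
    rw [zero_mul] at h1
    filter_upwards [h1.eventually_lt_const hT] with j hj
    have h2 : lam j ^ 2 / ν * s₀ < 0 := mul_neg_of_pos_of_neg (hc j) hs₀0
    rw [← htt j]
    exact ⟨by linarith, by linarith⟩
  -- Step 5: Morrey's inequality on the ball `B(y₀, r)` (`b > 3 = dim`), constant `Cm` independent of `j`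
  have hfr : (Module.finrank ℝ (EuclideanSpace ℝ (Fin 3)) : ℝ) < (b : ℝ) := by
    rw [finrank_euclideanSpace_fin]; push_cast; linarith
  obtain ⟨Cm, hCm, hMor⟩ := Literature.Analysis.FunctionSpaces.morrey_holder_of_convex
    (volume : Measure (EuclideanSpace ℝ (Fin 3))) (F := EuclideanSpace ℝ (Fin 3)) hb1 hfr isOpen_ball
    (convex_ball y₀ r) hr (Subset.refl (ball y₀ r)) (Subset.refl (ball y₀ r))
  -- the real constant of the final estimate
  set K : ℝ := (Cm * ENNReal.ofReal r ^ γ).toReal with hKdef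
  have hK0 : 0 ≤ K := ENNReal.toReal_nonneg
  have hgood : ∀ᶠ j in atTop, ∀ η : ℝ, 0 < η → Q j < ENNReal.ofReal η →
      ∀ y ∈ ball y₀ r, ‖ζ j y - ζ j y₀‖ ≤ η * K := by
    filter_upwards [hev1, hev2, hev3] with j h1 h2 h3 η hη hQ y hy
    -- the closed ball's preimage lies in the top region `Ω_d(tt j)`
    have htop : ∀ z ∈ closedBall y₀ r, d < ‖curl (u (tt j)) (xc j + lam j • z)‖ := by
      intro z hz
      have hF := h1 z hz
      have e : ‖F j z‖ = lam j ^ 2 / ν * ‖curl (u (tt j)) (xc j + lam j • z)‖ := by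
        simp only [hFdef, httdef]
        rw [norm_smul, Real.norm_of_nonneg (hc j).le]
      rw [e] at hF
      exact lt_of_mul_lt_mul_left (h2.trans hF) (hc j).le
    have hmem : tt j ∈ Ico 0 T := ⟨h3.1.le, h3.2⟩
    -- smoothness of `ξ` at the preimage points, and of `ζ j` on the ball
    have hωcd : ContDiff ℝ 1 (curl (u (tt j))) :=
      contDiff_curl (n := 1) ((hsol.contDiff_velocity hmem).of_le (by exact_mod_cast le_top))
    have hωdiff : Differentiable ℝ (curl (u (tt j))) := hωcd.differentiable (by simp)
    have hξcd : ∀ z ∈ closedBall y₀ r,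
        ContDiffAt ℝ 1 (vorticityDirection (curl (u (tt j)))) (xc j + lam j • z) := fun z hz =>
      contDiffAt_vorticityDirection hωcd.contDiffAt (norm_pos_iff.1 (hd.trans (htop z hz)))
    have haffcd : ContDiff ℝ 1 (fun y : EuclideanSpace ℝ (Fin 3) => xc j + lam j • y) :=
      contDiff_const.add (contDiff_id.const_smul _)
    have hζcd : ContDiffOn ℝ 1 (ζ j) (ball y₀ r) := by
      intro z hz
      have h1 := (hξcd z (ball_subset_closedBall hz)).comp z haffcd.contDiffAt
      exact h1.contDiffWithinAt
    -- the chain rule: `‖D(ζ j)(z)‖ₑ ≤ λ_j ‖Dξ(x_j + λ_j z)‖ₑ` on the closed ball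
    have hζder : ∀ z ∈ closedBall y₀ r, HasFDerivAt (ζ j)
        ((fderiv ℝ (vorticityDirection (curl (u (tt j)))) (xc j + lam j • z)).comp
          (lam j • ContinuousLinearMap.id ℝ (EuclideanSpace ℝ (Fin 3)))) z := by
      intro z hz
      have haff : HasFDerivAt (fun y : EuclideanSpace ℝ (Fin 3) => xc j + lam j • y)
          (lam j • ContinuousLinearMap.id ℝ (EuclideanSpace ℝ (Fin 3))) z :=
        ((hasFDerivAt_id z).const_smul (lam j)).const_add (xc j)
      exact ((hξcd z hz).differentiableAt (by simp)).hasFDerivAt.comp z haff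
    have hζbd : ∀ z ∈ closedBall y₀ r, ‖fderiv ℝ (ζ j) z‖ₑ ≤ ENNReal.ofReal (lam j) *
        ‖fderiv ℝ (vorticityDirection (curl (u (tt j)))) (xc j + lam j • z)‖ₑ := by
      intro z hz
      rw [(hζder z hz).fderiv, ← ofReal_norm, ← ofReal_norm,
        ← ENNReal.ofReal_mul (hlam j).le]
      refine ENNReal.ofReal_le_ofReal ((ContinuousLinearMap.opNorm_comp_le _ _).trans ?_)
      rw [mul_comm]
      refine mul_le_mul_of_nonneg_right ?_ (norm_nonneg _)
      rw [norm_smul, Real.norm_of_nonneg (hlam j).le]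
      have := ContinuousLinearMap.norm_id_le (𝕜 := ℝ) (E := EuclideanSpace ℝ (Fin 3))
      nlinarith [(hlam j).le]
    -- the `L^b` norm of `D(ζ j)` over the ball: `≤ λ_j^γ G(tt j) = Q j`
    have hΩmeas : MeasurableSet {x : EuclideanSpace ℝ (Fin 3) | d < ‖curl (u (tt j)) x‖} :=
      (isOpen_lt continuous_const (hωcd.continuous.norm)).measurableSet
    have hLb : eLpNorm (fderiv ℝ (ζ j)) (b : ℝ≥0∞) (volume.restrict (ball y₀ r)) ≤ Q j := by
      rw [eLpNorm_eq_lintegral_rpow_enorm_toReal hbne0 hbtop, hbreal]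
      -- the integral of the `b`-th powers
      have hI1 : ∫⁻ z in ball y₀ r, ‖fderiv ℝ (ζ j) z‖ₑ ^ (b : ℝ) ≤
          ENNReal.ofReal (lam j) ^ (b : ℝ) * (ENNReal.ofReal (lam j ^ 3)⁻¹ *
            ∫⁻ x in {x | d < ‖curl (u (tt j)) x‖},
              ‖fderiv ℝ (vorticityDirection (curl (u (tt j)))) x‖ₑ ^ (b : ℝ)) := by
        calc ∫⁻ z in ball y₀ r, ‖fderiv ℝ (ζ j) z‖ₑ ^ (b : ℝ)
            ≤ ∫⁻ z in ball y₀ r, ENNReal.ofReal (lam j) ^ (b : ℝ) *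
                ‖fderiv ℝ (vorticityDirection (curl (u (tt j)))) (xc j + lam j • z)‖ₑ ^ (b : ℝ) := by
              refine setLIntegral_mono' measurableSet_ball fun z hz => ?_
              rw [← ENNReal.mul_rpow_of_nonneg _ _ hb0.le]
              exact ENNReal.rpow_le_rpow (hζbd z (ball_subset_closedBall hz)) hb0.le
          _ = ENNReal.ofReal (lam j) ^ (b : ℝ) * ∫⁻ z in ball y₀ r,
                ‖fderiv ℝ (vorticityDirection (curl (u (tt j)))) (xc j + lam j • z)‖ₑ ^ (b : ℝ) :=
              lintegral_const_mul' _ _ (ENNReal.rpow_ne_top_of_nonneg hb0.le ENNReal.ofReal_ne_top)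
          _ ≤ _ := by
              refine mul_le_mul' le_rfl ?_
              exact setLIntegral_ball_comp_add_smul_le
                (fun x => ‖fderiv ℝ (vorticityDirection (curl (u (tt j)))) x‖ₑ ^ (b : ℝ)) (hlam j)
                (xc j) y₀ hΩmeas (fun z hz => htop z (ball_subset_closedBall hz))
      -- the top-region integral is `(‖Dξ‖_{L^b(Ω_d)})^b ≤ G(tt j)^b`
      have hI2 : ∫⁻ x in {x | d < ‖curl (u (tt j)) x‖},
          ‖fderiv ℝ (vorticityDirection (curl (u (tt j)))) x‖ₑ ^ (b : ℝ) ≤ G (tt j) ^ (b : ℝ) := by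
        have h := hDξ (tt j) h3
        rw [eLpNorm_eq_lintegral_rpow_enorm_toReal hbne0 hbtop, hbreal] at h
        have h' := ENNReal.rpow_le_rpow h hb0.le
        rwa [← ENNReal.rpow_mul, one_div, inv_mul_cancel₀ hb0.ne', ENNReal.rpow_one] at h'
      -- assemble: `∫ ≤ (Q j)^b`, then take the `1/b`-th power
      have hQb : Q j ^ (b : ℝ) = ENNReal.ofReal (lam j) ^ (b : ℝ) * ENNReal.ofReal (lam j ^ 3)⁻¹ *
          G (tt j) ^ (b : ℝ) := by
        have hreal_id : lam j ^ ((b : ℝ) - 3) = lam j ^ (b : ℝ) * (lam j ^ 3)⁻¹ := by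
          rw [Real.rpow_sub (hlam j), div_eq_mul_inv,
            show ((3 : ℝ)) = ((3 : ℕ) : ℝ) by norm_num, Real.rpow_natCast]
        simp only [hQdef]
        rw [htt j, ENNReal.mul_rpow_of_nonneg _ _ hb0.le]
        congr 1
        rw [ENNReal.ofReal_rpow_of_nonneg (Real.rpow_nonneg (hlam j).le γ) hb0.le,
          ← Real.rpow_mul (hlam j).le, mul_comm γ, hbγ, hreal_id,
          ENNReal.ofReal_mul (Real.rpow_nonneg (hlam j).le _), ENNReal.ofReal_rpow_of_pos (hlam j),
          ENNReal.ofReal_inv_of_pos (pow_pos (hlam j) 3)]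
      have hIQ : ∫⁻ z in ball y₀ r, ‖fderiv ℝ (ζ j) z‖ₑ ^ (b : ℝ) ≤ Q j ^ (b : ℝ) := by
        rw [hQb, mul_assoc]
        exact hI1.trans (mul_le_mul' le_rfl (mul_le_mul' le_rfl hI2))
      calc (∫⁻ z in ball y₀ r, ‖fderiv ℝ (ζ j) z‖ₑ ^ (b : ℝ)) ^ (1 / (b : ℝ))
          ≤ (Q j ^ (b : ℝ)) ^ (1 / (b : ℝ)) := ENNReal.rpow_le_rpow hIQ (by positivity)
        _ = Q j := by rw [one_div, ENNReal.rpow_rpow_inv hb0.ne']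
    -- Morrey on the ball
    have hMy : ‖ζ j y - ζ j y₀‖ₑ ≤ Cm * Q j * ENNReal.ofReal r ^ γ := by
      have h := hMor hζcd hy (mem_ball_self hr)
      refine h.trans ?_
      have hed : edist y y₀ ^ (1 - (Module.finrank ℝ (EuclideanSpace ℝ (Fin 3)) : ℝ) / (b : ℝ)) ≤
          ENNReal.ofReal r ^ γ := by
        rw [finrank_euclideanSpace_fin]
        push_cast
        refine ENNReal.rpow_le_rpow ?_ hγ0.le
        rw [edist_dist]
        exact ENNReal.ofReal_le_ofReal (mem_ball.1 hy).le
      exact mul_le_mul' (mul_le_mul' le_rfl hLb) hed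
    -- the real form with `Q j < η`
    have hfin : Cm * ENNReal.ofReal η * ENNReal.ofReal r ^ γ ≠ ⊤ :=
      ENNReal.mul_ne_top (ENNReal.mul_ne_top hCm.ne ENNReal.ofReal_ne_top)
        (ENNReal.rpow_ne_top_of_nonneg hγ0.le ENNReal.ofReal_ne_top)
    have hMy' : ‖ζ j y - ζ j y₀‖ₑ ≤ Cm * ENNReal.ofReal η * ENNReal.ofReal r ^ γ :=
      hMy.trans (mul_le_mul' (mul_le_mul' le_rfl hQ.le) le_rfl)
    have hreal : (Cm * ENNReal.ofReal η * ENNReal.ofReal r ^ γ).toReal = η * K := by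
      rw [hKdef, mul_assoc, mul_comm (ENNReal.ofReal η), ← mul_assoc, ENNReal.toReal_mul,
        ENNReal.toReal_ofReal hη.le, mul_comm]
    have hfinal := ENNReal.toReal_mono hfin hMy'
    rw [toReal_enorm, hreal] at hfinal
    exact hfinal
  -- the zoomed directions converge to the direction of the limit vorticity on the ball
  have hζlim : ∀ y ∈ closedBall y₀ r, Tendsto (fun j => ζ j y) atTop (𝓝 (‖Ω y‖⁻¹ • Ω y)) := by
    intro y hy
    have hconv : Tendsto (fun j => F j y) atTop (𝓝 (Ω y)) :=
      hflex s₀ hs₀0 (fun _ => s₀) tendsto_const_nhds y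
    have hnd : ContinuousAt (fun v : EuclideanSpace ℝ (Fin 3) => ‖v‖⁻¹ • v) (Ω y) :=
      (continuous_norm.continuousAt.inv₀ (norm_ne_zero_iff.2 (hΩne' y hy))).smul continuousAt_id
    refine (hnd.tendsto.comp hconv).congr fun j => ?_
    show ‖F j y‖⁻¹ • F j y = ζ j y
    simp only [hFdef, hζdef, httdef, vorticityDirection_apply]
    exact inv_norm_smul_smul_of_pos (hc j) _
  -- hence the limit directions agree on the ball
  have hpar : ∀ y ∈ ball y₀ r, ‖Ω y‖⁻¹ • Ω y = ‖Ω y₀‖⁻¹ • Ω y₀ := by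
    intro y hy
    have hy' : y ∈ closedBall y₀ r := ball_subset_closedBall hy
    set D : ℝ := ‖‖Ω y‖⁻¹ • Ω y - ‖Ω y₀‖⁻¹ • Ω y₀‖ with hDdef
    have hDlim : Tendsto (fun j => ‖ζ j y - ζ j y₀‖) atTop (𝓝 D) :=
      ((hζlim y hy').sub (hζlim y₀ (mem_closedBall_self hr.le))).norm
    have hDle : ∀ η : ℝ, 0 < η → D ≤ η * K := fun η hη => by
      by_contra hlt
      have hev : ∀ᶠ j in atTop, η * K < ‖ζ j y - ζ j y₀‖ := hDlim.eventually (lt_mem_nhds (not_le.1 hlt))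
      obtain ⟨j, hj1, hj2, hj3⟩ := ((hfreqQ η hη).and_eventually (hgood.and hev)).exists
      exact absurd (hj2 η hη hj1 y hy) (not_le.2 hj3)
    have hD0 : D ≤ 0 := by
      by_contra hpos
      push Not at hpos
      have e : D / (2 * (K + 1)) * K ≤ D / 2 := by
        rw [div_mul_eq_mul_div, div_le_div_iff₀ (by positivity) (by positivity)]
        nlinarith
      linarith [hDle (D / (2 * (K + 1))) (by positivity)]
    exact sub_eq_zero.1 (norm_eq_zero.1 (le_antisymm hD0 (norm_nonneg _)))
  -- Step 6: `curl W(s₀)` is parallel to `Ω y₀` on the open ball — window rigidity kills `W`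
  have hal : ∀ y ∈ ball y₀ r, cross (curl (W s₀) y) (Ω y₀) = 0 := by
    intro y hy
    have hy' : y ∈ closedBall y₀ r := ball_subset_closedBall hy
    have hΩy : Ω y ≠ 0 := hΩne' y hy'
    have e1 : Ω y = (‖Ω y‖ * ‖Ω y₀‖⁻¹) • Ω y₀ := by
      calc Ω y = ‖Ω y‖ • (‖Ω y‖⁻¹ • Ω y) := by rw [smul_inv_smul₀ (norm_ne_zero_iff.2 hΩy)]
        _ = ‖Ω y‖ • (‖Ω y₀‖⁻¹ • Ω y₀) := by rw [hpar y hy]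
        _ = (‖Ω y‖ * ‖Ω y₀‖⁻¹) • Ω y₀ := by rw [mul_smul]
    show cross (Ω y) (Ω y₀) = 0
    rw [e1]
    ext i
    fin_cases i <;> (simp [cross]; try ring)
  exact hW0 (eq_zero_of_aligned_window hWcl.hasTypeITimeDecay hWcl.continuousOn_uncurry
    (fun s t hst ht' x => hWcl.mild_eq_heatExtension hst ht' x) (fun t ht' => hWcl.isDivFree ht')
    hs₀0 hy₀ isOpen_ball ⟨y₀, mem_ball_self hr⟩ hal (-1) (by norm_num) 0)

/-- **Giga–Miura 2011, Rmk. 2.8 (the scaling-invariant family `∇ζ ∈ L^a(L^b(Ω_d))`,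
`2/a + 3/b = 1`, exponents `2 < a < ∞`, `3 < b < ∞`) — PROVED.** Let `ν > 0`, `T > 0`, and let
`(u, p)` be a classical unforced Navier–Stokes solution on `ℝ³ × [0, T)` which is Leray–Hopf on
`[0, T)` and bounded on `ℝ³ × [0, T']` for every `T' < T`, with a possible blow-up at `T` of Type I
(`IsTypeIBlowup u T`). If for some `d > 0`, some `3 < b < ∞` and `a` with `2/a + 3/b = 1`, the
function `t ↦ ‖∇ξ(t)‖_{L^b(Ω_d(t))}` (`Ω_d(t) = {x : |ω(x,t)| > d}`, `ξ = ω/|ω|`, operator norm of the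
Fréchet derivative, `eLpNorm … b (volume.restrict Ω_d(t))`) admits a measurable majorant `G` with
`∫_{(0,T)} G^a < ∞`, then `u` continues as a classical solution past `T`. The endpoint
`(a, b) = (2, ∞)` is Cor. 2.6 (`hasSmoothExtensionPast_of_directionGradient_sqIntegrable_typeI`).
Printed only as a remark ("It is easy to generalize our assumption in this form with `2/a + 3/b = 1`
and `2 ≤ a < ∞`", HUPS #956 p. 10); proved by the Type-I zoom, Morrey and window rigidity.
[cite: GigaMiura2011, Rmk. 2.8 with Cor. 2.6 / Rmk. 2.7 (§2.1; HUPS preprint #956 pp. 9–10)] -/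
theorem hasSmoothExtensionPast_of_directionGradient_LaLb_typeI {ν T : ℝ} (hν : 0 < ν) (hT : 0 < T)
    {u : ℝ → EuclideanSpace ℝ (Fin 3) → EuclideanSpace ℝ (Fin 3)}
    {p : ℝ → EuclideanSpace ℝ (Fin 3) → ℝ}
    (hsol : IsClassicalNSSolutionOn (Ico 0 T) ν 0 u p) (hLH : IsLerayHopfOn T ν 0 (u 0) u)
    (hbdd : ∀ T' < T, ∃ M : ℝ, ∀ t ∈ Icc 0 T', ∀ x, ‖u t x‖ ≤ M)
    (hI : IsTypeIBlowup u T) {a : ℝ} {b : ℝ≥0} (hb3 : 3 < (b : ℝ)) (hab : 2 / a + 3 / (b : ℝ) = 1)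
    (hD : ∃ d : ℝ, 0 < d ∧ ∃ G : ℝ → ℝ≥0∞, Measurable G ∧ (∫⁻ t in Ioo 0 T, G t ^ a) < ∞ ∧
      ∀ t ∈ Ioo 0 T, eLpNorm (fderiv ℝ (vorticityDirection (curl (u t)))) (b : ℝ≥0∞)
        (volume.restrict {x | d < ‖curl (u t) x‖}) ≤ G t) :
    HasSmoothExtensionPast ν 0 u T := by
  obtain ⟨d, hd, G, hGm, hGa, hDξ⟩ := hD
  by_contra hext
  exact false_of_directionGradient_LaLb_typeI hν hT hsol hLH hbdd hI hext hd hb3 hab hGm hGa hDξ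

end Literature.Analysis.NavierStokesZoomKit

end Part13

/-! ## Part 14 — the EXACT discharges -/

namespace Literature.Analysis.FluidPDE

open Literature.Analysis in
/-- **The named fact `gigaMiura2011_directionGradient_typeI` HOLDS** (`GigaMiura2011DirectionGradientCriterion.lean`; Giga–Miura 2011
Cor. 2.6 with Rmk. 2.7: a square-integrable-in-time `L^∞` bound on `∇ξ` over the top region excludes Type I blow-up).  EXACT-name
proof term of the last Part's `NavierStokesZoomKit.hasSmoothExtensionPast_of_directionGradient_sqIntegrable_typeI`, Literature-side twin of
`Summit.NavierStokesRegularity.NavierStokesRegularity.Theorems.gigaMiura2011_directionGradient_typeI_holds` (same proof).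
[cite: GigaMiura2011, Cor. 2.6 with Rmk. 2.7 (§2.1; HUPS preprint #956 p. 9)] -/
theorem gigaMiura2011_directionGradient_typeI_holds : gigaMiura2011_directionGradient_typeI := by
  intro ν T hν hT u p hsol hLH hbdd hI hD
  exact NavierStokesZoomKit.hasSmoothExtensionPast_of_directionGradient_sqIntegrable_typeI hν hT hsol hLH hbdd hI hD

/-- **The named fact `gigaMiura2011_directionGradient_LaLb_typeI` HOLDS** (the `L^a_t L^b_x`, `2/a + 3/b = 1` member of the family,
Rmk. 2.8).  EXACT-name restatement, Literature-side twin of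
`Summit.NavierStokesRegularity.NavierStokesRegularity.Theorems.gigaMiura2011_directionGradient_LaLb_typeI_holds` (same proof).
[cite: GigaMiura2011, Cor. 2.6 with Rmk. 2.7–2.8 (§2.1)] -/
theorem gigaMiura2011_directionGradient_LaLb_typeI_holds : gigaMiura2011_directionGradient_LaLb_typeI := by
  intro ν T hν hT u p hsol hLH hbdd hI a b hb3 hab hD
  exact NavierStokesZoomKit.hasSmoothExtensionPast_of_directionGradient_LaLb_typeI hν hT hsol hLH hbdd hI hb3 hab hD

end Literature.Analysis.FluidPDE

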